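import Literature.MathematicalPhysics.QuantumFieldTheory.Balaban1983to89.B9SectBCodedChainR5
import Literature.MathematicalPhysics.QuantumFieldTheory.Balaban1983to89.B9SectBE4H2GFrameV6
import Literature.MathematicalPhysics.QuantumFieldTheory.Balaban1983to89.B9SectBCodedChainR4
import Literature.MathematicalPhysics.QuantumFieldTheory.Balaban1983to89.B9SectBE4H2GFrameCodedY
import Literature.MathematicalPhysics.QuantumFieldTheory.Balaban1983to89.B9SectBCodedClassR
import Literature.MathematicalPhysics.QuantumFieldTheory.Balaban1983to89.B9SectBCodedChainR3
import Literature.MathematicalPhysics.QuantumFieldTheory.Balaban1983to89.B9Ineq386RightEntry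
import Literature.MathematicalPhysics.QuantumFieldTheory.Balaban1983to89.Node00.OpsYDeltaA
import Literature.MathematicalPhysics.QuantumFieldTheory.Balaban1983to89.B9SectBGStepCodedF
import Literature.MathematicalPhysics.QuantumFieldTheory.Balaban1983to89.B9Ineq347BondReadingY
import Literature.MathematicalPhysics.QuantumFieldTheory.Balaban1983to89.B9SectBStepPosFamilyTransfer
import Literature.MathematicalPhysics.QuantumFieldTheory.Balaban1983to89.B9SectBGStepCodedFGlob
import Literature.MathematicalPhysics.QuantumFieldTheory.Balaban1983to89.B9Ineq344LocalPairHolds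
import Literature.MathematicalPhysics.QuantumFieldTheory.Balaban1983to89.B9SectBH2FrameCodedY
import Literature.MathematicalPhysics.QuantumFieldTheory.Balaban1983to89.B9Thm311PosAtRecordV4
import Literature.MathematicalPhysics.QuantumFieldTheory.Balaban1983to89.B9SectBKerStepParSymY
import Literature.MathematicalPhysics.QuantumFieldTheory.Balaban1983to89.B9SectBKerStepRecordReduction

/-!
# `Balaban1983to89.B9SectBCodedChainR6` — CASCADE-R BUNDLE 6∕7 (director-ym №279 GO-R; №277 (3) `hunitA` cure): the class-parametric twins
# `B9SectBE4H2GFrameCodedYR`, `B9SectBGStepCodedFR`, `B9SectBGStepCodedFGlobR`, `B9SectBH2FrameCodedYR`, `B9SectBKerStepParSymYR`, `B9SectBKerStepRecordReductionR`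

statement-level skeleton of published theorems with citation tags; proofs where landed; nothing here is a claim about the
Yang–Mills mass gap

WHY A BUNDLE.  The minimal R-sub-path of №279 (3) is a 47-module dependency chain; post-accept olean builds are the latency of record today, so the
chain is filed as 7 layered modules instead of 47.  This module is the VERBATIM concatenation, in dependency order, of the 6 generated twin files
named above (each keeps its own namespace `…<Original>R`, its own honest twin header and a pointer to the original module documentation; consumers `open` the
namespaces exactly as they would the per-file twins).  Generated by dag-n06-c g16 (`mkbundle.py`, HOME `pub-ymgap-dag-n06-c/lean/g16/`).

v1.1 — DOC-ONLY EDITION (№288 (4) HEADER AUDIT; ref-E READ-9∕13 species HEADER-NIT; lit-balaban-r06 numerals).  No Lean token outside comments changes (every declaration byte-identical to v1).  The generator sentence «specialises definitionally ∕ VERBATIM» was FALSE for the declarations carrying the №277 re-keyed `hunitA` — here: `B9SectBE4H2GFrameCodedYR`: `e4h2GFrame₆CodedOn`, `stepE4Pos_KACU_frame_on`, `stepH2Pos_KACU_frame_on`; `B9SectBGStepCodedFR`: `stepEPos_KACU_of_385`; `B9SectBGStepCodedFGlobR`: `stepGlobPos_KACU_of_385` — (weaker hypothesis: the twin IMPLIES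 the original at `P := extraY 𝔸 G` via `fun j α₀ U hU => hunitA j U hU.1.1`); their twin headers now say so, the others (`B9SectBH2FrameCodedYR`, `B9SectBKerStepParSymYR`, `B9SectBKerStepRecordReductionR`) mark the clause idle.  CAVEAT OF RECORD (LOCATED-18, director-ym №290 (1)): that class-keyed `hunitA` has no α₀-threshold and is uninhabitable at `SU(N)` as typed (certificate `B9Thm311ClassKeyedHunitANotInhabited`); the GUARDED twins `B9SectBCodedChainRG1∕RG2` ∕ `B9SectBStepUGuardedR` are the consumable objects.

HONEST SCOPE.  Re-typing bookkeeping; nothing of [B9] asserted beyond the originals; COUNT-NEUTRAL; N06 NOT discharged; nothing continuum ∕ OS ∕ mass gap ∕ Clay.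
-/

/-!
# `Balaban1983to89.B9SectBE4H2GFrameCodedYR` — THE CLASS-PARAMETRIC TWIN of `B9SectBE4H2GFrameCodedY` (CASCADE-R, director-ym №279 GO-R; №277 (3) `hunitA` cure; dag-n06-d SOCKET-(α) class question)

statement-level skeleton of published theorems with citation tags; proofs where landed; nothing here is a claim about the
Yang–Mills mass gap

WHAT THIS FILE IS.  The original module `B9SectBE4H2GFrameCodedY` types its objects over MODULE 3's member carrier `bg9Y 𝔸 G x` (MODULE 2's small-cube class (3.35)).  This file RE-DECLARES, with UNCHANGED NAMES inside the namespace `…B9SectBE4H2GFrameCodedYR`, exactly its 4 class-dependent declarations over the CLASS-PARAMETRIC carrier `B9SectBCodedClassR.bg9YC 𝔸 G P x` (`P : RegExtraY …` = the two cube conditions of (3.35)∕(3.36) as a parameter; `bg9Y 𝔸 G x = bg9YC 𝔸 G (extraY 𝔸 G) x` by `rfl`, so every declaration here WITHOUT the `hunitA` binder specialises definitionally to its original; EXCEPTION (v1.1, №288 (4), ref-E READ-9∕13 species HEADER-NIT): `e4h2GFrame₆CodedOn`, `stepE4Pos_KACU_frame_on`, `stepH2Pos_KACU_frame_on` carry the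 №277 RE-KEYED `hunitA` (WEAKER hypothesis), so at `P := extraY 𝔸 G` they IMPLY the originals via `fun j α₀ U hU => hunitA j U hU.1.1` (ref-E K3), NOT a definitional specialisation; CAVEAT (LOCATED-18, №290 (1)): no α₀-threshold ⇒ still uninhabitable at `SU(N)` — consumers use the GUARDED `…RG` twin; at the record's reading of PRINT's class, `P := extraYPb 𝔸 G`, the displayed laws `hreg335P` ((3.35) on plaquettes) and the class-keyed `hunitA` become theorems).  The text is the original's VERBATIM under the token surgery `bg9Y 𝔸 G ↦ bg9YC 𝔸 G P`, `NAME ↦ NAME P` for the class-dependent names (P the first explicit argument), and — №277 — the binder `hunitA` re-keyed from «all G-valued U» to «all (3.35)-regular U of the carrier» (`∀ j α₀ U, (bg9YC 𝔸 G P (f j)).Reg335 c35 α₀ U → IsUnit (deltaAY …)`) with its use sites (`hunitA j U hU ↦ hunitA j α₀ U hU`) — NOT verbatim for the declarations named above.  Class-free declarations of the original are NOT copied: they are imported and used BY NAME (`open … hiding` the re-declared ones).  Generated by dag-n06-c g16's `gen.py` (HOME `pub-ymgap-dag-n06-c/lean/g16/`); the ORIGINAL MODULE DOCUMENTATION FOLLOWS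 VERBATIM and describes the mathematics.

HONEST SCOPE.  Re-typing bookkeeping; nothing of [B9] asserted beyond the original; COUNT-NEUTRAL; N06 NOT discharged; nothing continuum ∕ OS ∕ mass gap ∕ Clay.  Cell `pub-ymgap` (D-0062), Track A node N06 [B9], seat `pub-ymgap-dag-n06-c` g16, 2026-08-29.
-/

/-! Module documentation: that of the original `Balaban1983to89.B9SectBE4H2GFrameCodedY` applies verbatim to this twin (not repeated here). -/

noncomputable section

namespace Literature.MathematicalPhysics.QuantumFieldTheory.Balaban1983to89.B9SectBE4H2GFrameCodedYR

open Literature.MathematicalPhysics.QuantumFieldTheory.Balaban1983to89.B9SectBCodedClassR (RegExtraY bg9YC)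
open Literature.MathematicalPhysics.QuantumFieldTheory.Balaban1983to89.B9SectBE4H2GFrameCodedY hiding e4h2G_transfer_KACU e4h2GFrame₆CodedOn stepE4Pos_KACU_frame_on stepH2Pos_KACU_frame_on

open LatticeFieldCalculus (supDist)
open B9Eq39Adjoint (R R_smul R_zero R_sub R_add)
open B6GlobalChartV1 (PV blkV1 boxEquiv)
open B6Geom246MultiLevelTorus (geomT)
open B6Ineq2142KLevelV1 (β beta_level)
open B6KLevelCensusIndexV1 (KIdx Adm kGeo)
open B6RandomWalk (HasMajorant hasMajorant_mono BlockSupp Ineq261)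
open B9Thm34Ext (toB6)
open B9FromB6 (EBlock H1Block E4Block H2Block)
open B9GeoNormsKLevelV1 (geo9K geo9K_dist_nonneg geo9K_holder_mono_bond)
open B9GeoLemma21KLevelV1 (geo9Y_dist_comm geo9Y_dist_triangle geo9Y_len_pos one_le_k)
open B9Eq310Hermitian (norm_R_le)
open B9Eq352DivFormLetters (conj coordEquiv conj_neg norm_coordSymm_apply_le)
open B9Eq352GradLetters (diffLetter)
open B9Eq371GradLetters (bT bU)
open B9CoReadingCoords (cdBₗ cdsBₗ cdBₗ_apply cdsBₗ_apply)
open B9BackgroundsKLevelV1 (shiftsV1)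
open B9PinMembersKLevelV1 (MemberY geo9Y bg9Y)
open B9Eq360DeltaPrimeAY (AfldY)
open B9SectBGpLettersY (GVal decY decY_base blkC coordC norm_le_one_and_inv_of_mem)
open B9SectBL2DictionaryY (coordC_base_eq)
open B9SectBGpFrameCodedYR (codingYx)
open B9SectBGpFrameCodedY (CplxLettersY)
open B9SectBGpReadingsYR (KSC)
open B9SectBGpReadingsY (baseY)
open B9SectBCodedCarrier (CCfg pullS)
open B9SectBCodedReadingsUR (KACU)
open B9SectBKerFrameCodedYR (CinvY)
open B9SectBStepWhole (StepPos StepE4Pos StepH2Pos StepPos.mono)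
open B9RWSumsReadsNbr (nbr mem_nbr)
open B9GeoNormsKLevelModelSignsV1 (modelSignsOn_geo9K)
open Node00 (SiteY BlkY FBondY IBondY CfgY BallY SiteParY BondParY BondOpY liftY liftY_apply holderQB cdB cdsB UboxY shiftY GAY GpY XY deltaAY deltaPrimeAY
  bondCoordsY bondFunCoordsY)
open Node00.OpsYRead342CrossB (norm_cdsB_le_norm_cdB_unshift dist_blkV1_unshift_le)
open B9SectBGWordDeltaAY (bondOpCoordsRY GbC)
open B9SectBGReadCodedY (eta_inv_eq_abs_cf hasMajorant_of_eq hasMajorant_conj_bondOpCoordsRY GbC_eq_conj_bondOpCoordsRY bondOpCoordsRY_mul bondOpCoordsRY_cdBₗ bondOpCoordsRY_cdsBₗ diffLetter_abs_eq)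
open B9SectBGReadYR (readG342Y_KACU)
open B9SectBGFrameCodedYR (gFrame₅CodedOn)
open B9SectBGFrameCodedY (cXY cXY_nonneg parB_contractive)
open B9SectBGClassLettersY (Reg335PlaqY CplxLettersGY VarParBY)
open B9SectBE4H2GFrameV6 (E4H2GFrame₆ stepE4H2Pos_of_e4h2GFrame₆)
open B9SectBH1GReadWriteYR (KACU_h1_inr_eq)
open B9SectBH1GReadWriteY (probeB norm_probeB h1ReadB)
open B9SectBH1GProbesY (lamB lamB_apply' lamB_GbC lamB_DL_GbC lamB_GbC_DR lamB_conj_bondOpCoordsRY lamB_coordEquiv_bondFunCoordsY probeBC probeBC_symm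
  blockSupp_coordEquiv_bondFun_liftY probeL_lamB_le blkC_snd_eq_blkV1 blkC_bondCoordsY_snd)
open B9SectBH1GUndiffY (HolderLipBY cutH_inr_nonneg)
open B9SectBE4H2GReadWriteYR (KACU_e4_inr_eq KACU_e4_inl KACU_h2_inr_eq KACU_h2_off)
open B9SectBE4H2GReadWriteY (e4ReadB h2ReadB norm_le_e4ReadB probe_le_h2ReadB e4ReadB_le_of_forall h2ReadB_le_of_probes)

variable {d ℓ : ℕ} {hd : 1 ≤ d + 1} {hL : Odd (ℓ + 1) ∧ 1 < ℓ + 1} {b₀ b₁ : ℝ} {Mstar : ℕ}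
variable {𝔸 : Type} [NormedRing 𝔸] (P : RegExtraY d ℓ hd hL b₀ b₁ Mstar 𝔸) [NormedAlgebra ℂ 𝔸] [CompleteSpace 𝔸]

/-! ## §1 Triple-product bridges and coordinate tools -/

section Bridges

variable {ι : Type} [Fintype ι] (x : MemberY d ℓ hd hL b₀ b₁ Mstar) (parS : SiteParY 𝔸 x.toKIdx) (parB : BondParY 𝔸 x.toKIdx) (b : Module.Basis ι ℝ 𝔸)

end Bridges

/-! ## §2 The output writing functions -/

/-! ## §3 ★★ The (3.44) ∕ (3.45) transfer field PROVED at def-Y's bond letters for `KACU` -/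

section Transfer

variable [NormOneClass 𝔸] (c35 : ℝ) (G : Subgroup 𝔸ˣ) (x : MemberY d ℓ hd hL b₀ b₁ Mstar) (par : SiteParY 𝔸 x.toKIdx) (parB : BondParY 𝔸 x.toKIdx)
  {ι : Type} [Fintype ι] (b : Module.Basis ι ℝ 𝔸) (ιB : BlkY x.toKIdx → IBondY x.toKIdx) [Fintype (geo9Y x).Site]
  (C37 C38 : ℝ → CfgY 𝔸 x.toKIdx → AfldY 𝔸 x.toKIdx → Prop)

set_option maxHeartbeats 1600000 in
/-- ★★ **THE (3.44) ∕ (3.45) TRANSFER FIELD OF THE BOND-SECTOR FRAME, PROVED FOR `KACU` AT def-Y's LETTERS**: from r06's per-input member (v′) (`HV`) and per-probe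
member (vi′) (`HVI`) for the letter `GbC` of the member (the shapes of `E4H2GFrame₆.e4h2G_transfer`), the (3.42) and (3.43)–(3.45) blocks of `KACU` at the base and
unit norms of the bond variables (`G`-valued base), the (3.44) AND (3.45) blocks of `KACU` at the coded product with `(wE4G6 … B δc Bε, δc∕7)` and
`(wH2G6 … B δc Bβ Bε Bεβ, δc∕7)`. [cite: Balaban1985BackgroundPropagators, Thm 3.4 p.400, Thm 3.3 p.399, (3.44)–(3.45) p.398, (3.40) p.397, p.403 l.2–5, (3.82)–(3.86) p.407; Balaban1984PropagatorsII, (2.51)–(2.52) p.232, (2.54) p.233, Lemma 2.1 p.234] -/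
theorem e4h2G_transfer_KACU (hι : ∀ s : BlkY x.toKIdx, β x.toKIdx.hN x.toKIdx.D x.toKIdx.hk (ιB s) = s)
    (hG1 : ∀ u : 𝔸ˣ, u ∈ G → ‖(u : 𝔸)‖ ≤ 1)
    {M₂ : ℝ} (hM₂ : 0 ≤ M₂) (hrepr : ∀ (v : 𝔸) (j : ι), |b.repr v j| ≤ M₂ * ‖v‖)
    {MInv : ℝ} (cRG : ℝ → ℝ) {aInv aW : ℝ}
    (α₀ : ℝ) (c c' : (codingYx P G x C37 C38).bg.Cfg) (α₁ B₀ B δ δc : ℝ) (Bβ Bε : ℝ → ℝ) (Bεβ : ℝ → ℝ → ℝ)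
    (_hM : MInv ≤ (geo9Y x).M) (_hα₀ : 0 < α₀) (_hMa : (geo9Y x).M * α₀ ≤ aInv) (hreg : (codingYx P G x C37 C38).bg.Reg335 c35 α₀ c)
    (_hα₁ : 0 < α₁) (_haW : α₁ ≤ aW) (h37 : (codingYx P G x C37 C38).bg.Cplx337 α₁ c c') (hB₀ : 0 < B₀) (hB : 0 ≤ B)
    (_hδ : 0 < δ) (hδc : 0 < δc) (hδcδ : δc ≤ δ) (hcRG : M₂ * (∑ j, ‖b j‖) ≤ cRG δ)
    (hE : EBlock (KACU P G x (GAY x.toKIdx par parB (GpY x.toKIdx par)) parB C37 C38) B₀ δ c)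
    (hHH : B9.Ineq343_345 (KACU P G x (GAY x.toKIdx par parB (GpY x.toKIdx par)) parB C37 C38) Bβ Bε Bεβ δ c)
    (HV : ∀ (Dl Ds : Module.End ℝ ((Fin (d + 1) × SiteY x.toKIdx) × ι → ℝ)),
      HasMajorant (g := toB6 (geo9Y x) (0 : ℝ) True) (fun q : (Fin (d + 1) × SiteY x.toKIdx) × ι => blkC x.toKIdx ιB q.1.2) (Dl * GbC x.toKIdx par parB b c)
        (fun a a' => cRG δ * B₀ * (geo9Y x).len a * Real.exp (-(δc * (geo9Y x).dist a a'))) →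
      HasMajorant (g := toB6 (geo9Y x) (0 : ℝ) True) (fun q : (Fin (d + 1) × SiteY x.toKIdx) × ι => blkC x.toKIdx ιB q.1.2) (GbC x.toKIdx par parB b c * Ds)
        (fun a a' => cRG δ * B₀ * (geo9Y x).len a * Real.exp (-(δc * (geo9Y x).dist a a'))) →
      ∀ (y' : IBondY x.toKIdx) (μ : (Fin (d + 1) × SiteY x.toKIdx) × ι → ℝ) (M : ℝ),
        BlockSupp (g := toB6 (geo9Y x) (0 : ℝ) True) (fun q : (Fin (d + 1) × SiteY x.toKIdx) × ι => blkC x.toKIdx ιB q.1.2) μ y' M →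
      ∀ (N : ℝ), 0 ≤ N →
        (∀ (k : Fin (d + 1) ⊕ Fin (d + 1)) (z : (Fin (d + 1) × SiteY x.toKIdx) × ι),
          |(((conj b (diffLetter (bT (shiftY x.toKIdx)) (bU (coordC G x.toKIdx c)) ((((geo9Y x).eta : ℂ))⁻¹) k)) * GbC x.toKIdx par parB b c * Ds) μ) z| ≤
            N * Real.exp (-(δc * (geo9Y x).dist (blkC x.toKIdx ιB z.1.2) y'))) →
        (∀ z : (Fin (d + 1) × SiteY x.toKIdx) × ι, |((Dl * GbC x.toKIdx par parB b c * Ds) μ) z| ≤ N * Real.exp (-(δc * (geo9Y x).dist (blkC x.toKIdx ιB z.1.2) y'))) →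
        ∀ p : (Fin (d + 1) × SiteY x.toKIdx) × ι, |((Dl * GbC x.toKIdx par parB b ((codingYx P G x C37 C38).bg.mul c' c) * Ds) μ) p| ≤
          B * (N + M) * Real.exp (-(δc / 7 * (geo9Y x).dist (blkC x.toKIdx ιB p.1.2) y')))
    (HVI : ∀ (Dl Ds : Module.End ℝ ((Fin (d + 1) × SiteY x.toKIdx) × ι → ℝ)),
      HasMajorant (g := toB6 (geo9Y x) (0 : ℝ) True) (fun q : (Fin (d + 1) × SiteY x.toKIdx) × ι => blkC x.toKIdx ιB q.1.2) (Dl * GbC x.toKIdx par parB b c)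
        (fun a a' => cRG δ * B₀ * (geo9Y x).len a * Real.exp (-(δc * (geo9Y x).dist a a'))) →
      HasMajorant (g := toB6 (geo9Y x) (0 : ℝ) True) (fun q : (Fin (d + 1) × SiteY x.toKIdx) × ι => blkC x.toKIdx ιB q.1.2) (GbC x.toKIdx par parB b c * Ds)
        (fun a a' => cRG δ * B₀ * (geo9Y x).len a * Real.exp (-(δc * (geo9Y x).dist a a'))) →
      ∀ (Φ : (Fin (d + 1) × SiteY x.toKIdx → 𝔸) →ₗ[ℝ] 𝔸) (y : IBondY x.toKIdx) (p₀ : (Fin (d + 1) × SiteY x.toKIdx) × ι), blkC x.toKIdx ιB p₀.1.2 = y →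
      ∀ (γ Bh cζ : ℝ), 0 ≤ Bh → 0 ≤ cζ →
        (∀ (y'' : IBondY x.toKIdx) (ν : (Fin (d + 1) × SiteY x.toKIdx) × ι → ℝ) (C : ℝ),
          BlockSupp (g := toB6 (geo9Y x) (0 : ℝ) True) (fun q : (Fin (d + 1) × SiteY x.toKIdx) × ι => blkC x.toKIdx ιB q.1.2) ν y'' C →
          ‖Φ ((coordEquiv b).symm (Dl (GbC x.toKIdx par parB b c ν)))‖ ≤ Bh * (geo9Y x).len y ^ (1 - γ) * cζ * Real.exp (-(δc * (geo9Y x).dist y y'')) * C) →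
      ∀ (y' : IBondY x.toKIdx) (μ : (Fin (d + 1) × SiteY x.toKIdx) × ι → ℝ) (M : ℝ),
        BlockSupp (g := toB6 (geo9Y x) (0 : ℝ) True) (fun q : (Fin (d + 1) × SiteY x.toKIdx) × ι => blkC x.toKIdx ιB q.1.2) μ y' M →
      ∀ (N : ℝ), 0 ≤ N →
        (∀ (k : Fin (d + 1) ⊕ Fin (d + 1)) (z : (Fin (d + 1) × SiteY x.toKIdx) × ι),
          |(((conj b (diffLetter (bT (shiftY x.toKIdx)) (bU (coordC G x.toKIdx c)) ((((geo9Y x).eta : ℂ))⁻¹) k)) * GbC x.toKIdx par parB b c * Ds) μ) z| ≤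
            N * Real.exp (-(δc * (geo9Y x).dist (blkC x.toKIdx ιB z.1.2) y'))) →
      ∀ (N₂ : ℝ), 0 ≤ N₂ → ‖Φ ((coordEquiv b).symm ((Dl * GbC x.toKIdx par parB b c * Ds) μ))‖ ≤ N₂ * Real.exp (-(δc * (geo9Y x).dist y y')) →
        ‖Φ ((coordEquiv b).symm ((Dl * GbC x.toKIdx par parB b ((codingYx P G x C37 C38).bg.mul c' c) * Ds) μ))‖ ≤
          B * (N₂ + Bh * (geo9Y x).len y ^ (1 - γ) * cζ * ((geo9Y x).len y)⁻¹ * (N + M)) * Real.exp (-(δc / 7 * (geo9Y x).dist y y'))) :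
    E4Block (KACU P G x (GAY x.toKIdx par parB (GpY x.toKIdx par)) parB C37 C38) (wE4G6 (2 * ((d : ℝ) + 1)) (∑ j, ‖b j‖) M₂ B δc Bε) (δc / 7)
        ((codingYx P G x C37 C38).bg.mul c' c) ∧
      H2Block (KACU P G x (GAY x.toKIdx par parB (GpY x.toKIdx par)) parB C37 C38) (wH2G6 (2 * ((d : ℝ) + 1)) (∑ j, ‖b j‖) M₂ B δc Bβ Bε Bεβ) (δc / 7)
        ((codingYx P G x C37 C38).bg.mul c' c) := by
  classical
  letI : Fintype (B9GeoNormsKLevelV1.geo9K x.toKIdx).Site := ‹Fintype (geo9Y x).Site›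
  -- the coded pair is (base U, mult a); the product is `prod U a`
  obtain ⟨U, a, rfl, rfl, hCa⟩ := (codingYx P G x C37 C38).exists_of_bg_Cplx337 h37
  have hU335 : (bg9YC 𝔸 G P x).Reg335 c35 α₀ U := by
    obtain ⟨U', h1, h2⟩ := (codingYx P G x C37 C38).exists_of_bg_Reg335 hreg
    cases h1
    exact h2
  have hU : GVal G x.toKIdx U := hU335.1.1
  -- notation and elementary facts
  set Sb : ℝ := ∑ j, ‖b j‖ with hSb
  have hSb0 : 0 ≤ Sb := Finset.sum_nonneg fun j _ => norm_nonneg _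
  set OA : BondOpY 𝔸 x.toKIdx := GAY x.toKIdx par parB (GpY x.toKIdx par) with hOA
  set TU : (FBondY x.toKIdx → 𝔸) →ₗ[ℂ] (FBondY x.toKIdx → 𝔸) := OA U with hTU
  set TW : (FBondY x.toKIdx → 𝔸) →ₗ[ℂ] (FBondY x.toKIdx → 𝔸) := OA (decY x.toKIdx (.prod U a)) with hTW
  have hco : coordC G x.toKIdx (.base U) = UboxY x.toKIdx U := coordC_base_eq G x hU
  have hη : ((((geo9Y x).eta : ℂ)))⁻¹ = ((|x.toKIdx.cf| : ℝ) : ℂ) := eta_inv_eq_abs_cf x.toKIdx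
  have hDk : ∀ k : Fin (d + 1) ⊕ Fin (d + 1),
      diffLetter (bT (shiftY x.toKIdx)) (bU (coordC G x.toKIdx (.base U))) ((((geo9Y x).eta : ℂ))⁻¹) k =
        diffLetter (bT (shiftY x.toKIdx)) (bU (UboxY x.toKIdx U)) ((|x.toKIdx.cf| : ℝ) : ℂ) k := by
    intro k; rw [hco, hη]
  have hUu : ∀ (ν : Fin (d + 1)) (s : Site (PV d ℓ x.m x.K hd hL) 0),
      ‖((U ν s : 𝔸ˣ) : 𝔸)‖ ≤ 1 ∧ ‖(((U ν s)⁻¹ : 𝔸ˣ) : 𝔸)‖ ≤ 1 := fun ν s => norm_le_one_and_inv_of_mem G hG1 (hU ν s)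
  have hdd : 0 ≤ 2 * ((d : ℝ) + 1) := by positivity
  have hdn : ∀ a a' : IBondY x.toKIdx, 0 ≤ (geo9Y x).dist a a' := fun a a' => geo9K_dist_nonneg x.toKIdx a a'
  have hk1 : 1 ≤ x.toKIdx.k := one_le_k x.toKIdx
  -- the input blocks at the base
  have hEU : EBlock (KACU P G x OA parB C37 C38) B₀ δ (.base U) := hE
  have hH1U : H1Block (KACU P G x OA parB C37 C38) Bβ δ (.base U) := hHH.1
  have hE4U : E4Block (KACU P G x OA parB C37 C38) Bε δ (.base U) := hHH.2.1
  have hH2U : H2Block (KACU P G x OA parB C37 C38) Bεβ δ (.base U) := hHH.2.2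
  -- the (3.42) majorants of `∇_{U,ν}G(U)` and `G(U)∇*_{U,μ}` at the base, transported to r06's carrier, lowered to δc, constant raised to `cRG δ`
  have cR0 : 0 ≤ M₂ * Sb := mul_nonneg hM₂ hSb0
  obtain ⟨-, g1, g2, -⟩ := readG342Y_KACU P (Rr := 0) (Hp := True) b G x OA parB C37 C38 ιB hι hM₂ hrepr hB₀.le hEU
  have hGbU : GbC x.toKIdx par parB b (.base U) = conj b (bondOpCoordsRY x.toKIdx (TU.restrictScalars ℝ)) := by
    rw [GbC_eq_conj_bondOpCoordsRY, decY_base]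
  have raise : ∀ {T : Module.End ℝ ((Fin (d + 1) × SiteY x.toKIdx) × ι → ℝ)},
      HasMajorant (g := toB6 (geo9Y x) (0 : ℝ) True) (fun q : (Fin (d + 1) × SiteY x.toKIdx) × ι => blkC x.toKIdx ιB q.1.2) T
        (fun a a' => M₂ * Sb * (B₀ * (geo9Y x).len a * Real.exp (-(δ * (geo9Y x).dist a a')))) →
      HasMajorant (g := toB6 (geo9Y x) (0 : ℝ) True) (fun q : (Fin (d + 1) × SiteY x.toKIdx) × ι => blkC x.toKIdx ιB q.1.2) T
        (fun a a' => cRG δ * B₀ * (geo9Y x).len a * Real.exp (-(δc * (geo9Y x).dist a a'))) := by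
    intro T h
    refine hasMajorant_mono _ h fun a a' => ?_
    have hexp : Real.exp (-(δ * (geo9Y x).dist a a')) ≤ Real.exp (-(δc * (geo9Y x).dist a a')) := Real.exp_le_exp.2 (by nlinarith [hdn a a'])
    have hfac : 0 ≤ B₀ * (geo9Y x).len a := mul_nonneg hB₀.le (geo9Y_len_pos x a).le
    calc M₂ * Sb * (B₀ * (geo9Y x).len a * Real.exp (-(δ * (geo9Y x).dist a a')))
        ≤ M₂ * Sb * (B₀ * (geo9Y x).len a * Real.exp (-(δc * (geo9Y x).dist a a'))) :=
          mul_le_mul_of_nonneg_left (mul_le_mul_of_nonneg_left hexp hfac) cR0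
      _ ≤ cRG δ * (B₀ * (geo9Y x).len a * Real.exp (-(δc * (geo9Y x).dist a a'))) :=
          mul_le_mul_of_nonneg_right hcRG (mul_nonneg hfac (Real.exp_pos _).le)
      _ = _ := by ring
  have hmajL : ∀ ν : Fin (d + 1), HasMajorant (g := toB6 (geo9Y x) (0 : ℝ) True) (fun q : (Fin (d + 1) × SiteY x.toKIdx) × ι => blkC x.toKIdx ιB q.1.2)
      (conj b (bondOpCoordsRY x.toKIdx (cdBₗ x.toKIdx U ν)) * GbC x.toKIdx par parB b (.base U))
      (fun a a' => cRG δ * B₀ * (geo9Y x).len a * Real.exp (-(δc * (geo9Y x).dist a a'))) := by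
    intro ν
    have heq : conj b (bondOpCoordsRY x.toKIdx (cdBₗ x.toKIdx U ν ∘ₗ TU.restrictScalars ℝ)) =
        conj b (bondOpCoordsRY x.toKIdx (cdBₗ x.toKIdx U ν)) * GbC x.toKIdx par parB b (.base U) := by
      rw [hGbU, ← B9Eq352DivFormLetters.conj_mul, ← bondOpCoordsRY_mul]; rfl
    exact raise (hasMajorant_of_eq x.toKIdx heq.symm (hasMajorant_conj_bondOpCoordsRY x.toKIdx b ιB _ (g1 ν)))
  have hmajR : ∀ μ : Fin (d + 1), HasMajorant (g := toB6 (geo9Y x) (0 : ℝ) True) (fun q : (Fin (d + 1) × SiteY x.toKIdx) × ι => blkC x.toKIdx ιB q.1.2)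
      (GbC x.toKIdx par parB b (.base U) * conj b (bondOpCoordsRY x.toKIdx (cdsBₗ x.toKIdx U μ)))
      (fun a a' => cRG δ * B₀ * (geo9Y x).len a * Real.exp (-(δc * (geo9Y x).dist a a'))) := by
    intro μ
    have heq : conj b (bondOpCoordsRY x.toKIdx (TU.restrictScalars ℝ ∘ₗ cdsBₗ x.toKIdx U μ)) =
        GbC x.toKIdx par parB b (.base U) * conj b (bondOpCoordsRY x.toKIdx (cdsBₗ x.toKIdx U μ)) := by
      rw [hGbU, ← B9Eq352DivFormLetters.conj_mul, ← bondOpCoordsRY_mul]; rfl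
    exact raise (hasMajorant_of_eq x.toKIdx heq.symm (hasMajorant_conj_bondOpCoordsRY x.toKIdx b ιB _ (g2 μ)))
  ------------------------------------------------------------------
  -- the (3.44) data at the base for an amplitude `J ⊗ E` supported in the block of `y′`
  ------------------------------------------------------------------
  have e4data : ∀ (ε : ℝ), 0 < ε → ε ≤ 1 → ∀ (J : FBondY x.toKIdx → ℝ) (y' : IBondY x.toKIdx), (geo9Y x).suppIn (Sum.inr J) y' →
      ∀ (E : BallY 𝔸) (ν μ : Fin (d + 1)) (q : FBondY x.toKIdx),
      ‖cdB x.toKIdx U ν (TU (cdsB x.toKIdx U μ (liftY J (E : 𝔸)))) q‖ ≤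
          max (Bε ε) 0 * Real.exp (-(δc * (geo9Y x).dist (ιB (blkV1 x.toKIdx.hN x.toKIdx.D q)) y')) *
            ((geo9Y x).holder ε (Sum.inr J) + (geo9Y x).supNorm (Sum.inr J)) ∧
        ‖cdsB x.toKIdx U ν (TU (cdsB x.toKIdx U μ (liftY J (E : 𝔸)))) q‖ ≤
          max (Bε ε) 0 * Real.exp (δc * (2 * ((d : ℝ) + 1))) * Real.exp (-(δc * (geo9Y x).dist (ιB (blkV1 x.toKIdx.hN x.toKIdx.D q)) y')) *
            ((geo9Y x).holder ε (Sum.inr J) + (geo9Y x).supNorm (Sum.inr J)) := by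
    intro ε hε0 hε1 J y' hs E ν μ q₀
    have hhol : 0 ≤ (geo9Y x).holder ε (Sum.inr J) := (modelSignsOn_geo9K x.toKIdx).holder_nonneg ε _
    have hsupN : 0 ≤ (geo9Y x).supNorm (Sum.inr J) := (modelSignsOn_geo9K x.toKIdx).supNorm_nonneg _
    have hHS : 0 ≤ (geo9Y x).holder ε (Sum.inr J) + (geo9Y x).supNorm (Sum.inr J) := add_nonneg hhol hsupN
    set Bp : ℝ := max (Bε ε) 0 with hBp
    have hBp0 : 0 ≤ Bp := le_max_right _ _
    -- the printed entry at any bond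
    have forward : ∀ q : FBondY x.toKIdx, ‖cdB x.toKIdx U ν (TU (cdsB x.toKIdx U μ (liftY J (E : 𝔸)))) q‖ ≤
        Bp * Real.exp (-(δc * (geo9Y x).dist (ιB (blkV1 x.toKIdx.hN x.toKIdx.D q)) y')) * ((geo9Y x).holder ε (Sum.inr J) + (geo9Y x).supNorm (Sum.inr J)) := by
      intro q
      have h := hE4U ε (Sum.inr J) (ιB (blkV1 x.toKIdx.hN x.toKIdx.D q)) y' hε0 hε1 hs
      rw [KACU_e4_inr_eq] at h
      have hr := norm_le_e4ReadB x.toKIdx b TU U hM₂ hrepr J (β x.toKIdx.hN x.toKIdx.D x.toKIdx.hk (ιB (blkV1 x.toKIdx.hN x.toKIdx.D q))) E ν μ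
        (q := q) (by rw [hι])
      refine (hr.trans h).trans (mul_le_mul_of_nonneg_right ?_ hHS)
      have hexp : Real.exp (-(δ * (geo9Y x).dist (ιB (blkV1 x.toKIdx.hN x.toKIdx.D q)) y')) ≤
          Real.exp (-(δc * (geo9Y x).dist (ιB (blkV1 x.toKIdx.hN x.toKIdx.D q)) y')) := Real.exp_le_exp.2 (by nlinarith [hdn (ιB (blkV1 x.toKIdx.hN x.toKIdx.D q)) y'])
      exact mul_le_mul (le_max_left _ _) hexp (Real.exp_pos _).le hBp0
    refine ⟨forward q₀, ?_⟩
    -- the backward letter on the left: the exact neighbour identity at the cost `e^{2(d+1)δc}`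
    refine (norm_cdsB_le_norm_cdB_unshift x.toKIdx U hUu ν _ q₀).trans ((forward _).trans ?_)
    refine mul_le_mul_of_nonneg_right ?_ hHS
    rw [mul_assoc]
    refine mul_le_mul_of_nonneg_left ?_ hBp0
    rw [← Real.exp_add]
    refine Real.exp_le_exp.2 ?_
    have hst := dist_blkV1_unshift_le x.toKIdx ιB hι ν q₀
    have htri := geo9Y_dist_triangle x (ιB (blkV1 x.toKIdx.hN x.toKIdx.D q₀))
      (ιB (blkV1 x.toKIdx.hN x.toKIdx.D ⟨(shiftsV1 (PV d ℓ x.m x.K hd hL) ν).symm q₀.src, q₀.dir⟩)) y'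
    have hst' : (geo9Y x).dist (ιB (blkV1 x.toKIdx.hN x.toKIdx.D q₀))
        (ιB (blkV1 x.toKIdx.hN x.toKIdx.D ⟨(shiftsV1 (PV d ℓ x.m x.K hd hL) ν).symm q₀.src, q₀.dir⟩)) ≤ 2 * ((d : ℝ) + 1) := hst
    nlinarith [hdn (ιB (blkV1 x.toKIdx.hN x.toKIdx.D ⟨(shiftsV1 (PV d ℓ x.m x.K hd hL) ν).symm q₀.src, q₀.dir⟩)) y']
  -- the sup data `N` of `∇♯_k·G(U)·D_s μ` for every letter on the left, at the coordinates of an amplitude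
  have Ndata : ∀ (ε : ℝ), 0 < ε → ε ≤ 1 → ∀ (J : FBondY x.toKIdx → ℝ) (y' : IBondY x.toKIdx), (geo9Y x).suppIn (Sum.inr J) y' →
      ∀ (E : BallY 𝔸) (μ : Fin (d + 1)) (k : Fin (d + 1) ⊕ Fin (d + 1)) (z : (Fin (d + 1) × SiteY x.toKIdx) × ι),
      |(((conj b (diffLetter (bT (shiftY x.toKIdx)) (bU (coordC G x.toKIdx (.base U))) ((((geo9Y x).eta : ℂ))⁻¹) k)) * GbC x.toKIdx par parB b (.base U) *
          conj b (bondOpCoordsRY x.toKIdx (cdsBₗ x.toKIdx U μ))) (coordEquiv b (bondFunCoordsY x.toKIdx (liftY J (E : 𝔸))))) z| ≤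
        (M₂ * (max (Bε ε) 0 * Real.exp (δc * (2 * ((d : ℝ) + 1))) * ((geo9Y x).holder ε (Sum.inr J) + (geo9Y x).supNorm (Sum.inr J)))) *
          Real.exp (-(δc * (geo9Y x).dist (blkC x.toKIdx ιB z.1.2) y')) := by
    intro ε hε0 hε1 J y' hs E μ k z
    have hhol : 0 ≤ (geo9Y x).holder ε (Sum.inr J) := (modelSignsOn_geo9K x.toKIdx).holder_nonneg ε _
    have hsupN : 0 ≤ (geo9Y x).supNorm (Sum.inr J) := (modelSignsOn_geo9K x.toKIdx).supNorm_nonneg _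
    have hHS : 0 ≤ (geo9Y x).holder ε (Sum.inr J) + (geo9Y x).supNorm (Sum.inr J) := add_nonneg hhol hsupN
    have hBp0 : 0 ≤ max (Bε ε) 0 := le_max_right _ _
    set qz : FBondY x.toKIdx := (bondCoordsY x.toKIdx).symm z.1 with hqz
    have hblk : blkC x.toKIdx ιB z.1.2 = ιB (blkV1 x.toKIdx.hN x.toKIdx.D qz) := blkC_snd_eq_blkV1 x.toKIdx ιB z
    rw [hDk, hblk]
    rcases k with ν' | ν'
    · rw [abs_apply_diffLetter_inl_mul_eq]
      refine (abs_apply_le_norm_lamB x b hrepr _ z).trans ?_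
      rw [lamB_L_GbC_DR, decY_base, lamB_coordEquiv_bondFunCoordsY, cdBₗ_apply]
      refine (mul_le_mul_of_nonneg_left ((e4data ε hε0 hε1 J y' hs E ν' μ qz).1) hM₂).trans ?_
      have hone : (1 : ℝ) ≤ Real.exp (δc * (2 * ((d : ℝ) + 1))) := Real.one_le_exp (by positivity)
      have he0 := (Real.exp_pos (-(δc * (geo9Y x).dist (ιB (blkV1 x.toKIdx.hN x.toKIdx.D qz)) y'))).le
      calc M₂ * (max (Bε ε) 0 * Real.exp (-(δc * (geo9Y x).dist (ιB (blkV1 x.toKIdx.hN x.toKIdx.D qz)) y')) *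
            ((geo9Y x).holder ε (Sum.inr J) + (geo9Y x).supNorm (Sum.inr J)))
          = (M₂ * (max (Bε ε) 0 * 1 * ((geo9Y x).holder ε (Sum.inr J) + (geo9Y x).supNorm (Sum.inr J)))) *
              Real.exp (-(δc * (geo9Y x).dist (ιB (blkV1 x.toKIdx.hN x.toKIdx.D qz)) y')) := by ring
        _ ≤ (M₂ * (max (Bε ε) 0 * Real.exp (δc * (2 * ((d : ℝ) + 1))) * ((geo9Y x).holder ε (Sum.inr J) + (geo9Y x).supNorm (Sum.inr J)))) *
              Real.exp (-(δc * (geo9Y x).dist (ιB (blkV1 x.toKIdx.hN x.toKIdx.D qz)) y')) := by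
            refine mul_le_mul_of_nonneg_right (mul_le_mul_of_nonneg_left ?_ hM₂) he0
            exact mul_le_mul_of_nonneg_right (mul_le_mul_of_nonneg_left hone hBp0) hHS
    · rw [abs_apply_diffLetter_inr_mul_eq]
      refine (abs_apply_le_norm_lamB x b hrepr _ z).trans ?_
      rw [lamB_L_GbC_DR, decY_base, lamB_coordEquiv_bondFunCoordsY, cdsBₗ_apply]
      refine (mul_le_mul_of_nonneg_left ((e4data ε hε0 hε1 J y' hs E ν' μ qz).2) hM₂).trans (le_of_eq ?_)
      ring
  refine ⟨?_, ?_⟩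
  ------------------------------------------------------------------
  -- (3.44) at the product
  ------------------------------------------------------------------
  · intro ε lam y y' hε0 hε1 hlam
    have hW : 0 ≤ wE4G6 (2 * ((d : ℝ) + 1)) Sb M₂ B δc Bε ε := wE4G6_nonneg Bε hSb0 hB hM₂ ε
    have hHS : 0 ≤ (geo9Y x).holder ε lam + (geo9Y x).supNorm lam :=
      add_nonneg ((modelSignsOn_geo9K x.toKIdx).holder_nonneg ε lam) ((modelSignsOn_geo9K x.toKIdx).supNorm_nonneg lam)
    have hRHS : 0 ≤ wE4G6 (2 * ((d : ℝ) + 1)) Sb M₂ B δc Bε ε * Real.exp (-(δc / 7 * (geo9Y x).dist y y')) *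
        ((geo9Y x).holder ε lam + (geo9Y x).supNorm lam) := mul_nonneg (mul_nonneg hW (Real.exp_pos _).le) hHS
    rcases lam with f | J
    · rw [KACU_e4_inl]; exact hRHS
    have hlam' : (geo9Y x).suppIn (Sum.inr J) y' := hlam
    have hsupN : 0 ≤ (geo9Y x).supNorm (Sum.inr J) := (modelSignsOn_geo9K x.toKIdx).supNorm_nonneg _
    have hhol : 0 ≤ (geo9Y x).holder ε (Sum.inr J) := (modelSignsOn_geo9K x.toKIdx).holder_nonneg ε _
    set yL : IBondY x.toKIdx := ιB (β x.toKIdx.hN x.toKIdx.D x.toKIdx.hk y') with hyL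
    have hyLβ : β x.toKIdx.hN x.toKIdx.D x.toKIdx.hk yL = β x.toKIdx.hN x.toKIdx.D x.toKIdx.hk y' := hι _
    have hlamL : (geo9Y x).suppIn (Sum.inr J) yL := fun q hq => by rw [hyLβ]; exact hlam' q hq
    rw [KACU_e4_inr_eq]
    show e4ReadB x.toKIdx TW U J (β x.toKIdx.hN x.toKIdx.D x.toKIdx.hk y) ≤ _
    refine e4ReadB_le_of_forall x.toKIdx TW U J _ hRHS fun E ν μ q hq => ?_
    have hE1 : ‖(E : 𝔸)‖ ≤ 1 := mem_closedBall_zero_iff.1 E.2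
    have hBS : BlockSupp (g := toB6 (geo9Y x) (0 : ℝ) True) (fun p : (Fin (d + 1) × SiteY x.toKIdx) × ι => blkC x.toKIdx ιB p.1.2)
        (coordEquiv b (bondFunCoordsY x.toKIdx (liftY J (E : 𝔸)))) yL (M₂ * (geo9Y x).supNorm (Sum.inr J)) :=
      blockSupp_coordEquiv_bondFun_liftY x.toKIdx b ιB hM₂ hrepr J y' hlam' hE1
    set Dl : Module.End ℝ ((Fin (d + 1) × SiteY x.toKIdx) × ι → ℝ) := conj b (bondOpCoordsRY x.toKIdx (cdBₗ x.toKIdx U ν)) with hDl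
    set Ds : Module.End ℝ ((Fin (d + 1) × SiteY x.toKIdx) × ι → ℝ) := conj b (bondOpCoordsRY x.toKIdx (cdsBₗ x.toKIdx U μ)) with hDs
    set N : ℝ := M₂ * (max (Bε ε) 0 * Real.exp (δc * (2 * ((d : ℝ) + 1))) * ((geo9Y x).holder ε (Sum.inr J) + (geo9Y x).supNorm (Sum.inr J))) with hN
    have hN0 : 0 ≤ N := by have := le_max_right (Bε ε) 0; positivity
    have hN1 := fun k z => Ndata ε hε0 hε1 J yL hlamL E μ k z
    have hDlU : Dl = conj b (bondOpCoordsRY x.toKIdx (cdBₗ x.toKIdx U ν)) := rfl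
    have hN2 : ∀ z : (Fin (d + 1) × SiteY x.toKIdx) × ι,
        |((Dl * GbC x.toKIdx par parB b (.base U) * Ds) (coordEquiv b (bondFunCoordsY x.toKIdx (liftY J (E : 𝔸))))) z| ≤
          N * Real.exp (-(δc * (geo9Y x).dist (blkC x.toKIdx ιB z.1.2) yL)) := by
      intro z
      have h := hN1 (Sum.inl ν) z
      rw [hDk, abs_apply_diffLetter_inl_mul_eq] at h
      rw [hDl, hDs]; exact h
    have hout := HV Dl Ds (hmajL ν) (hmajR μ) yL _ _ hBS N hN0 hN1 hN2
    -- the value of the output word at `q` from its coordinates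
    have hval : ‖cdB x.toKIdx U ν (TW (cdsB x.toKIdx U μ (liftY J (E : 𝔸)))) q‖ =
        ‖lamB x.toKIdx b ((Dl * GbC x.toKIdx par parB b ((codingYx P G x C37 C38).bg.mul (.mult a) (.base U)) * Ds)
          (coordEquiv b (bondFunCoordsY x.toKIdx (liftY J (E : 𝔸))))) q‖ := by
      rw [hDl, hDs, lamB_DL_GbC_DR, lamB_coordEquiv_bondFunCoordsY]; rfl
    rw [hval, lamB_apply']
    have hqblk : blkC x.toKIdx ιB (bondCoordsY x.toKIdx q).2 = ιB (β x.toKIdx.hN x.toKIdx.D x.toKIdx.hk y) := by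
      rw [blkC_bondCoordsY_snd, hq]
    have hdistq : (geo9Y x).dist (ιB (β x.toKIdx.hN x.toKIdx.D x.toKIdx.hk y)) yL = (geo9Y x).dist y y' :=
      Node00.OpsYRead342.geo9K_dist_congr x.toKIdx (hι _) hyLβ
    refine (norm_coordSymm_apply_le b _ (bondCoordsY x.toKIdx q)
      (B * (N + M₂ * (geo9Y x).supNorm (Sum.inr J)) * Real.exp (-(δc / 7 * (geo9Y x).dist y y'))) fun j => ?_).trans ?_
    · have h := hout (bondCoordsY x.toKIdx q, j)
      rw [hqblk, hdistq] at h
      exact h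
    -- arithmetic
    have he0 : 0 ≤ Real.exp (-(δc / 7 * (geo9Y x).dist y y')) := (Real.exp_pos _).le
    have hNM : N + M₂ * (geo9Y x).supNorm (Sum.inr J) ≤
        M₂ * (max (Bε ε) 0 * Real.exp (δc * (2 * ((d : ℝ) + 1))) + 1) * ((geo9Y x).holder ε (Sum.inr J) + (geo9Y x).supNorm (Sum.inr J)) := by
      rw [hN]
      have h1 : M₂ * (geo9Y x).supNorm (Sum.inr J) ≤ M₂ * ((geo9Y x).holder ε (Sum.inr J) + (geo9Y x).supNorm (Sum.inr J)) :=
        mul_le_mul_of_nonneg_left (le_add_of_nonneg_left hhol) hM₂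
      nlinarith
    calc (∑ j, ‖b j‖) * (B * (N + M₂ * (geo9Y x).supNorm (Sum.inr J)) * Real.exp (-(δc / 7 * (geo9Y x).dist y y')))
        = (Sb * B) * (N + M₂ * (geo9Y x).supNorm (Sum.inr J)) * Real.exp (-(δc / 7 * (geo9Y x).dist y y')) := by rw [hSb]; ring
      _ ≤ (Sb * B) * (M₂ * (max (Bε ε) 0 * Real.exp (δc * (2 * ((d : ℝ) + 1))) + 1) * ((geo9Y x).holder ε (Sum.inr J) + (geo9Y x).supNorm (Sum.inr J))) *
            Real.exp (-(δc / 7 * (geo9Y x).dist y y')) := mul_le_mul_of_nonneg_right (mul_le_mul_of_nonneg_left hNM (mul_nonneg hSb0 hB)) he0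
      _ = wE4G6 (2 * ((d : ℝ) + 1)) Sb M₂ B δc Bε ε * Real.exp (-(δc / 7 * (geo9Y x).dist y y')) *
            ((geo9Y x).holder ε (Sum.inr J) + (geo9Y x).supNorm (Sum.inr J)) := by rw [wE4G6]; ring
  ------------------------------------------------------------------
  -- (3.45) at the product
  ------------------------------------------------------------------
  · intro ε β' lam ζ y y' hε0 hε1 hβ0 hβ1 hζ hlam
    have hW : 0 ≤ wH2G6 (2 * ((d : ℝ) + 1)) Sb M₂ B δc Bβ Bε Bεβ ε β' := wH2G6_nonneg Bβ Bε Bεβ hSb0 hB hM₂ ε β'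
    have hleny : 0 < (geo9Y x).len y := geo9Y_len_pos x y
    have hcutH : 0 ≤ (geo9Y x).cutH β' ζ := (modelSignsOn_geo9K x.toKIdx).cutH_nonneg β' ζ
    have hHS : 0 ≤ (geo9Y x).holder (β' + ε) lam + (geo9Y x).supNorm lam :=
      add_nonneg ((modelSignsOn_geo9K x.toKIdx).holder_nonneg _ lam) ((modelSignsOn_geo9K x.toKIdx).supNorm_nonneg lam)
    have hRHS : 0 ≤ wH2G6 (2 * ((d : ℝ) + 1)) Sb M₂ B δc Bβ Bε Bεβ ε β' * (geo9Y x).len y ^ (-β') * (geo9Y x).cutH β' ζ *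
        Real.exp (-(δc / 7 * (geo9Y x).dist y y')) * ((geo9Y x).holder (β' + ε) lam + (geo9Y x).supNorm lam) :=
      mul_nonneg (mul_nonneg (mul_nonneg (mul_nonneg hW (Real.rpow_nonneg hleny.le _)) hcutH) (Real.exp_pos _).le) hHS
    rcases lam with f | J
    · rw [(KACU_h2_off P G x OA parB C37 C38 _ β').2 f ζ]; exact hRHS
    rcases ζ with zs | z
    · rw [(KACU_h2_off P G x OA parB C37 C38 _ β').1 J zs]; exact hRHS
    have hlam' : (geo9Y x).suppIn (Sum.inr J) y' := hlam
    have hsupN : 0 ≤ (geo9Y x).supNorm (Sum.inr J) := (modelSignsOn_geo9K x.toKIdx).supNorm_nonneg _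
    have hhol : 0 ≤ (geo9Y x).holder ε (Sum.inr J) := (modelSignsOn_geo9K x.toKIdx).holder_nonneg ε _
    have hholb : 0 ≤ (geo9Y x).holder (β' + ε) (Sum.inr J) := (modelSignsOn_geo9K x.toKIdx).holder_nonneg _ _
    have hholmono : (geo9Y x).holder ε (Sum.inr J) ≤ (geo9Y x).holder (β' + ε) (Sum.inr J) := geo9K_holder_mono_bond x.toKIdx (by linarith) J
    rw [KACU_h2_inr_eq]
    show h2ReadB x.toKIdx TW (parB U) U J β' z ≤ _
    -- the anchor: the labelled block of `y`, through a site of the block `βy`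
    obtain ⟨w₀, hw₀⟩ := B6Geom246MultiLevelBox.exists_blkOf_eq x.toKIdx.D.toDomains (β x.toKIdx.hN x.toKIdx.D x.toKIdx.hk y)
    set y₁ : IBondY x.toKIdx := blkC x.toKIdx ιB w₀ with hy₁
    have hy₁' : y₁ = ιB (β x.toKIdx.hN x.toKIdx.D x.toKIdx.hk y) := by rw [hy₁]; show ιB (B9Eq360DeltaPrimeAY.blkY x.toKIdx w₀) = _; rw [← hw₀]; rfl
    have hy₁β : β x.toKIdx.hN x.toKIdx.D x.toKIdx.hk y₁ = β x.toKIdx.hN x.toKIdx.D x.toKIdx.hk y := by rw [hy₁', hι]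
    have hlen : (geo9Y x).len y₁ = (geo9Y x).len y := Node00.OpsYRead342.geo9K_len_congr x.toKIdx hy₁β
    have hdist : ∀ t : IBondY x.toKIdx, (geo9Y x).dist y₁ t = (geo9Y x).dist y t := fun t => Node00.OpsYRead342.geo9K_dist_congr x.toKIdx hy₁β rfl
    set yL : IBondY x.toKIdx := ιB (β x.toKIdx.hN x.toKIdx.D x.toKIdx.hk y') with hyL
    have hyLβ : β x.toKIdx.hN x.toKIdx.D x.toKIdx.hk yL = β x.toKIdx.hN x.toKIdx.D x.toKIdx.hk y' := hι _
    have hlamL : (geo9Y x).suppIn (Sum.inr J) yL := fun q hq => by rw [hyLβ]; exact hlam' q hq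
    have hdistL : (geo9Y x).dist y₁ yL = (geo9Y x).dist y y' := Node00.OpsYRead342.geo9K_dist_congr x.toKIdx hy₁β (hι _)
    have hleny₁ : 0 < (geo9Y x).len y₁ := geo9Y_len_pos x y₁
    haveI : Nontrivial 𝔸 := NormOneClass.nontrivial
    obtain ⟨j₀⟩ := b.index_nonempty
    have hp₀ : blkC x.toKIdx ιB ((((0 : Fin (d + 1)), w₀), j₀) : (Fin (d + 1) × SiteY x.toKIdx) × ι).1.2 = y₁ := rfl
    -- constants
    set cζ : ℝ := (geo9Y x).cutH β' (Sum.inr z) with hcζ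
    have hcζ0 : 0 ≤ cζ := hcutH
    set Bp : ℝ := max (Bβ β') 0 with hBp
    have hBp0 : 0 ≤ Bp := le_max_right _ _
    set Bpe : ℝ := max (Bε ε) 0 with hBpe
    have hBpe0 : 0 ≤ Bpe := le_max_right _ _
    set Bp2 : ℝ := max (Bεβ ε β') 0 with hBp2
    have hBp20 : 0 ≤ Bp2 := le_max_right _ _
    set BhL : ℝ := Sb * Bp with hBhL
    have hBhL0 : 0 ≤ BhL := mul_nonneg hSb0 hBp0
    set HS : ℝ := (geo9Y x).holder (β' + ε) (Sum.inr J) + (geo9Y x).supNorm (Sum.inr J) with hHSdef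
    have hHS0 : 0 ≤ HS := add_nonneg hholb hsupN
    -- the (3.43) block at the base READ (exponent β′), at the call rate
    set Wf : IBondY x.toKIdx → ℝ := fun a' => Bp * (geo9Y x).len y₁ ^ (1 - β') * cζ * Real.exp (-(δc * (geo9Y x).dist y₁ a')) with hWf
    have hWf0 : ∀ a', 0 ≤ Wf a' := fun a' =>
      mul_nonneg (mul_nonneg (mul_nonneg hBp0 (Real.rpow_nonneg hleny₁.le _)) hcζ0) (Real.exp_pos _).le
    have hreadU : ∀ (g : FBondY x.toKIdx → ℝ) (a' : IBondY x.toKIdx), (geo9Y x).suppIn (Sum.inr g) a' →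
        h1ReadB x.toKIdx TU (parB U) U g β' z ≤ Wf a' * (geo9Y x).supNorm (Sum.inr g) := by
      intro g a' hg
      have h := hH1U β' (Sum.inr g) (Sum.inr z) y a' hβ0 hβ1 hζ hg
      rw [KACU_h1_inr_eq] at h
      have hN : 0 ≤ (geo9Y x).supNorm (Sum.inr g) := (modelSignsOn_geo9K x.toKIdx).supNorm_nonneg _
      refine (show h1ReadB x.toKIdx TU (parB U) U g β' z ≤ _ from h).trans ?_
      rw [← hlen, ← hdist]
      have hP : 0 ≤ (geo9Y x).len y₁ ^ (1 - β') * cζ := mul_nonneg (Real.rpow_nonneg hleny₁.le _) hcζ0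
      have hexp : Real.exp (-(δ * (geo9Y x).dist y₁ a')) ≤ Real.exp (-(δc * (geo9Y x).dist y₁ a')) :=
        Real.exp_le_exp.2 (by nlinarith [hdn y₁ a'])
      calc Bβ β' * (geo9Y x).len y₁ ^ (1 - β') * (geo9Y x).cutH β' (Sum.inr z) * Real.exp (-(δ * (geo9Y x).dist y₁ a')) *
            (geo9Y x).supNorm (Sum.inr g)
          = Bβ β' * (((geo9Y x).len y₁ ^ (1 - β') * cζ) * Real.exp (-(δ * (geo9Y x).dist y₁ a')) * (geo9Y x).supNorm (Sum.inr g)) := by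
            rw [hcζ]; ring
        _ ≤ Bp * (((geo9Y x).len y₁ ^ (1 - β') * cζ) * Real.exp (-(δc * (geo9Y x).dist y₁ a')) * (geo9Y x).supNorm (Sum.inr g)) := by
            refine mul_le_mul (le_max_left _ _) ?_ (mul_nonneg (mul_nonneg hP (Real.exp_pos _).le) hN) hBp0
            exact mul_le_mul_of_nonneg_right (mul_le_mul_of_nonneg_left hexp hP) hN
        _ = Wf a' * (geo9Y x).supNorm (Sum.inr g) := by rw [hWf]; ring
    refine h2ReadB_le_of_probes x.toKIdx TW (parB U) U J β' z hRHS fun E ν μ q q' hadm => ?_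
    have hE1 : ‖(E : 𝔸)‖ ≤ 1 := mem_closedBall_zero_iff.1 E.2
    have hBS : BlockSupp (g := toB6 (geo9Y x) (0 : ℝ) True) (fun p : (Fin (d + 1) × SiteY x.toKIdx) × ι => blkC x.toKIdx ιB p.1.2)
        (coordEquiv b (bondFunCoordsY x.toKIdx (liftY J (E : 𝔸)))) yL (M₂ * (geo9Y x).supNorm (Sum.inr J)) :=
      blockSupp_coordEquiv_bondFun_liftY x.toKIdx b ιB hM₂ hrepr J y' hlam' hE1
    set Dl : Module.End ℝ ((Fin (d + 1) × SiteY x.toKIdx) × ι → ℝ) := conj b (bondOpCoordsRY x.toKIdx (cdBₗ x.toKIdx U ν)) with hDl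
    set Ds : Module.End ℝ ((Fin (d + 1) × SiteY x.toKIdx) × ι → ℝ) := conj b (bondOpCoordsRY x.toKIdx (cdsBₗ x.toKIdx U μ)) with hDs
    set Φ : (Fin (d + 1) × SiteY x.toKIdx → 𝔸) →ₗ[ℝ] 𝔸 := probeBC x.toKIdx (parB U) β' z q q' with hΦ
    -- the LEFT (3.43) premise for `D_l·G(U)`
    have prem : ∀ (y'' : IBondY x.toKIdx) (μ' : (Fin (d + 1) × SiteY x.toKIdx) × ι → ℝ) (C : ℝ),
        BlockSupp (g := toB6 (geo9Y x) (0 : ℝ) True) (fun q : (Fin (d + 1) × SiteY x.toKIdx) × ι => blkC x.toKIdx ιB q.1.2) μ' y'' C →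
        ‖Φ ((coordEquiv b).symm (Dl (GbC x.toKIdx par parB b (.base U) μ')))‖ ≤
          BhL * (geo9Y x).len y₁ ^ (1 - β') * cζ * Real.exp (-(δc * (geo9Y x).dist y₁ y'')) * C := by
      intro y'' μ' C hμ
      calc ‖Φ ((coordEquiv b).symm (Dl (GbC x.toKIdx par parB b (.base U) μ')))‖
          = ‖probeB x.toKIdx (parB U) β' z q q' (cdB x.toKIdx U ν (TU (lamB x.toKIdx b μ')))‖ := by
            rw [hΦ, probeBC_symm, ← Module.End.mul_apply, hDl, lamB_DL_GbC, decY_base]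
        _ ≤ Sb * (Wf y'' * C) := probeL_lamB_le x.toKIdx b ιB TU (parB U) U hι hM₂ hrepr β' z hWf0 hreadU hμ ν hadm
        _ = BhL * (geo9Y x).len y₁ ^ (1 - β') * cζ * Real.exp (-(δc * (geo9Y x).dist y₁ y'')) * C := by rw [hWf, hBhL]; ring
    -- the sup data `N`
    set N : ℝ := M₂ * (Bpe * Real.exp (δc * (2 * ((d : ℝ) + 1))) * ((geo9Y x).holder ε (Sum.inr J) + (geo9Y x).supNorm (Sum.inr J))) with hN
    have hN0 : 0 ≤ N := by positivity
    have hN1 := fun k zz => Ndata ε hε0 hε1 J yL hlamL E μ k zz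
    -- the probe data `N₂` of the unperturbed word, from the (3.45) block at the base
    set N₂ : ℝ := Bp2 * (geo9Y x).len y₁ ^ (-β') * cζ * HS with hN₂
    have hN₂0 : 0 ≤ N₂ := mul_nonneg (mul_nonneg (mul_nonneg hBp20 (Real.rpow_nonneg hleny₁.le _)) hcζ0) hHS0
    have hN2 : ‖Φ ((coordEquiv b).symm ((Dl * GbC x.toKIdx par parB b (.base U) * Ds) (coordEquiv b (bondFunCoordsY x.toKIdx (liftY J (E : 𝔸))))))‖ ≤
        N₂ * Real.exp (-(δc * (geo9Y x).dist y₁ yL)) := by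
      have hbr : ‖Φ ((coordEquiv b).symm ((Dl * GbC x.toKIdx par parB b (.base U) * Ds) (coordEquiv b (bondFunCoordsY x.toKIdx (liftY J (E : 𝔸))))))‖ =
          ‖probeB x.toKIdx (parB U) β' z q q' (cdB x.toKIdx U ν (TU (cdsB x.toKIdx U μ (liftY J (E : 𝔸)))))‖ := by
        rw [hΦ, probeBC_symm, hDl, hDs, lamB_DL_GbC_DR, decY_base, lamB_coordEquiv_bondFunCoordsY]
      rw [hbr]
      have h := hH2U ε β' (Sum.inr J) (Sum.inr z) y y' hε0 hε1 hβ0 hβ1 hζ hlam'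
      rw [KACU_h2_inr_eq] at h
      have hr := probe_le_h2ReadB x.toKIdx b TU U (parB U) hM₂ hrepr J β' z E ν μ hadm
      refine (hr.trans h).trans ?_
      rw [hN₂, hdistL, hlen, hHSdef]
      have hP : 0 ≤ (geo9Y x).len y ^ (-β') * (geo9Y x).cutH β' (Sum.inr z) := mul_nonneg (Real.rpow_nonneg hleny.le _) hcutH
      have hexp : Real.exp (-(δ * (geo9Y x).dist y y')) ≤ Real.exp (-(δc * (geo9Y x).dist y y')) := Real.exp_le_exp.2 (by nlinarith [hdn y y'])
      calc Bεβ ε β' * (geo9Y x).len y ^ (-β') * (geo9Y x).cutH β' (Sum.inr z) * Real.exp (-(δ * (geo9Y x).dist y y')) *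
            ((geo9Y x).holder (β' + ε) (Sum.inr J) + (geo9Y x).supNorm (Sum.inr J))
          = Bεβ ε β' * (((geo9Y x).len y ^ (-β') * (geo9Y x).cutH β' (Sum.inr z)) * Real.exp (-(δ * (geo9Y x).dist y y')) *
              ((geo9Y x).holder (β' + ε) (Sum.inr J) + (geo9Y x).supNorm (Sum.inr J))) := by ring
        _ ≤ Bp2 * (((geo9Y x).len y ^ (-β') * (geo9Y x).cutH β' (Sum.inr z)) * Real.exp (-(δc * (geo9Y x).dist y y')) *
              ((geo9Y x).holder (β' + ε) (Sum.inr J) + (geo9Y x).supNorm (Sum.inr J))) := by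
            refine mul_le_mul (le_max_left _ _) ?_ (mul_nonneg (mul_nonneg hP (Real.exp_pos _).le) hHS0) hBp20
            exact mul_le_mul_of_nonneg_right (mul_le_mul_of_nonneg_left hexp hP) hHS0
        _ = Bp2 * (geo9Y x).len y ^ (-β') * cζ * ((geo9Y x).holder (β' + ε) (Sum.inr J) + (geo9Y x).supNorm (Sum.inr J)) *
              Real.exp (-(δc * (geo9Y x).dist y y')) := by rw [hcζ]; ring
    -- the transfer
    have hout := HVI Dl Ds (hmajL ν) (hmajR μ) Φ y₁ _ hp₀ β' BhL cζ hBhL0 hcζ0 prem yL _ _ hBS N hN0 hN1 N₂ hN₂0 hN2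
    have hval : ‖probeB x.toKIdx (parB U) β' z q q' (cdB x.toKIdx U ν (TW (cdsB x.toKIdx U μ (liftY J (E : 𝔸)))))‖ =
        ‖Φ ((coordEquiv b).symm ((Dl * GbC x.toKIdx par parB b ((codingYx P G x C37 C38).bg.mul (.mult a) (.base U)) * Ds)
          (coordEquiv b (bondFunCoordsY x.toKIdx (liftY J (E : 𝔸))))))‖ := by
      rw [hΦ, probeBC_symm, hDl, hDs, lamB_DL_GbC_DR, lamB_coordEquiv_bondFunCoordsY]; rfl
    rw [hval]
    refine hout.trans ?_
    -- arithmetic: `B·(N₂ + B_hL·ℓ^{1−β′}·cζ·ℓ⁻¹·(N + M₂|J|))·e ≦ wH2G6 ε β′ · ℓ^{−β′} · cζ · e · HS`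
    rw [hdistL, hlen]
    set L₁ : ℝ := (geo9Y x).len y with hL₁
    set ee : ℝ := Real.exp (-(δc / 7 * (geo9Y x).dist y y')) with hee
    have hee0 : 0 ≤ ee := (Real.exp_pos _).le
    have hLpow : L₁ ^ (1 - β') * L₁⁻¹ = L₁ ^ (-β') := by
      rw [← Real.rpow_neg_one, ← Real.rpow_add hleny]; ring_nf
    have hNM : N + M₂ * (geo9Y x).supNorm (Sum.inr J) ≤ M₂ * (Bpe * Real.exp (δc * (2 * ((d : ℝ) + 1))) + 1) * HS := by
      rw [hN, hHSdef]
      have h1 : (geo9Y x).holder ε (Sum.inr J) + (geo9Y x).supNorm (Sum.inr J) ≤ (geo9Y x).holder (β' + ε) (Sum.inr J) + (geo9Y x).supNorm (Sum.inr J) := by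
        linarith
      have h2 : M₂ * (geo9Y x).supNorm (Sum.inr J) ≤ M₂ * ((geo9Y x).holder (β' + ε) (Sum.inr J) + (geo9Y x).supNorm (Sum.inr J)) :=
        mul_le_mul_of_nonneg_left (le_add_of_nonneg_left hholb) hM₂
      have h3 : M₂ * (Bpe * Real.exp (δc * (2 * ((d : ℝ) + 1))) * ((geo9Y x).holder ε (Sum.inr J) + (geo9Y x).supNorm (Sum.inr J))) ≤
          M₂ * (Bpe * Real.exp (δc * (2 * ((d : ℝ) + 1))) * ((geo9Y x).holder (β' + ε) (Sum.inr J) + (geo9Y x).supNorm (Sum.inr J))) :=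
        mul_le_mul_of_nonneg_left (mul_le_mul_of_nonneg_left h1 (by positivity)) hM₂
      nlinarith
    have hNMnn : 0 ≤ N + M₂ * (geo9Y x).supNorm (Sum.inr J) := add_nonneg hN0 (mul_nonneg hM₂ hsupN)
    have hmid : BhL * L₁ ^ (1 - β') * cζ * L₁⁻¹ * (N + M₂ * (geo9Y x).supNorm (Sum.inr J)) ≤
        (Sb * Bp * M₂ * (Bpe * Real.exp (δc * (2 * ((d : ℝ) + 1))) + 1)) * (L₁ ^ (-β') * cζ * HS) := by
      calc BhL * L₁ ^ (1 - β') * cζ * L₁⁻¹ * (N + M₂ * (geo9Y x).supNorm (Sum.inr J))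
          = BhL * (L₁ ^ (1 - β') * L₁⁻¹) * cζ * (N + M₂ * (geo9Y x).supNorm (Sum.inr J)) := by ring
        _ = BhL * L₁ ^ (-β') * cζ * (N + M₂ * (geo9Y x).supNorm (Sum.inr J)) := by rw [hLpow]
        _ ≤ BhL * L₁ ^ (-β') * cζ * (M₂ * (Bpe * Real.exp (δc * (2 * ((d : ℝ) + 1))) + 1) * HS) :=
            mul_le_mul_of_nonneg_left hNM (mul_nonneg (mul_nonneg hBhL0 (Real.rpow_nonneg hleny.le _)) hcζ0)
        _ = (Sb * Bp * M₂ * (Bpe * Real.exp (δc * (2 * ((d : ℝ) + 1))) + 1)) * (L₁ ^ (-β') * cζ * HS) := by rw [hBhL]; ring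
    have hN₂' : N₂ = Bp2 * (L₁ ^ (-β') * cζ * HS) := by rw [hN₂, hlen]; ring
    calc B * (N₂ + BhL * L₁ ^ (1 - β') * cζ * L₁⁻¹ * (N + M₂ * (geo9Y x).supNorm (Sum.inr J))) * ee
        ≤ B * (Bp2 * (L₁ ^ (-β') * cζ * HS) + (Sb * Bp * M₂ * (Bpe * Real.exp (δc * (2 * ((d : ℝ) + 1))) + 1)) * (L₁ ^ (-β') * cζ * HS)) * ee := by
          rw [hN₂']
          exact mul_le_mul_of_nonneg_right (mul_le_mul_of_nonneg_left (add_le_add le_rfl hmid) hB) hee0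
      _ = wH2G6 (2 * ((d : ℝ) + 1)) Sb M₂ B δc Bβ Bε Bεβ ε β' * L₁ ^ (-β') * cζ * ee * HS := by
          rw [wH2G6, ← hBp, ← hBpe, ← hBp2]; ring

end Transfer

/-! ## §4 ★★★ The frame instance over the coded carriers of a subfamily and the (3.44) ∕ (3.45) block-steps of the bond family -/

section Steps

variable [NormOneClass 𝔸] [FiniteDimensional ℝ 𝔸] {J : Type} (f : J → MemberY d ℓ hd hL b₀ b₁ Mstar)
  [∀ x : MemberY d ℓ hd hL b₀ b₁ Mstar, Fintype (geo9Y x).Site]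
  [instDS : ∀ x : MemberY d ℓ hd hL b₀ b₁ Mstar, DecidableEq (geo9Y x).Site] [instNE : ∀ x : MemberY d ℓ hd hL b₀ b₁ Mstar, Nonempty (geo9Y x).Site]
  (c35 : ℝ) (G : Subgroup 𝔸ˣ) (par : ∀ j : J, SiteParY 𝔸 (f j).toKIdx) (parB : ∀ j : J, BondParY 𝔸 (f j).toKIdx)
  {ι : Type} [Fintype ι] [DecidableEq ι] (b : Module.Basis ι ℝ 𝔸) (ιB : ∀ j : J, BlkY (f j).toKIdx → IBondY (f j).toKIdx)
  (C37 C38 : ∀ j : J, ℝ → CfgY 𝔸 (f j).toKIdx → AfldY 𝔸 (f j).toKIdx → Prop)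

/-- ★★★ **THE (3.44) ∕ (3.45) BOND-SECTOR FRAME OVER THE CODED CARRIERS OF A SUBFAMILY, INHABITED FOR `KACU`**: gen 13's instance `gFrame₅CodedOn` extended by the
writing functions `wE4G6` ∕ `wH2G6`, the rate `wHGδ' δc = δc∕7`, and the transfer field `e4h2G_transfer_KACU`.  NO hypothesis beyond `gFrame₅CodedOn`'s binders.
[cite: Balaban1985BackgroundPropagators, Thm 3.4 p.400, Thm 3.3 p.399, (3.44)–(3.45) p.398, p.403 l.2–5, (3.82)–(3.86) p.407; Balaban1984PropagatorsII, Lemma 2.1 p.234, (2.51)–(2.52) p.232] -/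
noncomputable def e4h2GFrame₆CodedOn (hι : ∀ (j : J) (s : BlkY (f j).toKIdx), β (f j).toKIdx.hN (f j).toKIdx.D (f j).toKIdx.hk (ιB j s) = s)
    (hG1 : ∀ u : 𝔸ˣ, u ∈ G → ‖(u : 𝔸)‖ ≤ 1) (hpar : ∀ j (U : CfgY 𝔸 (f j).toKIdx), GVal G (f j).toKIdx U → ∀ z w, par j U z w ∈ G)
    (hunit : ∀ j (U : CfgY 𝔸 (f j).toKIdx), GVal G (f j).toKIdx U → IsUnit (deltaPrimeAY (f j).toKIdx (par j) U))
    (M₂ : ℝ) (hM₂ : 0 ≤ M₂) (hrepr : ∀ (v : 𝔸) (j : ι), |b.repr v j| ≤ M₂ * ‖v‖) (hcR : 0 < M₂ * ∑ j, ‖b j‖)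
    (Cq : ℝ) (hCq : 0 ≤ Cq) (hC37 : ∀ j β' U a, C37 j β' U a → GVal G (f j).toKIdx U ∧ CplxLettersY G (f j) (par j) (ιB j) Cq β' U a)
    (MInv aInv aW : ℝ) (hMInv : 0 < MInv) (haInv : 0 < aInv) (haW : 0 < aW)
    (hunitX : ∀ j (U : CfgY 𝔸 (f j).toKIdx), GVal G (f j).toKIdx U → IsUnit (XY (f j).toKIdx (par j) (GpY (f j).toKIdx (par j)) U))
    (hsym : ∀ j (U : CfgY 𝔸 (f j).toKIdx) (z w : SiteY (f j).toKIdx), par j U z w = (par j U w z)⁻¹)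
    (hunitA : ∀ j (α₀ : ℝ) (U : CfgY 𝔸 (f j).toKIdx), (bg9YC 𝔸 G P (f j)).Reg335 c35 α₀ U → IsUnit (deltaAY (f j).toKIdx (par j) (parB j) (GpY (f j).toKIdx (par j)) U))
    (hparB : ∀ j (U : CfgY 𝔸 (f j).toKIdx), GVal G (f j).toKIdx U → ∀ y f', parB j U y f' ∈ G) (hb₁ : 0 ≤ b₁)
    (C₀ : ℝ) (hC₀ : 0 ≤ C₀)
    (hreg335P : ∀ j (α₀ : ℝ) (U : CfgY 𝔸 (f j).toKIdx), MInv ≤ (geo9Y (f j)).M → 0 < α₀ → (geo9Y (f j)).M * α₀ ≤ aInv →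
      (bg9YC 𝔸 G P (f j)).Reg335 c35 α₀ U → Reg335PlaqY G (f j) (ιB j) C₀ U)
    (hC37G : ∀ j β' U a, C37 j β' U a → CplxLettersGY G (f j) (ιB j) β' U a)
    (cVar : ℝ) (hcVar : 0 ≤ cVar) (hvarB : ∀ j β' U a, C37 j β' U a → VarParBY (f j).toKIdx (parB j) cVar β' U a)
    (hMd : 2 * ((d : ℝ) + 1) < MInv) (mN : ℕ) (hnbr : ∀ (j : J) (y' : IBondY (f j).toKIdx), (nbr (geo9Y (f j)) (2 * ((d : ℝ) + 1)) y').card ≤ mN) :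
    E4H2GFrame₆ c35 (fun j => geo9Y (f j)) (fun j => (codingYx P G (f j) (C37 j) (C38 j)).bg) (fun j => KSC P G (f j) (par j) (C37 j) (C38 j)) b (Fin (d + 1))
      (fun j => SiteY (f j).toKIdx) (fun j => BlkY (f j).toKIdx × ι)
      (fun j => KACU P G (f j) (GAY (f j).toKIdx (par j) (parB j) (GpY (f j).toKIdx (par j))) (parB j) (C37 j) (C38 j))
      (fun j => pullS (codingYx P G (f j) (C37 j) (C38 j)) (CinvY P f G par j)) :=
  { gFrame₅CodedOn P f c35 G par parB b ιB C37 C38 hι hG1 hpar hunit M₂ hM₂ hrepr hcR Cq hCq hC37 MInv aInv aW hMInv haInv haW hunitX hsym hunitA hparB hb₁ C₀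
      hC₀ hreg335P hC37G cVar hcVar hvarB hMd mN hnbr with
    wE4G := fun B δc Bε => wE4G6 (2 * ((d : ℝ) + 1)) (∑ j, ‖b j‖) M₂ B δc Bε
    wH2G := fun B δc Bβ Bε Bεβ => wH2G6 (2 * ((d : ℝ) + 1)) (∑ j, ‖b j‖) M₂ B δc Bβ Bε Bεβ
    wHGδ' := fun δc => δc / 7
    wHGδ'_pos := fun δc hδc => by positivity
    e4h2G_transfer := fun j α₀ c c' α₁ B₀ B δ δc Bβ Bε Bεβ hM hα₀ hMa hreg hα₁ haW' h37 hB₀ hB hδ hδc hδcδ hE hHH HV HVI =>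
      e4h2G_transfer_KACU P c35 G (f j) (par j) (parB j) b (ιB j) (C37 j) (C38 j) (hι j) hG1 hM₂ hrepr
        (fun δ' => M₂ * (∑ j, ‖b j‖) + cXY (d := d) (ℓ := ℓ) b M₂ mN δ') α₀ c c' α₁ B₀ B δ δc Bβ Bε Bεβ hM hα₀ hMa hreg hα₁ haW' h37 hB₀ hB hδ hδc hδcδ
        (le_add_of_nonneg_right (cXY_nonneg (d := d) (ℓ := ℓ) b hM₂ mN δ)) hE hHH HV HVI }

/-- ★★ **`StepE4Pos` OF THE CODED BOND FAMILY `KACU` THROUGH THE FRAME — THE (3.44) MEMBER OF THE SECT.-B STEP OF RECORD, G SIDE** (r06's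
`stepE4Pos_of_e4h2GFrame₆` on `e4h2GFrame₆CodedOn`), GIVEN the Lemma-2.1 datum of the frame.
[cite: Balaban1985BackgroundPropagators, Thm 3.4 p.400, Thm 3.3 p.399, (3.44) p.398, (3.82)–(3.86) p.407; Balaban1984PropagatorsII, Lemma 2.1 p.234, (2.51) p.232] -/
theorem stepE4Pos_KACU_frame_on (hι : ∀ (j : J) (s : BlkY (f j).toKIdx), β (f j).toKIdx.hN (f j).toKIdx.D (f j).toKIdx.hk (ιB j s) = s)
    (hG1 : ∀ u : 𝔸ˣ, u ∈ G → ‖(u : 𝔸)‖ ≤ 1) (hpar : ∀ j (U : CfgY 𝔸 (f j).toKIdx), GVal G (f j).toKIdx U → ∀ z w, par j U z w ∈ G)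
    (hunit : ∀ j (U : CfgY 𝔸 (f j).toKIdx), GVal G (f j).toKIdx U → IsUnit (deltaPrimeAY (f j).toKIdx (par j) U))
    (M₂ : ℝ) (hM₂ : 0 ≤ M₂) (hrepr : ∀ (v : 𝔸) (j : ι), |b.repr v j| ≤ M₂ * ‖v‖) (hcR : 0 < M₂ * ∑ j, ‖b j‖)
    (Cq : ℝ) (hCq : 0 ≤ Cq) (hC37 : ∀ j β' U a, C37 j β' U a → GVal G (f j).toKIdx U ∧ CplxLettersY G (f j) (par j) (ιB j) Cq β' U a)
    (MInv aInv aW : ℝ) (hMInv : 0 < MInv) (haInv : 0 < aInv) (haW : 0 < aW)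
    (hunitX : ∀ j (U : CfgY 𝔸 (f j).toKIdx), GVal G (f j).toKIdx U → IsUnit (XY (f j).toKIdx (par j) (GpY (f j).toKIdx (par j)) U))
    (hsym : ∀ j (U : CfgY 𝔸 (f j).toKIdx) (z w : SiteY (f j).toKIdx), par j U z w = (par j U w z)⁻¹)
    (hunitA : ∀ j (α₀ : ℝ) (U : CfgY 𝔸 (f j).toKIdx), (bg9YC 𝔸 G P (f j)).Reg335 c35 α₀ U → IsUnit (deltaAY (f j).toKIdx (par j) (parB j) (GpY (f j).toKIdx (par j)) U))
    (hparB : ∀ j (U : CfgY 𝔸 (f j).toKIdx), GVal G (f j).toKIdx U → ∀ y f', parB j U y f' ∈ G) (hb₁ : 0 ≤ b₁)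
    (C₀ : ℝ) (hC₀ : 0 ≤ C₀)
    (hreg335P : ∀ j (α₀ : ℝ) (U : CfgY 𝔸 (f j).toKIdx), MInv ≤ (geo9Y (f j)).M → 0 < α₀ → (geo9Y (f j)).M * α₀ ≤ aInv →
      (bg9YC 𝔸 G P (f j)).Reg335 c35 α₀ U → Reg335PlaqY G (f j) (ιB j) C₀ U)
    (hC37G : ∀ j β' U a, C37 j β' U a → CplxLettersGY G (f j) (ιB j) β' U a)
    (cVar : ℝ) (hcVar : 0 ≤ cVar) (hvarB : ∀ j β' U a, C37 j β' U a → VarParBY (f j).toKIdx (parB j) cVar β' U a)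
    (hMd : 2 * ((d : ℝ) + 1) < MInv) (mN : ℕ) (hnbr : ∀ (j : J) (y' : IBondY (f j).toKIdx), (nbr (geo9Y (f j)) (2 * ((d : ℝ) + 1)) y').card ≤ mN) (d261 : ℝ → ℕ)
    (h261 : ∀ (j : J) (δ α : ℝ), 0 < δ → δ ≤ 1 → 9 / 5000 ≤ α → α < 1 →
      (e4h2GFrame₆CodedOn P f c35 G par parB b ιB C37 C38 hι hG1 hpar hunit M₂ hM₂ hrepr hcR Cq hCq hC37 MInv aInv aW hMInv haInv haW hunitX hsym hunitA hparB hb₁ C₀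
      hC₀ hreg335P hC37G cVar hcVar hvarB hMd mN hnbr).M261 δ ≤ (geo9Y (f j)).M → Ineq261 (d261 δ) (toB6 (geo9Y (f j)) 0 True) δ α) :
    StepE4Pos (d + 1) c35 (fun j => geo9Y (f j)) (fun j => (codingYx P G (f j) (C37 j) (C38 j)).bg) (fun j => KSC P G (f j) (par j) (C37 j) (C38 j))
      (fun j => KACU P G (f j) (GAY (f j).toKIdx (par j) (parB j) (GpY (f j).toKIdx (par j))) (parB j) (C37 j) (C38 j))
      (fun j => pullS (codingYx P G (f j) (C37 j) (C38 j)) (CinvY P f G par j))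
      (fun j => KACU P G (f j) (GAY (f j).toKIdx (par j) (parB j) (GpY (f j).toKIdx (par j))) (parB j) (C37 j) (C38 j)) :=
  B9SectBE4H2GFrameV6.stepE4Pos_of_e4h2GFrame₆ (F := e4h2GFrame₆CodedOn P f c35 G par parB b ιB C37 C38 hι hG1 hpar hunit M₂ hM₂ hrepr hcR Cq hCq hC37 MInv aInv aW hMInv haInv haW hunitX hsym hunitA hparB hb₁ C₀
      hC₀ hreg335P hC37G cVar hcVar hvarB hMd mN hnbr) d261 h261

/-- ★★ **`StepH2Pos` OF THE CODED BOND FAMILY `KACU` THROUGH THE FRAME — THE (3.45) MEMBER OF THE SECT.-B STEP OF RECORD, G SIDE** (r06's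
`stepH2Pos_of_e4h2GFrame₆` on `e4h2GFrame₆CodedOn`), GIVEN the Lemma-2.1 datum of the frame.
[cite: Balaban1985BackgroundPropagators, Thm 3.4 p.400, Thm 3.3 p.399, (3.45) p.398, (3.82)–(3.86) p.407; Balaban1984PropagatorsII, Lemma 2.1 p.234, (2.51) p.232] -/
theorem stepH2Pos_KACU_frame_on (hι : ∀ (j : J) (s : BlkY (f j).toKIdx), β (f j).toKIdx.hN (f j).toKIdx.D (f j).toKIdx.hk (ιB j s) = s)
    (hG1 : ∀ u : 𝔸ˣ, u ∈ G → ‖(u : 𝔸)‖ ≤ 1) (hpar : ∀ j (U : CfgY 𝔸 (f j).toKIdx), GVal G (f j).toKIdx U → ∀ z w, par j U z w ∈ G)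
    (hunit : ∀ j (U : CfgY 𝔸 (f j).toKIdx), GVal G (f j).toKIdx U → IsUnit (deltaPrimeAY (f j).toKIdx (par j) U))
    (M₂ : ℝ) (hM₂ : 0 ≤ M₂) (hrepr : ∀ (v : 𝔸) (j : ι), |b.repr v j| ≤ M₂ * ‖v‖) (hcR : 0 < M₂ * ∑ j, ‖b j‖)
    (Cq : ℝ) (hCq : 0 ≤ Cq) (hC37 : ∀ j β' U a, C37 j β' U a → GVal G (f j).toKIdx U ∧ CplxLettersY G (f j) (par j) (ιB j) Cq β' U a)
    (MInv aInv aW : ℝ) (hMInv : 0 < MInv) (haInv : 0 < aInv) (haW : 0 < aW)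
    (hunitX : ∀ j (U : CfgY 𝔸 (f j).toKIdx), GVal G (f j).toKIdx U → IsUnit (XY (f j).toKIdx (par j) (GpY (f j).toKIdx (par j)) U))
    (hsym : ∀ j (U : CfgY 𝔸 (f j).toKIdx) (z w : SiteY (f j).toKIdx), par j U z w = (par j U w z)⁻¹)
    (hunitA : ∀ j (α₀ : ℝ) (U : CfgY 𝔸 (f j).toKIdx), (bg9YC 𝔸 G P (f j)).Reg335 c35 α₀ U → IsUnit (deltaAY (f j).toKIdx (par j) (parB j) (GpY (f j).toKIdx (par j)) U))
    (hparB : ∀ j (U : CfgY 𝔸 (f j).toKIdx), GVal G (f j).toKIdx U → ∀ y f', parB j U y f' ∈ G) (hb₁ : 0 ≤ b₁)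
    (C₀ : ℝ) (hC₀ : 0 ≤ C₀)
    (hreg335P : ∀ j (α₀ : ℝ) (U : CfgY 𝔸 (f j).toKIdx), MInv ≤ (geo9Y (f j)).M → 0 < α₀ → (geo9Y (f j)).M * α₀ ≤ aInv →
      (bg9YC 𝔸 G P (f j)).Reg335 c35 α₀ U → Reg335PlaqY G (f j) (ιB j) C₀ U)
    (hC37G : ∀ j β' U a, C37 j β' U a → CplxLettersGY G (f j) (ιB j) β' U a)
    (cVar : ℝ) (hcVar : 0 ≤ cVar) (hvarB : ∀ j β' U a, C37 j β' U a → VarParBY (f j).toKIdx (parB j) cVar β' U a)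
    (hMd : 2 * ((d : ℝ) + 1) < MInv) (mN : ℕ) (hnbr : ∀ (j : J) (y' : IBondY (f j).toKIdx), (nbr (geo9Y (f j)) (2 * ((d : ℝ) + 1)) y').card ≤ mN) (d261 : ℝ → ℕ)
    (h261 : ∀ (j : J) (δ α : ℝ), 0 < δ → δ ≤ 1 → 9 / 5000 ≤ α → α < 1 →
      (e4h2GFrame₆CodedOn P f c35 G par parB b ιB C37 C38 hι hG1 hpar hunit M₂ hM₂ hrepr hcR Cq hCq hC37 MInv aInv aW hMInv haInv haW hunitX hsym hunitA hparB hb₁ C₀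
      hC₀ hreg335P hC37G cVar hcVar hvarB hMd mN hnbr).M261 δ ≤ (geo9Y (f j)).M → Ineq261 (d261 δ) (toB6 (geo9Y (f j)) 0 True) δ α) :
    StepH2Pos (d + 1) c35 (fun j => geo9Y (f j)) (fun j => (codingYx P G (f j) (C37 j) (C38 j)).bg) (fun j => KSC P G (f j) (par j) (C37 j) (C38 j))
      (fun j => KACU P G (f j) (GAY (f j).toKIdx (par j) (parB j) (GpY (f j).toKIdx (par j))) (parB j) (C37 j) (C38 j))
      (fun j => pullS (codingYx P G (f j) (C37 j) (C38 j)) (CinvY P f G par j))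
      (fun j => KACU P G (f j) (GAY (f j).toKIdx (par j) (parB j) (GpY (f j).toKIdx (par j))) (parB j) (C37 j) (C38 j)) :=
  B9SectBE4H2GFrameV6.stepH2Pos_of_e4h2GFrame₆ (F := e4h2GFrame₆CodedOn P f c35 G par parB b ιB C37 C38 hι hG1 hpar hunit M₂ hM₂ hrepr hcR Cq hCq hC37 MInv aInv aW hMInv haInv haW hunitX hsym hunitA hparB hb₁ C₀
      hC₀ hreg335P hC37G cVar hcVar hvarB hMd mN hnbr) d261 h261

end Steps

end Literature.MathematicalPhysics.QuantumFieldTheory.Balaban1983to89.B9SectBE4H2GFrameCodedYR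

end

/-!
# `Balaban1983to89.B9SectBGStepCodedFR` — THE CLASS-PARAMETRIC TWIN of `B9SectBGStepCodedF` (CASCADE-R, director-ym №279 GO-R; №277 (3) `hunitA` cure; dag-n06-d SOCKET-(α) class question)

statement-level skeleton of published theorems with citation tags; proofs where landed; nothing here is a claim about the
Yang–Mills mass gap

WHAT THIS FILE IS.  The original module `B9SectBGStepCodedF` types its objects over MODULE 3's member carrier `bg9Y 𝔸 G x` (MODULE 2's small-cube class (3.35)).  This file RE-DECLARES, with UNCHANGED NAMES inside the namespace `…B9SectBGStepCodedFR`, exactly its 4 class-dependent declarations over the CLASS-PARAMETRIC carrier `B9SectBCodedClassR.bg9YC 𝔸 G P x` (`P : RegExtraY …` = the two cube conditions of (3.35)∕(3.36) as a parameter; `bg9Y 𝔸 G x = bg9YC 𝔸 G (extraY 𝔸 G) x` by `rfl`, so every declaration here WITHOUT the `hunitA` binder specialises definitionally to its original; EXCEPTION (v1.1, №288 (4), ref-E READ-9∕13 species HEADER-NIT): `stepEPos_KACU_of_385` carries the №277 RE-KEYED `hunitA` (WEAKER hypothesis), so at `P := extraY 𝔸 G` it IMPLIES the original via `fun j α₀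 U hU => hunitA j U hU.1.1` (ref-E K3), NOT a definitional specialisation; CAVEAT (LOCATED-18, №290 (1)): no α₀-threshold ⇒ still uninhabitable at `SU(N)` — consumers use the GUARDED `…RG` twin; at the record's reading of PRINT's class, `P := extraYPb 𝔸 G`, the displayed laws `hreg335P` ((3.35) on plaquettes) and the class-keyed `hunitA` become theorems).  The text is the original's VERBATIM under the token surgery `bg9Y 𝔸 G ↦ bg9YC 𝔸 G P`, `NAME ↦ NAME P` for the class-dependent names (P the first explicit argument), and — №277 — the binder `hunitA` re-keyed from «all G-valued U» to «all (3.35)-regular U of the carrier» (`∀ j α₀ U, (bg9YC 𝔸 G P (f j)).Reg335 c35 α₀ U → IsUnit (deltaAY …)`) with its use sites (`hunitA j U hU ↦ hunitA j α₀ U hU`) — NOT verbatim for the declaration named above.  Class-free declarations of the original are NOT copied: they are imported and used BY NAME (`open … hiding` the re-declared ones).  Generated by dag-n06-c g16's `gen.py` (HOME `pub-ymgap-dag-n06-c/lean/g16/`); the ORIGINAL MODULE DOCUMENTATION FOLLOWS VERBATIM and describes the mathematics.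

HONEST SCOPE.  Re-typing bookkeeping; nothing of [B9] asserted beyond the original; COUNT-NEUTRAL; N06 NOT discharged; nothing continuum ∕ OS ∕ mass gap ∕ Clay.  Cell `pub-ymgap` (D-0062), Track A node N06 [B9], seat `pub-ymgap-dag-n06-c` g16, 2026-08-29.
-/

/-!
# Balaban [B9], Thm 3.4 p. 400 with Thm 3.3 p. 399 and (3.84)–(3.86) p. 407 — THE (3.42) MEMBER OF THE SECT.-B STEP OF RECORD FOR THE
# BOND SECTOR `KACU` (print's reading R13-U1), ROUTE F: r06's LETTER-FREE (3.84)–(3.86) engines run on NODE 00's own bond carrier, with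
# print's (3.85) DISPLAYED — `DaF` ∕ `GbF` ∕ `VF`, `GbF_eq_of_two_sided`, ★ `Step385F`, ★★ `eBlock_KACU_prod_of_385`, ★★★ `stepEPos_KACU_of_385`

T. Bałaban, *Propagators for lattice gauge theories in a background field*, Commun. Math. Phys. **99** (1985) 389–434
[`Balaban1985BackgroundPropagators`, "B9"]; [4] = T. Bałaban, *Propagators and renormalization transformations for lattice gauge
theories. II*, Commun. Math. Phys. **96** (1984) 223–250 [`Balaban1984PropagatorsII`].

statement-level skeleton of published theorems with citation tags; proofs where landed; nothing here is a claim about the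
Yang–Mills mass gap

THE PRINTED LOCUS (p. 407, verbatim): *«We can write (3.82) as Δ_a(U′U) = Δ_a(U) − V(A) = (I − V(A)G(U))Δ_a(U). (3.84) Using the bounds
(3.73), (3.77), (3.83) and assuming that Theorem 3.3 holds for G(U), we get |(V(A)G(U)J)(b)| ≦ O(1)α₁e^{−(1/2)δ₀d(y,y′)}|J| for b ∈ Δ(y),
supp J ⊂ Δ(y′). (3.85) … hence V(A)G(U) is a small operator in supremum norm, and we have G(U′U) = G(U)(I − V(A)G(U))⁻¹ = Σ_{n=0}^∞
G(U)(V(A)G(U))ⁿ, (3.86) and convergence is in the operator norm for α₁ sufficiently mall [sic]. … This way we get all these inequalities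
for the operator G(U′U).»*; Thm 3.3 p. 399 («the operator G(U) (a = 1) satisfies the inequalities (3.42)–(3.47)»); (3.27) p. 395
(«G(U) = Δ_a(U)⁻¹»); (3.42) p. 397.

WHY THIS FILE (pub-ymgap N06 row 13, G side; seat dag-n06-c gen 13).  The target of record `B9SectBCodedReadingsU.SectBStepU` asks, for the
bond-sector family `KACU` (NODE 00's U-letter reading `kernelFamilyBU` of the letter `OA := G(·) = Node00.GAY parS parB GpS` over the coded
carrier), the positive-input block-step `StepEPos … (KACU∘f)`: the (3.42) block of `G(U′U)` for `U′` in the class (3.37) at `α₁ ≦ a₁`, from Theorems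
3.1–3.3 at `U`.  The letters route (frames `B9SectBGFrameV3` + an instance identifying NODE 00's `Δ_a(V)` with r06's concrete word — DESIGN
POINT 2 of the seat's G-SIDE-PLAN; LOCATED-12: the frames' law `coord_mul` is moreover not inhabitable at the coded root) is not available.  THIS FILE
takes print's own three-line route (3.84) ⇒ (3.86) in r06's LETTER-FREE operator form (`B9Ineq385VG.exists_gExt_of_385`, `gExt_leftEntry_of_386`,
`B9Ineq386RightEntry.gExt_rightEntry_of_386L`), run DIRECTLY on NODE 00's bond carrier `FBondY × ι` (block map `ι_B ∘ blkV1`) where gen 12's (3.42)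
READ ∕ WRITE dictionary `B9SectBGReadY.readG342Y_KACU` ∕ `writeG342Y_KACU` lives — so NO identification of `Δ_a` between models is needed: `Δ_a(U)`,
`G(U)`, `V(A) := Δ_a(U) − Δ_a(U′U)` are NODE 00's own operators in real coordinates (§1), and the inverse `G(U′U)` the Neumann series produces IS
NODE 00's `GAY (U′U)` by uniqueness of two-sided inverses (`GbF_eq_of_two_sided`).
* §1 `DaF V := conj b (Δ_a(V)|ℝ)`, `GbF V := conj b (G(V)|ℝ)`, `VF U a := DaF U − DaF (e^{iηa}U)`; `DaF_mul_GbF` ∕ `GbF_mul_DaF` (under `IsUnit Δ_a(V)`),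
  `DaF_sub_VF`, ★ `GbF_eq_of_two_sided` (a two-sided inverse of `DaF W` forces `Δ_a(W)` bijective, hence a unit, and is `GbF W`).
* §2 the block map `blkF`, the output predicate `Maj385F` and ★ **`Step385F` — print's (3.85) `V(A)G(U) ≺ κ·α₁·e^{−ρd}` AND ITS LEFT TWIN
  `G(U)V(A) ≺ κ·α₁·e^{−ρd}` at NODE 00's letters, DISPLAYED in the positive-input step shape `B9SectBStepWhole.StepPos … (ℝ × ℝ)`** (output
  `(κ, ρ)` uniform in the member; inputs = Theorems 3.1–3.3 at `U`, exactly print's «assuming that Theorem 3.3 holds for G(U)» plus the (3.77)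
  dependence on Theorems 3.1–3.2).  The twin is NOT printed: r06 derives it (`B9Ineq386CommSum.hasMajorant_GV_of_gradForm_comm_sum`) because the
  operator-form right entry (3.42)₃ needs it; here both are HYPOTHESES.
* §3 ★★ `eBlock_KACU_prod_of_385` — ONE configuration, explicit constants: `EBlock KACU B₀ δ₀ (base U)`, the two majorants at `(U, a)`, [4] (2.61)
  and the scale transfer of `Lʲη` at `ρ₀ := min ρ δ₀`, exponent `α′ ∈ [0, 1/3]`, and `κα₁c₁(α′) ≦ 1/2` give `EBlock KACU (M₂Σ‖b‖·2(M₂Σ‖b‖B₀)Λ²(c₁+1))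
  ((1−3α′)ρ₀) (prod U a)` and `IsUnit Δ_a(e^{iηa}U)` (the analytic-extension clause for G: `GAY_inv_prod_of_385`).
* §4 ★★★ `stepEPos_KACU_of_385 : … → StepEPos dB c35 (geo9Y∘f) (codingYx …).bg (KSCU∘f) (KACU∘f) (pullS Cinv) (KACU∘f)` from the structural
  binders `hι` (section of `β`), `hM₂`∕`hrepr`∕`hcR` (real coordinates of `𝔸`), the DISPLAYED `hunitA : GVal U → IsUnit (Δ_a(U))` (Thm 3.3 ∕ 3.11's
  regime) and `h385 : Step385F …`; thresholds from n06-k's (2.61) supplier (`B9SectBGpFrameCodedY.exists_d261`) and window scale transfers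
  (`B9RWSums347DefiniteFacesWindow.scaleTransfer6_window_geo9Y`) at `α′ = 1/100`.

HONEST SCOPE.  (3.85) and its left twin are HYPOTHESES (named, printed locus p. 407), not proved here; so is the invertibility of `Δ_a(U)` at
`G`-valued `U`.  Everything else is NODE 00's definitions + r06's kernel-checked engines + gen 12's dictionary.  The Hölder ∕ `L²` ∕ (3.47) members of
`KACU` are NOT here.  Count-neutral; N06 NOT discharged; no summit ∕ sub-problem statement is proved; one finite lattice programme — nothing
continuum ∕ OS ∕ mass-gap ∕ Clay.  No `sorry`, no `axiom`, no `instance`, no `notation`.  Seat dag-n06-c g13, 2026-08-28; `--supports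
stmt-QuantumFields-27364`.

RELATED IN THE TREE, NOT DUPLICATED: r06 `B9Ineq385VG` ((3.83)∕(3.85)∕(3.86) DERIVED in r06's letters; §6 `exists_gExt_of_385`, §5 `gExt_leftEntry_of_386`
USED BY NAME), `B9Ineq386RightEntry` (`gExt_rightEntry_of_386L` USED BY NAME), `B9Thm34GEntries342` ∕ `B9Thm34GUniformBlk` (the same for r06's CONCRETE
`Δ_a` word — the letters route), gen 12 `B9SectBGReadY` (READ ∕ WRITE), `B9SectBGFrameV3` (the frames of the letters route), NODE 00 `Node00.OpsYDeltaA`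
(`deltaAY`, `GAY`, `deltaAY_mul_GAY`), gen 7 `B9SectBGpLettersY.gopC_eq` (the `G′` twin of `GbF_eq_of_two_sided`, with print's units).
-/

noncomputable section

namespace Literature.MathematicalPhysics.QuantumFieldTheory.Balaban1983to89.B9SectBGStepCodedFR

open Literature.MathematicalPhysics.QuantumFieldTheory.Balaban1983to89.B9SectBCodedClassR (RegExtraY bg9YC)
open Literature.MathematicalPhysics.QuantumFieldTheory.Balaban1983to89.B9SectBGStepCodedF hiding Step385F eBlock_KACU_prod_of_385 GAY_inv_prod_of_385 stepEPos_KACU_of_385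

open Literature.MathematicalPhysics.QuantumFieldTheory.Balaban1983to89
open Literature.MathematicalPhysics.QuantumFieldTheory.Balaban1983to89.B6RandomWalk (HasMajorant hasMajorant_mono Triangle254 Ineq261)
open Literature.MathematicalPhysics.QuantumFieldTheory.Balaban1983to89.B9Thm34Ext (toB6)
open Literature.MathematicalPhysics.QuantumFieldTheory.Balaban1983to89.B9Ineq347 (ScaleTransfer)
open Literature.MathematicalPhysics.QuantumFieldTheory.Balaban1983to89.B9Ineq385VG (exists_gExt_of_385 gExt_leftEntry_of_386)
open Literature.MathematicalPhysics.QuantumFieldTheory.Balaban1983to89.B9Ineq386RightEntry (gExt_rightEntry_of_386L)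
open Literature.MathematicalPhysics.QuantumFieldTheory.Balaban1983to89.B9FromB6 (EBlock)
open Literature.MathematicalPhysics.QuantumFieldTheory.Balaban1983to89.B9Eq39Adjoint (fluct)
open Literature.MathematicalPhysics.QuantumFieldTheory.Balaban1983to89.B9Eq352DivFormLetters (conj coordEquiv)
open Literature.MathematicalPhysics.QuantumFieldTheory.Balaban1983to89.B6GlobalChartV1 (blkV1)
open Literature.MathematicalPhysics.QuantumFieldTheory.Balaban1983to89.B6KLevelCensusIndexV1 (KIdx kGeo)
open Literature.MathematicalPhysics.QuantumFieldTheory.Balaban1983to89.B6Ineq2142KLevelV1 (β)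
open Literature.MathematicalPhysics.QuantumFieldTheory.Balaban1983to89.B9GeoNormsKLevelV1 (geo9K)
open Literature.MathematicalPhysics.QuantumFieldTheory.Balaban1983to89.B9CoReadingCoords (cdBₗ cdsBₗ lapBₗ lapBₗ_apply)
open Literature.MathematicalPhysics.QuantumFieldTheory.Balaban1983to89.B9SectBCodedCarrier (CCfg Coding pullS)
open Literature.MathematicalPhysics.QuantumFieldTheory.Balaban1983to89.B9Eq360DeltaPrimeAY (AfldY mulY)
open Literature.MathematicalPhysics.QuantumFieldTheory.Balaban1983to89.B9PinMembersKLevelV1 (MemberY geo9Y bg9Y)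
open Literature.MathematicalPhysics.QuantumFieldTheory.Balaban1983to89.B9SectBGpLettersY (GVal decY)
open Literature.MathematicalPhysics.QuantumFieldTheory.Balaban1983to89.B9SectBGpLettersY (conj_one)
open Literature.MathematicalPhysics.QuantumFieldTheory.Balaban1983to89.B9SectBGpFrameCodedYR (codingYx)
open Literature.MathematicalPhysics.QuantumFieldTheory.Balaban1983to89.B9SectBGpFrameCodedY (exists_d261)
open Literature.MathematicalPhysics.QuantumFieldTheory.Balaban1983to89.B9SectBCodedReadingsUR (KSCU KACU)
open Literature.MathematicalPhysics.QuantumFieldTheory.Balaban1983to89.B9SectBGReadYR (readG342Y_KACU writeG342Y_KACU)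
open Literature.MathematicalPhysics.QuantumFieldTheory.Balaban1983to89.B9SectBStepWhole (StepPos StepEPos)
open Literature.MathematicalPhysics.QuantumFieldTheory.Balaban1983to89.B9GeoLemma21KLevelV1 (geo9Y_dist_triangle geo9Y_dist_self geo9Y_dist_comm
  geo9Y_len_pos geo9K_len_pos)
open Literature.MathematicalPhysics.QuantumFieldTheory.Balaban1983to89.B9RWSums347DefiniteFacesWindow (geo9Y_dist_nonneg scaleTransfer6_window_geo9Y)
open Literature.MathematicalPhysics.QuantumFieldTheory.Balaban1983to89.Node00 (SiteY BlkY FBondY IBondY CfgY SiteParY BondParY SiteOpY BondOpY deltaAY GAY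
  deltaAY_mul_GAY GAY_mul_deltaAY)

variable {d ℓ : ℕ} {hd : 1 ≤ d + 1} {hL : Odd (ℓ + 1) ∧ 1 < ℓ + 1} {b₀ b₁ : ℝ} {Mstar : ℕ}
variable {𝔸 : Type} [NormedRing 𝔸] (P : RegExtraY d ℓ hd hL b₀ b₁ Mstar 𝔸) [NormedAlgebra ℂ 𝔸] [CompleteSpace 𝔸]
variable {ι : Type} [Fintype ι]

/-! ## §1 NODE 00's `Δ_a(V)`, `G(V)` and the variation `V(A) = Δ_a(U) − Δ_a(U′U)` in real coordinates on the bond carrier -/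

section Letters

variable (i : KIdx d ℓ hd hL b₀ b₁) (parS : SiteParY 𝔸 i) (parB : BondParY 𝔸 i) (GpS : SiteOpY 𝔸 i) (b : Module.Basis ι ℝ 𝔸)

end Letters

/-! ## §2 The block map of the bond carrier, the two (3.85) majorants, and (3.85) DISPLAYED in the positive-input step shape -/

section Display

variable (x : MemberY d ℓ hd hL b₀ b₁ Mstar) (parS : SiteParY 𝔸 x.toKIdx) (parB : BondParY 𝔸 x.toKIdx) (GpS : SiteOpY 𝔸 x.toKIdx)
  (b : Module.Basis ι ℝ 𝔸) (ιB : BlkY x.toKIdx → IBondY x.toKIdx)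

end Display

section Step385

variable {J : Type} (f : J → MemberY d ℓ hd hL b₀ b₁ Mstar) [∀ x : MemberY d ℓ hd hL b₀ b₁ Mstar, Fintype (geo9Y x).Site]
  (dB : ℕ) (c35 : ℝ) (G : Subgroup 𝔸ˣ) (b : Module.Basis ι ℝ 𝔸)
  (par parS : ∀ j : J, SiteParY 𝔸 (f j).toKIdx) (parB : ∀ j : J, BondParY 𝔸 (f j).toKIdx) (GpS : ∀ j : J, SiteOpY 𝔸 (f j).toKIdx)
  (ιB : ∀ j : J, BlkY (f j).toKIdx → IBondY (f j).toKIdx)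
  (C37 C38 : ∀ j : J, ℝ → CfgY 𝔸 (f j).toKIdx → AfldY 𝔸 (f j).toKIdx → Prop)
  (Cinv : ∀ j : J, B9.SiteKernel (geo9Y (f j)) (bg9YC 𝔸 G P (f j)))

/-- ★ **(3.85) AND ITS LEFT TWIN, DISPLAYED IN THE POSITIVE-INPUT STEP SHAPE** for the family `(KSCU, KACU, C⁻¹)` of the Sect.-B step of record over
the coded carrier (`KACU` reading the letter `G(·) = Node00.GAY parS parB GpS`): for every positive input tuple of Theorems 3.1–3.3 there are thresholds
`M₀, a₁, a₀′` and an output `(κ, ρ)`, `κ ≧ 0`, `ρ > 0`, such that at every member above `M₀`, every (3.35)-regular `U` at which Theorems 3.1–3.3 hold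
with the inputs, every `0 < α₁ ≦ a₁` and every `U′ = e^{iηa}` in the class (3.37) (on the coded carrier: the pair `(base U, mult a)`): `V(A)G(U) ≺ κα₁e^{−ρd}` (print's (3.85), with `O(1)` and `½δ₀`
named `κ`, `ρ`) and `G(U)V(A) ≺ κα₁e^{−ρd}` (its left twin, derived in the tree at r06's letters by `B9Ineq386CommSum.hasMajorant_GV_of_gradForm_comm_sum`).
A `Prop` — the HYPOTHESIS `h385` of `stepEPos_KACU_of_385`; nothing asserted. [cite: Balaban1985BackgroundPropagators, (3.85) p.407 («Using the bounds (3.73), (3.77), (3.83) and assuming that Theorem 3.3 holds for G(U), we get …»), Thm 3.4 p.400] -/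
def Step385F : Prop :=
  StepPos dB c35 (fun j => geo9Y (f j)) (fun j => (codingYx P G (f j) (C37 j) (C38 j)).bg)
    (fun j => KSCU P G (f j) (par j) (C37 j) (C38 j))
    (fun j => KACU P G (f j) (GAY (f j).toKIdx (parS j) (parB j) (GpS j)) (parB j) (C37 j) (C38 j))
    (fun j => pullS (codingYx P G (f j) (C37 j) (C38 j)) (Cinv j)) (ℝ × ℝ) (fun c => 0 ≤ c.1 ∧ 0 < c.2)
    (fun c j U α₁ => ∀ U' : (codingYx P G (f j) (C37 j) (C38 j)).bg.Cfg, (codingYx P G (f j) (C37 j) (C38 j)).bg.Cplx337 α₁ U U' →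
      ∀ (U₀ : CfgY 𝔸 (f j).toKIdx) (a : AfldY 𝔸 (f j).toKIdx), U = .base U₀ → U' = .mult a →
        Maj385F (f j) (parS j) (parB j) (GpS j) b (ιB j) c.1 c.2 α₁ U₀ a)

end Step385

/-! ## §3 ★★ The (3.42) block of `KACU` at a coded product from (3.85): ONE configuration, explicit constants -/

section Core

variable (G : Subgroup 𝔸ˣ) (x : MemberY d ℓ hd hL b₀ b₁ Mstar) (parS : SiteParY 𝔸 x.toKIdx) (parB : BondParY 𝔸 x.toKIdx) (GpS : SiteOpY 𝔸 x.toKIdx)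
  (b : Module.Basis ι ℝ 𝔸) (ιB : BlkY x.toKIdx → IBondY x.toKIdx) (C37 C38 : ℝ → CfgY 𝔸 x.toKIdx → AfldY 𝔸 x.toKIdx → Prop)

omit [NormedAlgebra ℂ 𝔸] [CompleteSpace 𝔸] [Fintype ι] in
/-- majorant bookkeeping: `A·P(a)·e^{−rd} ≦ A′·P(a)·e^{−r′d}` for `A ≦ A′`, `0 ≦ A′`, `r′ ≦ r`, `P, d ≧ 0`. [folklore] [cite: Balaban1984PropagatorsII, (2.51) p.232] -/
private theorem maj_reshape [Fintype (geo9Y x).Site] {X : Type} (blk : X → (geo9Y x).Site) {T : Module.End ℝ (X → ℝ)}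
    {A A' r r' : ℝ} (P : (geo9Y x).Site → ℝ) (hP : ∀ a, 0 ≤ P a) (hA : A ≤ A') (hA' : 0 ≤ A') (hr : r' ≤ r)
    (h : HasMajorant (g := toB6 (geo9Y x) 0 True) blk T (fun a a' => A * P a * Real.exp (-(r * (geo9Y x).dist a a')))) :
    HasMajorant (g := toB6 (geo9Y x) 0 True) blk T (fun a a' => A' * P a * Real.exp (-(r' * (geo9Y x).dist a a'))) := by
  refine hasMajorant_mono (g := toB6 (geo9Y x) 0 True) blk h fun a a' => ?_
  have hd : 0 ≤ (geo9Y x).dist a a' := geo9Y_dist_nonneg x a a'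
  have he : Real.exp (-(r * (geo9Y x).dist a a')) ≤ Real.exp (-(r' * (geo9Y x).dist a a')) :=
    Real.exp_le_exp.2 (by nlinarith)
  calc A * P a * Real.exp (-(r * (geo9Y x).dist a a'))
      ≤ A' * P a * Real.exp (-(r * (geo9Y x).dist a a')) :=
        mul_le_mul_of_nonneg_right (mul_le_mul_of_nonneg_right hA (hP a)) (Real.exp_pos _).le
    _ ≤ A' * P a * Real.exp (-(r' * (geo9Y x).dist a a')) := mul_le_mul_of_nonneg_left he (mul_nonneg hA' (hP a))

/-- ★★ **THE (3.42) BLOCK OF `G(U′U)` READ BY `KACU` AT THE CODED PRODUCT, FROM (3.85) — ONE CONFIGURATION, EXPLICIT CONSTANTS.**  Data: a base `U` with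
`Δ_a(U)` invertible; Theorem 3.3's (3.42) block of `KACU` at `base U` with `(B₀, δ₀)`; the two (3.85) majorants at `(U, a)` with `(κα₁, ρ)`; [4] (2.61) and
the scale transfer of `Lʲη` at the common rate `ρ₀ = min ρ δ₀` and an exponent `0 ≦ α′ ≦ 1/3` with constant `Λ ≧ 1`; the smallness `κα₁c₁(α′) ≦ ½`
(«for α₁ sufficiently small»).  Conclusion: `EBlock KACU (M₂Σ‖b‖·(2(M₂Σ‖b‖B₀)Λ²(c₁+1))) ((1−3α′)ρ₀) (prod U a)` and `IsUnit Δ_a(e^{iηa}U)`.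
Proof = print's p. 407: READ the four majorants of `G(U)`, `∇_νG(U)`, `G(U)∇*_ν`, `Δ_UG(U)` from the block (gen 12 `readG342Y_KACU`), (3.84) ⇒ (3.86)
(`exists_gExt_of_385`: the two-sided inverse `G̃` of `Δ_a(U) − V(A) = Δ_a(U′U)` with both resolvent identities), `G̃ = G(U′U)` (`GbF_eq_of_two_sided`),
[4] (2.66) for the three left entries (`gExt_leftEntry_of_386`) and the right entry (`gExt_rightEntry_of_386L`, the twin), then WRITE the block at the coded
product (gen 12 `writeG342Y_KACU`: U-letter differences at the base, operator at the product — R13-U1).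
[cite: Balaban1985BackgroundPropagators, Thm 3.4 p.400 + (3.84)–(3.86) p.407 + Thm 3.3 (3.42) pp.397/399 + (3.27) p.395; Balaban1984PropagatorsII, (2.66) p.234 + Lemma 2.1 p.234 + (2.51) p.232] -/
theorem eBlock_KACU_prod_of_385 [Fintype (geo9Y x).Site] [DecidableEq ι]
    (hι : ∀ s, β x.toKIdx.hN x.toKIdx.D x.toKIdx.hk (ιB s) = s)
    {M₂ : ℝ} (hM₂ : 0 ≤ M₂) (hrepr : ∀ (v : 𝔸) (j : ι), |b.repr v j| ≤ M₂ * ‖v‖)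
    {U : CfgY 𝔸 x.toKIdx} {a : AfldY 𝔸 x.toKIdx} (hunit : IsUnit (deltaAY x.toKIdx parS parB GpS U))
    {B₀ δ₀ κ ρ α₁ α' Λ : ℝ} (d₂ : ℕ) (hB₀ : 0 < B₀) (hδ₀ : 0 < δ₀) (hκ : 0 ≤ κ) (hρ : 0 < ρ) (hα₁ : 0 ≤ α₁)
    (hα'0 : 0 ≤ α') (hα'3 : 3 * α' ≤ 1) (hΛ : 1 ≤ Λ)
    (h261 : Ineq261 d₂ (toB6 (geo9Y x) 0 True) (min ρ δ₀) α')
    (hST : ScaleTransfer (geo9Y x) (min ρ δ₀) α' Λ (fun y => (geo9Y x).len y))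
    (hsmall : κ * α₁ * B6.c1 d₂ (min ρ δ₀) α' ≤ 1 / 2)
    (hE : EBlock (KACU P G x (GAY x.toKIdx parS parB GpS) parB C37 C38) B₀ δ₀ (.base U))
    (hVG : HasMajorant (g := toB6 (geo9Y x) 0 True) (blkF x ιB)
      (VF x.toKIdx parS parB GpS b U a * GbF x.toKIdx parS parB GpS b U) (fun y y' => κ * α₁ * Real.exp (-(ρ * (geo9Y x).dist y y'))))
    (hGV : HasMajorant (g := toB6 (geo9Y x) 0 True) (blkF x ιB)
      (GbF x.toKIdx parS parB GpS b U * VF x.toKIdx parS parB GpS b U a) (fun y y' => κ * α₁ * Real.exp (-(ρ * (geo9Y x).dist y y')))) :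
    EBlock (KACU P G x (GAY x.toKIdx parS parB GpS) parB C37 C38)
        (M₂ * (∑ j, ‖b j‖) * (2 * (M₂ * (∑ j, ‖b j‖) * B₀) * Λ ^ 2 * (B6.c1 d₂ (min ρ δ₀) α' + 1))) ((1 - 3 * α') * min ρ δ₀) (.prod U a) ∧
      IsUnit (deltaAY x.toKIdx parS parB GpS (mulY x.toKIdx (fluct (kGeo x.toKIdx).eta a) U)) := by
  classical
  letI : Fintype (geo9K x.toKIdx).Site := ‹Fintype (geo9Y x).Site›
  -- names
  set W := mulY x.toKIdx (fluct (kGeo x.toKIdx).eta a) U with hW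
  set ρ₀ := min ρ δ₀ with hρ₀
  set c₁ := B6.c1 d₂ ρ₀ α' with hc₁
  set θ := κ * α₁ with hθ
  set Bl := M₂ * (∑ j, ‖b j‖) * B₀ with hBl
  set GU := GbF x.toKIdx parS parB GpS b U with hGU
  set V := VF x.toKIdx parS parB GpS b U a with hV
  set Δa := DaF x.toKIdx parS parB GpS b U with hΔa
  -- the geometry of record
  have hdnn : ∀ y y' : (geo9Y x).Site, 0 ≤ (geo9Y x).dist y y' := geo9Y_dist_nonneg x
  have htri : Triangle254 (toB6 (geo9Y x) 0 True) := fun p q r => geo9Y_dist_triangle x p q r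
  have hrefl : ∀ y : (geo9Y x).Site, (geo9Y x).dist y y = 0 := geo9Y_dist_self x
  have hsym : ∀ y y' : (geo9Y x).Site, (geo9Y x).dist y y' = (geo9Y x).dist y' y := geo9Y_dist_comm x
  have hlen : ∀ y : (geo9Y x).Site, 0 < (geo9Y x).len y := geo9K_len_pos x.toKIdx
  -- signs
  have hSb : 0 ≤ ∑ j, ‖b j‖ := Finset.sum_nonneg fun j _ => norm_nonneg _
  have hM₂S : 0 ≤ M₂ * ∑ j, ‖b j‖ := mul_nonneg hM₂ hSb
  have hBl0 : 0 ≤ Bl := mul_nonneg hM₂S hB₀.le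
  have hρ₀ : 0 < ρ₀ := lt_min hρ hδ₀
  have hρ₀ρ : ρ₀ ≤ ρ := min_le_left _ _
  have hρ₀δ : ρ₀ ≤ δ₀ := min_le_right _ _
  have hθ0 : 0 ≤ θ := mul_nonneg hκ hα₁
  have hc₁0 : 0 ≤ c₁ := B6RandomWalk.c1_nonneg _ _ _
  have hα'1 : α' ≤ 1 := by linarith
  have hα'ρ : 0 ≤ (1 - α') * ρ₀ := mul_nonneg (by linarith) hρ₀.le
  have hα'ρ1 : 0 ≤ α' * ρ₀ := mul_nonneg hα'0 hρ₀.le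
  have hα'ρ2 : 0 ≤ (1 - 2 * α') * ρ₀ := mul_nonneg (by linarith) hρ₀.le
  have hsmall' : θ * c₁ < 1 := lt_of_le_of_lt hsmall (by norm_num)
  have hinv2 : (1 - θ * c₁)⁻¹ ≤ 2 := by
    have h1 : (1 : ℝ) / 2 ≤ 1 - θ * c₁ := by linarith
    calc (1 - θ * c₁)⁻¹ ≤ ((1 : ℝ) / 2)⁻¹ := inv_anti₀ (by norm_num) h1
      _ = 2 := by norm_num
  have hinv0 : 0 ≤ (1 - θ * c₁)⁻¹ := inv_nonneg.2 (by linarith)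
  have hΛ0 : 0 ≤ Λ := zero_le_one.trans hΛ
  have hΛ2 : 1 ≤ Λ ^ 2 := one_le_pow₀ hΛ
  -- (3.27) at the base: `Δ_a(U)G(U) = G(U)Δ_a(U) = 1`
  have hΔG : Δa * GU = 1 := DaF_mul_GbF x.toKIdx parS parB GpS b hunit
  have hGΔ : GU * Δa = 1 := GbF_mul_DaF x.toKIdx parS parB GpS b hunit
  -- READ: the four majorants of `G(U)` from Theorem 3.3's block, lowered to the common rate `ρ₀`
  obtain ⟨h0, h1, h2, h3⟩ := readG342Y_KACU P (Rr := (0 : ℝ)) (Hp := True) (b := b) (G := G) (x := x) (OA := GAY x.toKIdx parS parB GpS) (parB := parB)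
      (C37 := C37) (C38 := C38) (ιB := ιB) hι hM₂ hrepr hB₀.le hE
  have h0' : HasMajorant (g := toB6 (geo9Y x) 0 True) (blkF x ιB) (1 * GU) (fun y y' => Bl * (geo9Y x).len y ^ 2 * Real.exp (-(ρ₀ * (geo9Y x).dist y y'))) := by
    rw [one_mul]
    refine maj_reshape x (blkF x ιB) (fun y => (geo9Y x).len y ^ 2) (fun y => sq_nonneg _) le_rfl hBl0 hρ₀δ
      (hasMajorant_mono (g := toB6 (geo9Y x) 0 True) (blkF x ιB) h0 fun y y' => le_of_eq (by rw [hBl]; unfold geo9Y; ring))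
  have h1' : ∀ ν : Fin (d + 1), HasMajorant (g := toB6 (geo9Y x) 0 True) (blkF x ιB) (conj b (cdBₗ x.toKIdx U ν) * GU)
      (fun y y' => Bl * (geo9Y x).len y * Real.exp (-(ρ₀ * (geo9Y x).dist y y'))) := fun ν => by
    rw [hGU, GbF, ← B9Eq352DivFormLetters.conj_mul]
    refine maj_reshape x (blkF x ιB) (fun y => (geo9Y x).len y) (fun y => (hlen y).le) le_rfl hBl0 hρ₀δ
      (hasMajorant_mono (g := toB6 (geo9Y x) 0 True) (blkF x ιB) (h1 ν) fun y y' => le_of_eq (by rw [hBl]; unfold geo9Y; ring))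
  have h2' : ∀ ν : Fin (d + 1), HasMajorant (g := toB6 (geo9Y x) 0 True) (blkF x ιB) (GU * conj b (cdsBₗ x.toKIdx U ν))
      (fun y y' => Bl * (geo9Y x).len y * Real.exp (-(ρ₀ * (geo9Y x).dist y y'))) := fun ν => by
    rw [hGU, GbF, ← B9Eq352DivFormLetters.conj_mul]
    refine maj_reshape x (blkF x ιB) (fun y => (geo9Y x).len y) (fun y => (hlen y).le) le_rfl hBl0 hρ₀δ
      (hasMajorant_mono (g := toB6 (geo9Y x) 0 True) (blkF x ιB) (h2 ν) fun y y' => le_of_eq (by rw [hBl]; unfold geo9Y; ring))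
  have h3' : HasMajorant (g := toB6 (geo9Y x) 0 True) (blkF x ιB) (conj b (lapBₗ x.toKIdx U) * GU) (fun y y' => Bl * 1 * Real.exp (-(ρ₀ * (geo9Y x).dist y y'))) := by
    rw [hGU, GbF, ← B9Eq352DivFormLetters.conj_mul]
    refine maj_reshape x (blkF x ιB) (fun _ => (1 : ℝ)) (fun _ => zero_le_one) le_rfl hBl0 hρ₀δ
      (hasMajorant_mono (g := toB6 (geo9Y x) 0 True) (blkF x ιB) h3 fun y y' => le_of_eq (by rw [hBl]; unfold geo9Y; ring))
  -- the two (3.85) majorants at the common rate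
  have hVG' : HasMajorant (g := toB6 (geo9Y x) 0 True) (blkF x ιB) (V * GU) (fun y y' => θ * Real.exp (-(ρ₀ * (geo9Y x).dist y y'))) := by
    have := maj_reshape x (blkF x ιB) (fun _ => (1 : ℝ)) (fun _ => zero_le_one) le_rfl hθ0 hρ₀ρ
      (hasMajorant_mono (g := toB6 (geo9Y x) 0 True) (blkF x ιB) hVG fun y y' => le_of_eq (by rw [hθ]; ring))
    exact hasMajorant_mono (g := toB6 (geo9Y x) 0 True) (blkF x ιB) this fun y y' => le_of_eq (by ring)
  have hGV' : HasMajorant (g := toB6 (geo9Y x) 0 True) (blkF x ιB) (GU * V) (fun y y' => θ * Real.exp (-(ρ₀ * (geo9Y x).dist y y'))) := by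
    have := maj_reshape x (blkF x ιB) (fun _ => (1 : ℝ)) (fun _ => zero_le_one) le_rfl hθ0 hρ₀ρ
      (hasMajorant_mono (g := toB6 (geo9Y x) 0 True) (blkF x ιB) hGV fun y y' => le_of_eq (by rw [hθ]; ring))
    exact hasMajorant_mono (g := toB6 (geo9Y x) 0 True) (blkF x ιB) this fun y y' => le_of_eq (by ring)
  -- (3.84) ⟹ (3.86): the two-sided inverse `G̃` of `Δ_a(U) − V(A) = Δ_a(U′U)`, with both resolvent identities
  obtain ⟨GExt, h386L, h386R, hinvL, hinvR⟩ :=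
    exists_gExt_of_385 (R := (0 : ℝ)) (H := True) (blkF x ιB) d₂ ρ₀ α' θ hθ0 hα'ρ hdnn h261 hsmall' Δa GU V hΔG hGΔ hVG'
  rw [hΔa, hV, DaF_sub_VF] at hinvL hinvR
  -- `G̃ = G(U′U)` and `Δ_a(U′U)` is invertible
  obtain ⟨hunitW, hGbW⟩ := GbF_eq_of_two_sided x.toKIdx parS parB GpS b W _ GExt rfl hinvL hinvR
  refine ⟨?_, hunitW⟩
  -- [4] (2.66): the three left entries and the right entry of `G̃`
  have hL0 := gExt_leftEntry_of_386 (R := (0 : ℝ)) (H := True) (blkF x ιB) d₂ ρ₀ α' θ Bl (fun y => (geo9Y x).len y ^ 2) hBl0 (fun y => sq_nonneg _) hθ0 hρ₀.le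
    hα'1 hα'ρ htri hrefl hdnn h261 hsmall' h0' hVG' h386R
  have hL1 := fun ν : Fin (d + 1) => gExt_leftEntry_of_386 (R := (0 : ℝ)) (H := True) (blkF x ιB) d₂ ρ₀ α' θ Bl (fun y => (geo9Y x).len y) hBl0
    (fun y => (hlen y).le) hθ0 hρ₀.le hα'1 hα'ρ htri hrefl hdnn h261 hsmall' (h1' ν) hVG' h386R
  have hL3 := gExt_leftEntry_of_386 (R := (0 : ℝ)) (H := True) (blkF x ιB) d₂ ρ₀ α' θ Bl (fun _ => (1 : ℝ)) hBl0 (fun _ => zero_le_one) hθ0 hρ₀.le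
    hα'1 hα'ρ htri hrefl hdnn h261 hsmall' h3' hVG' h386R
  have hR2 := fun ν : Fin (d + 1) => gExt_rightEntry_of_386L (R := (0 : ℝ)) (H := True) (blkF x ιB) d₂ ρ₀ α' θ Bl Λ (fun y => (geo9Y x).len y) hBl0 hΛ0
    (fun y => (hlen y).le) hθ0 hρ₀.le hα'1 hα'ρ1 hα'ρ2 htri hrefl hsym hdnn h261 hsmall' hST (h2' ν) hGV' h386L
  -- one common constant `2·Bl·Λ²·(c₁+1)` and the rate `(1−3α′)ρ₀`
  set Bc := 2 * Bl * Λ ^ 2 * (c₁ + 1) with hBc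
  have hBc0 : 0 ≤ Bc := by positivity
  have hcoefL : Bl * c₁ * (1 - θ * c₁)⁻¹ ≤ Bc := by
    calc Bl * c₁ * (1 - θ * c₁)⁻¹ ≤ Bl * c₁ * 2 := mul_le_mul_of_nonneg_left hinv2 (mul_nonneg hBl0 hc₁0)
      _ = 2 * Bl * 1 * c₁ := by ring
      _ ≤ 2 * Bl * Λ ^ 2 * (c₁ + 1) := by
          apply mul_le_mul (mul_le_mul_of_nonneg_left hΛ2 (by positivity)) (by linarith) hc₁0 (by positivity)
  have hcoefR : Bl * Λ ^ 2 * c₁ * (1 - θ * c₁)⁻¹ ≤ Bc := by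
    calc Bl * Λ ^ 2 * c₁ * (1 - θ * c₁)⁻¹ ≤ Bl * Λ ^ 2 * c₁ * 2 := mul_le_mul_of_nonneg_left hinv2 (by positivity)
      _ = 2 * Bl * Λ ^ 2 * c₁ := by ring
      _ ≤ 2 * Bl * Λ ^ 2 * (c₁ + 1) := mul_le_mul_of_nonneg_left (by linarith) (by positivity)
  have hrateL : (1 - 3 * α') * ρ₀ ≤ (1 - α') * ρ₀ := mul_le_mul_of_nonneg_right (by linarith) hρ₀.le
  have hG0 : HasMajorant (g := toB6 (geo9Y x) 0 True) (blkF x ιB) GExt (fun y y' => Bc * (geo9Y x).len y ^ 2 * Real.exp (-((1 - 3 * α') * ρ₀ * (geo9Y x).dist y y'))) := by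
    rw [one_mul] at hL0
    exact maj_reshape x (blkF x ιB) (fun y => (geo9Y x).len y ^ 2) (fun y => sq_nonneg _) hcoefL hBc0 hrateL hL0
  have hG1 : ∀ ν : Fin (d + 1), HasMajorant (g := toB6 (geo9Y x) 0 True) (blkF x ιB) (conj b (cdBₗ x.toKIdx U ν) * GExt)
      (fun y y' => Bc * (geo9Y x).len y * Real.exp (-((1 - 3 * α') * ρ₀ * (geo9Y x).dist y y'))) := fun ν =>
    maj_reshape x (blkF x ιB) (fun y => (geo9Y x).len y) (fun y => (hlen y).le) hcoefL hBc0 hrateL (hL1 ν)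
  have hG2 : ∀ ν : Fin (d + 1), HasMajorant (g := toB6 (geo9Y x) 0 True) (blkF x ιB) (GExt * conj b (cdsBₗ x.toKIdx U ν))
      (fun y y' => Bc * (geo9Y x).len y * Real.exp (-((1 - 3 * α') * ρ₀ * (geo9Y x).dist y y'))) := fun ν =>
    maj_reshape x (blkF x ιB) (fun y => (geo9Y x).len y) (fun y => (hlen y).le) hcoefR hBc0 le_rfl (hR2 ν)
  have hG3 : HasMajorant (g := toB6 (geo9Y x) 0 True) (blkF x ιB) (conj b (lapBₗ x.toKIdx U) * GExt)
      (fun y y' => Bc * 1 * Real.exp (-((1 - 3 * α') * ρ₀ * (geo9Y x).dist y y'))) :=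
    maj_reshape x (blkF x ιB) (fun _ => (1 : ℝ)) (fun _ => zero_le_one) hcoefL hBc0 hrateL hL3
  -- WRITE the block of `KACU` at the coded product: the operator at `W = e^{iηa}U` is `G(W)`, whose real coordinates are `G̃`
  have hGb : conj b ((GAY x.toKIdx parS parB GpS W).restrictScalars ℝ) = GExt := hGbW
  refine writeG342Y_KACU P (Rr := (0 : ℝ)) (Hp := True) (b := b) (G := G) (x := x) (OA := GAY x.toKIdx parS parB GpS) (parB := parB)
    (C37 := C37) (C38 := C38) (ιB := ιB) hι hM₂ hrepr U a
    ((GAY x.toKIdx parS parB GpS W).restrictScalars ℝ) (fun Λ' => rfl) (fun ν => cdBₗ x.toKIdx U ν) (fun ν => cdsBₗ x.toKIdx U ν)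
    (fun ν Λ' => rfl) (fun ν Λ' => rfl) (lapBₗ x.toKIdx U) (fun Λ' => lapBₗ_apply x.toKIdx U Λ') hBc0 ?_ ?_ ?_ ?_
  · rw [hGb]; exact hG0
  · intro ν; rw [hGb]; exact hG1 ν
  · intro ν; rw [hGb]; exact hG2 ν
  · rw [hGb]; exact hG3

/-- **The analytic-extension clause for `G`** at a class product, from (3.85): `Δ_a(U′U)·G(U′U) = 1 = G(U′U)·Δ_a(U′U)` («the operators … G(U) extend to
configurations U′U», Thm 3.4) — the inverse the Neumann series (3.86) produces is NODE 00's `GAY (U′U)`.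
[cite: Balaban1985BackgroundPropagators, Thm 3.4 p.400 + (3.86) p.407 + (3.27) p.395] -/
theorem GAY_inv_prod_of_385 [Fintype (geo9Y x).Site] [DecidableEq ι]
    (hι : ∀ s, β x.toKIdx.hN x.toKIdx.D x.toKIdx.hk (ιB s) = s)
    {M₂ : ℝ} (hM₂ : 0 ≤ M₂) (hrepr : ∀ (v : 𝔸) (j : ι), |b.repr v j| ≤ M₂ * ‖v‖)
    {U : CfgY 𝔸 x.toKIdx} {a : AfldY 𝔸 x.toKIdx} (hunit : IsUnit (deltaAY x.toKIdx parS parB GpS U))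
    {B₀ δ₀ κ ρ α₁ α' Λ : ℝ} (d₂ : ℕ) (hB₀ : 0 < B₀) (hδ₀ : 0 < δ₀) (hκ : 0 ≤ κ) (hρ : 0 < ρ) (hα₁ : 0 ≤ α₁)
    (hα'0 : 0 ≤ α') (hα'3 : 3 * α' ≤ 1) (hΛ : 1 ≤ Λ)
    (h261 : Ineq261 d₂ (toB6 (geo9Y x) 0 True) (min ρ δ₀) α')
    (hST : ScaleTransfer (geo9Y x) (min ρ δ₀) α' Λ (fun y => (geo9Y x).len y))
    (hsmall : κ * α₁ * B6.c1 d₂ (min ρ δ₀) α' ≤ 1 / 2)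
    (hE : EBlock (KACU P G x (GAY x.toKIdx parS parB GpS) parB C37 C38) B₀ δ₀ (.base U))
    (hVG : HasMajorant (g := toB6 (geo9Y x) 0 True) (blkF x ιB)
      (VF x.toKIdx parS parB GpS b U a * GbF x.toKIdx parS parB GpS b U) (fun y y' => κ * α₁ * Real.exp (-(ρ * (geo9Y x).dist y y'))))
    (hGV : HasMajorant (g := toB6 (geo9Y x) 0 True) (blkF x ιB)
      (GbF x.toKIdx parS parB GpS b U * VF x.toKIdx parS parB GpS b U a) (fun y y' => κ * α₁ * Real.exp (-(ρ * (geo9Y x).dist y y')))) :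
    deltaAY x.toKIdx parS parB GpS (mulY x.toKIdx (fluct (kGeo x.toKIdx).eta a) U) *
        GAY x.toKIdx parS parB GpS (mulY x.toKIdx (fluct (kGeo x.toKIdx).eta a) U) = 1 ∧
      GAY x.toKIdx parS parB GpS (mulY x.toKIdx (fluct (kGeo x.toKIdx).eta a) U) *
        deltaAY x.toKIdx parS parB GpS (mulY x.toKIdx (fluct (kGeo x.toKIdx).eta a) U) = 1 := by
  have hW := (eBlock_KACU_prod_of_385 P G x parS parB GpS b ιB C37 C38 hι hM₂ hrepr hunit d₂ hB₀ hδ₀ hκ hρ hα₁ hα'0 hα'3 hΛ h261 hST hsmall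
    hE hVG hGV).2
  exact ⟨deltaAY_mul_GAY x.toKIdx hW, GAY_mul_deltaAY x.toKIdx hW⟩

end Core

/-! ## §4 ★★★ The positive-input (3.42)-step for `KACU` over the coded carrier, from the displayed (3.85) -/

section Step

variable {J : Type} (f : J → MemberY d ℓ hd hL b₀ b₁ Mstar) [∀ x : MemberY d ℓ hd hL b₀ b₁ Mstar, Fintype (geo9Y x).Site]
  (dB : ℕ) (c35 : ℝ) (G : Subgroup 𝔸ˣ) (b : Module.Basis ι ℝ 𝔸)
  (par parS : ∀ j : J, SiteParY 𝔸 (f j).toKIdx) (parB : ∀ j : J, BondParY 𝔸 (f j).toKIdx) (GpS : ∀ j : J, SiteOpY 𝔸 (f j).toKIdx)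
  (ιB : ∀ j : J, BlkY (f j).toKIdx → IBondY (f j).toKIdx)
  (C37 C38 : ∀ j : J, ℝ → CfgY 𝔸 (f j).toKIdx → AfldY 𝔸 (f j).toKIdx → Prop)
  (Cinv : ∀ j : J, B9.SiteKernel (geo9Y (f j)) (bg9YC 𝔸 G P (f j)))

/-- ★★★ **THE POSITIVE-INPUT (3.42)-STEP `StepEPos` FOR THE BOND-SECTOR FAMILY `KACU` OF THE SECT.-B STEP OF RECORD (print's reading R13-U1), FROM THE
DISPLAYED (3.85)** — the `hEa` slot of `B9SectBStepWhole.sectBStepPrinted_of_posBlockSteps` for `SectBStepU`: for every positive input tuple of Theorems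
3.1–3.3 there are thresholds `M₀, a₁, a₀′` and positive output constants `(B, δ)` such that at every member above `M₀`, every (3.35)-regular base `U` at
which Theorems 3.1–3.3 hold with the inputs, every `0 < α₁ ≦ a₁` and every `U′ = e^{iηa}` in the class (3.37), the (3.42) block `EBlock KACU B δ (U′U)`
holds.  Structural binders: `hι` (the block labels are a section of `β`), `hM₂`∕`hrepr`∕`hcR` (real coordinates of `𝔸`); DISPLAYED: `hunitA` (Thm 3.3 ∕
3.11: `Δ_a(U)` invertible at `G`-valued `U`) and `h385 : Step385F …` ((3.85) and its left twin).  Thresholds: `M₀ = max(M₁, M₂₆₁(ρ₀), 400·log L∕ρ₀)`,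
`a₁′ = min(a₁, (2(κ+1)(c₁+1))⁻¹)`, `α′ = 1/100`, output `(M₂Σ‖b‖·2(M₂Σ‖b‖B₀)L⁸(c₁+1), (97/100)ρ₀)`, `ρ₀ = min ρ δ₀`.
[cite: Balaban1985BackgroundPropagators, Thm 3.4 p.400 + Sect. B (3.84)–(3.86) p.407 + Thm 3.3 p.399 + (3.42) p.397; Balaban1984PropagatorsII, Lemma 2.1 p.234 + (2.66) p.234] -/
theorem stepEPos_KACU_of_385 [DecidableEq ι]
    (hι : ∀ (j : J) (s : BlkY (f j).toKIdx), β (f j).toKIdx.hN (f j).toKIdx.D (f j).toKIdx.hk (ιB j s) = s)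
    {M₂ : ℝ} (hM₂ : 0 ≤ M₂) (hrepr : ∀ (v : 𝔸) (j : ι), |b.repr v j| ≤ M₂ * ‖v‖) (hcR : 0 < M₂ * ∑ j, ‖b j‖)
    (hunitA : ∀ j (α₀ : ℝ) (U : CfgY 𝔸 (f j).toKIdx), (bg9YC 𝔸 G P (f j)).Reg335 c35 α₀ U → IsUnit (deltaAY (f j).toKIdx (parS j) (parB j) (GpS j) U))
    (h385 : Step385F P f dB c35 G b par parS parB GpS ιB C37 C38 Cinv) :
    StepEPos dB c35 (fun j => geo9Y (f j)) (fun j => (codingYx P G (f j) (C37 j) (C38 j)).bg)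
      (fun j => KSCU P G (f j) (par j) (C37 j) (C38 j))
      (fun j => KACU P G (f j) (GAY (f j).toKIdx (parS j) (parB j) (GpS j)) (parB j) (C37 j) (C38 j))
      (fun j => pullS (codingYx P G (f j) (C37 j) (C38 j)) (Cinv j))
      (fun j => KACU P G (f j) (GAY (f j).toKIdx (parS j) (parB j) (GpS j)) (parB j) (C37 j) (C38 j)) := by
  classical
  intro B₀ δ₀ Bβ Bε Bεβ B₁ δ₁ hB₀ hδ₀ hB₁ hδ₁
  obtain ⟨M₁, a₁, a₀', ⟨κ, ρ⟩, hM₁, ha₁, ha₀', ⟨hκ, hρ⟩, H385⟩ := h385 B₀ δ₀ Bβ Bε Bεβ B₁ δ₁ hB₀ hδ₀ hB₁ hδ₁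
  -- the (2.61) supplier and the common rate
  obtain ⟨d261, M261, h261⟩ := exists_d261 (d := d) (ℓ := ℓ) (hd := hd) (hL := hL) (b₀ := b₀) (b₁ := b₁) (Mstar := Mstar)
  set ρ₀ := min ρ δ₀ with hρ₀
  have hρ₀pos : 0 < ρ₀ := lt_min hρ hδ₀
  set c₁ := B6.c1 (d261 ρ₀) ρ₀ (1 / 100) with hc₁
  have hc₁0 : 0 ≤ c₁ := B6RandomWalk.c1_nonneg _ _ _
  set Λ : ℝ := ((ℓ : ℝ) + 1) ^ 4 with hΛ
  have hΛ1 : 1 ≤ Λ := one_le_pow₀ (by have : (0 : ℝ) ≤ ℓ := Nat.cast_nonneg _; linarith)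
  have hSb : 0 ≤ ∑ j, ‖b j‖ := Finset.sum_nonneg fun j _ => norm_nonneg _
  -- thresholds and output
  set a₁' := min a₁ (1 / (2 * ((κ + 1) * (c₁ + 1)))) with ha₁'
  have hkc : 0 < (κ + 1) * (c₁ + 1) := by positivity
  have ha₁'pos : 0 < a₁' := lt_min ha₁ (by positivity)
  set Bout := M₂ * (∑ j, ‖b j‖) * (2 * (M₂ * (∑ j, ‖b j‖) * B₀) * Λ ^ 2 * (c₁ + 1)) with hBout
  have hBout : 0 < Bout := by positivity
  set κlo := 1 / 100 * ρ₀ with hκlo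
  have hκlo0 : 0 < κlo := by positivity
  refine ⟨max M₁ (max (M261 ρ₀) (4 * Real.log ((ℓ : ℝ) + 1) / κlo)), a₁', a₀', (Bout, (1 - 3 * (1 / 100)) * ρ₀),
    lt_max_of_lt_left hM₁, ha₁'pos, ha₀', ⟨hBout, by positivity⟩, ?_⟩
  intro j hM α₀ hα₀ hMa c hreg hT α₁ hα₁ hα₁a c' h37
  have hM1 : M₁ ≤ (geo9Y (f j)).M := le_trans (le_max_left _ _) hM
  have hM2 : M261 ρ₀ ≤ (geo9Y (f j)).M := le_trans (le_trans (le_max_left _ _) (le_max_right _ _)) hM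
  have hM3 : 4 * Real.log ((ℓ : ℝ) + 1) / κlo ≤ (geo9Y (f j)).M := le_trans (le_trans (le_max_right _ _) (le_max_right _ _)) hM
  have hα₁1 : α₁ ≤ a₁ := le_trans hα₁a (min_le_left _ _)
  -- the base and the class pair
  obtain ⟨U, rfl, hU⟩ := (codingYx P G (f j) (C37 j) (C38 j)).exists_of_bg_Reg335 hreg
  obtain ⟨U', a, hcU, rfl, hC⟩ := (codingYx P G (f j) (C37 j) (C38 j)).exists_of_bg_Cplx337 h37
  cases hcU
  -- the two (3.85) majorants at `(U, a)` and Theorem 3.3's block at the base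
  have h85 : Maj385F (f j) (parS j) (parB j) (GpS j) b (ιB j) κ ρ α₁ U a := H385 j hM1 α₀ hα₀ hMa _ hreg hT α₁ hα₁ hα₁1 _ h37 U a rfl rfl
  have hE : EBlock (KACU P G (f j) (GAY (f j).toKIdx (parS j) (parB j) (GpS j)) (parB j) (C37 j) (C38 j)) B₀ δ₀ (.base U) := hT.2.2.1.1
  -- Lemma 2.1 and the scale transfer at `(ρ₀, 1/100)`; the smallness
  have h261j : Ineq261 (d261 ρ₀) (toB6 (geo9Y (f j)) 0 True) ρ₀ (1 / 100) :=
    h261 (f j) ρ₀ (1 / 100) hρ₀pos (by norm_num) (by norm_num) hM2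
  have hSTj : ScaleTransfer (geo9Y (f j)) ρ₀ (1 / 100) Λ (fun y => (geo9Y (f j)).len y) :=
    (scaleTransfer6_window_geo9Y hκlo0 (f j) (δ := ρ₀) (α := 1 / 100) le_rfl hM3).1
  have hsmall : κ * α₁ * c₁ ≤ 1 / 2 := by
    have hα₁2 : α₁ ≤ 1 / (2 * ((κ + 1) * (c₁ + 1))) := le_trans hα₁a (min_le_right _ _)
    have hκc : κ * c₁ ≤ (κ + 1) * (c₁ + 1) := by nlinarith
    calc κ * α₁ * c₁ = κ * c₁ * α₁ := by ring
      _ ≤ (κ + 1) * (c₁ + 1) * (1 / (2 * ((κ + 1) * (c₁ + 1)))) :=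
          mul_le_mul hκc hα₁2 hα₁.le hkc.le
      _ = 1 / 2 := by field_simp
  -- the one-configuration theorem
  exact (eBlock_KACU_prod_of_385 P G (f j) (parS j) (parB j) (GpS j) b (ιB j) (C37 j) (C38 j) (hι j) hM₂ hrepr (hunitA j α₀ U hU) (d261 ρ₀)
    hB₀ hδ₀ hκ hρ hα₁.le (by norm_num) (by norm_num) hΛ1 h261j hSTj hsmall hE h85.1 h85.2).1

end Step

end Literature.MathematicalPhysics.QuantumFieldTheory.Balaban1983to89.B9SectBGStepCodedFR

end

/-!
# `Balaban1983to89.B9SectBGStepCodedFGlobR` — THE CLASS-PARAMETRIC TWIN of `B9SectBGStepCodedFGlob` (CASCADE-R, director-ym №279 GO-R; №277 (3) `hunitA` cure; dag-n06-d SOCKET-(α) class question)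

statement-level skeleton of published theorems with citation tags; proofs where landed; nothing here is a claim about the
Yang–Mills mass gap

WHAT THIS FILE IS.  The original module `B9SectBGStepCodedFGlob` types its objects over MODULE 3's member carrier `bg9Y 𝔸 G x` (MODULE 2's small-cube class (3.35)).  This file RE-DECLARES, with UNCHANGED NAMES inside the namespace `…B9SectBGStepCodedFGlobR`, exactly its 4 class-dependent declarations over the CLASS-PARAMETRIC carrier `B9SectBCodedClassR.bg9YC 𝔸 G P x` (`P : RegExtraY …` = the two cube conditions of (3.35)∕(3.36) as a parameter; `bg9Y 𝔸 G x = bg9YC 𝔸 G (extraY 𝔸 G) x` by `rfl`, so every declaration here WITHOUT the `hunitA` binder specialises definitionally to its original; EXCEPTION (v1.1, №288 (4), ref-E READ-9∕13 species HEADER-NIT): `stepGlobPos_KACU_of_385` carries the №277 RE-KEYED `hunitA` (WEAKER hypothesis), so at `P := extraY 𝔸 G` it IMPLIES the original via `fun j α₀ U hU => hunitA j U hU.1.1` (ref-E K3), NOT a definitional specialisation; CAVEAT (LOCATED-18, №290 (1)): no α₀-threshold ⇒ still uninhabitable at `SU(N)` — consumers use the GUARDED `…RG` twin; at the record's reading of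 PRINT's class, `P := extraYPb 𝔸 G`, the displayed laws `hreg335P` ((3.35) on plaquettes) and the class-keyed `hunitA` become theorems).  The text is the original's VERBATIM under the token surgery `bg9Y 𝔸 G ↦ bg9YC 𝔸 G P`, `NAME ↦ NAME P` for the class-dependent names (P the first explicit argument), and — №277 — the binder `hunitA` re-keyed from «all G-valued U» to «all (3.35)-regular U of the carrier» (`∀ j α₀ U, (bg9YC 𝔸 G P (f j)).Reg335 c35 α₀ U → IsUnit (deltaAY …)`) with its use sites (`hunitA j U hU ↦ hunitA j α₀ U hU`) — NOT verbatim for the declaration named above.  Class-free declarations of the original are NOT copied: they are imported and used BY NAME (`open … hiding` the re-declared ones).  Generated by dag-n06-c g16's `gen.py` (HOME `pub-ymgap-dag-n06-c/lean/g16/`); the ORIGINAL MODULE DOCUMENTATION FOLLOWS VERBATIM and describes the mathematics.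

HONEST SCOPE.  Re-typing bookkeeping; nothing of [B9] asserted beyond the original; COUNT-NEUTRAL; N06 NOT discharged; nothing continuum ∕ OS ∕ mass gap ∕ Clay.  Cell `pub-ymgap` (D-0062), Track A node N06 [B9], seat `pub-ymgap-dag-n06-c` g16, 2026-08-29.
-/

/-!
# Balaban [B9], Thm 3.4 p. 400 with (3.47) p. 398 — THE (3.47) MEMBER OF THE SECT.-B STEP OF RECORD FOR THE BOND SECTOR `KACU` (print's reading R13-U1),
# ROUTE F: `KACU_glob_prod_eq`, ★ `globBlock_KACU_prod_of_eBlock`, ★★ `stepGlobPos_KACU_of_385`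

T. Bałaban, *Propagators for lattice gauge theories in a background field*, Commun. Math. Phys. **99** (1985) 389–434
[`Balaban1985BackgroundPropagators`, "B9"]; [4] = T. Bałaban, *Propagators and renormalization transformations for lattice gauge
theories. II*, Commun. Math. Phys. **96** (1984) 223–250 [`Balaban1984PropagatorsII`].

statement-level skeleton of published theorems with citation tags; proofs where landed; nothing here is a claim about the
Yang–Mills mass gap

THE PRINTED LOCI.  p. 398: *«the global inequalities (3.47) are consequences of the local ones (3.42) and Lemma 2.1»*; p. 407: *«This way we get all these
inequalities for the operator G(U′U), the local ones follow from the bound (3.85) and Lemma 2.1 [4].»*; Thm 3.4 p. 400.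

WHY THIS FILE (pub-ymgap N06 row 13, G side; seat dag-n06-c gen 13).  `B9SectBGStepCodedF.stepEPos_KACU_of_385` gave the (3.42)-step for the bond-sector
reading `KACU` from the displayed (3.85); the (3.47)-step (`hGa` slot of `sectBStepPrinted_of_posBlockSteps` for `SectBStepU`) follows WITHOUT further
letters: at a coded product the (3.47) members of `KACU` ARE those of NODE 00's one-configuration bond reading of the CONSTANT letter `G(W)`, `W = e^{iηa}U`,
read through `baseY` (`KACU_glob_prod_eq`, `rfl` — the (3.42) twin is gen 12's `B9SectBGReadY.KACU_e_prod_eq`), for which `B9Ineq347BondReadingY.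
globBlock_kernelFamilyB_of_eBlock` turns the (3.42) block into the (3.47) block above a threshold depending on the rate only (`globBlock_KACU_prod_of_eBlock`);
the generic step transfer `B9SectBStepPosFamilyTransfer.stepPos_blk_of_family_pos` does the threshold bookkeeping (`stepGlobPos_KACU_of_385`).

HONEST SCOPE.  Bookkeeping over gen 13's (3.42)-step; the displayed hypotheses are the same (`hunitA`, `h385 : Step385F …`).  Count-neutral; N06 NOT discharged;
nothing continuum ∕ OS ∕ mass-gap ∕ Clay.  No `sorry`, no `axiom`, no `def`, no `instance`.  Seat dag-n06-c g13, 2026-08-28; `--supports stmt-QuantumFields-27364`.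
-/

noncomputable section

namespace Literature.MathematicalPhysics.QuantumFieldTheory.Balaban1983to89.B9SectBGStepCodedFGlobR

open Literature.MathematicalPhysics.QuantumFieldTheory.Balaban1983to89.B9SectBCodedClassR (RegExtraY bg9YC)
open Literature.MathematicalPhysics.QuantumFieldTheory.Balaban1983to89.B9SectBGStepCodedFGlob hiding KACU_glob_prod_eq globBlock_mono_const globBlock_KACU_prod_of_eBlock stepGlobPos_KACU_of_385

open Literature.MathematicalPhysics.QuantumFieldTheory.Balaban1983to89
open Literature.MathematicalPhysics.QuantumFieldTheory.Balaban1983to89.B6Ineq2142KLevelV1 (β)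
open Literature.MathematicalPhysics.QuantumFieldTheory.Balaban1983to89.B9FromB6 (EBlock GlobBlock)
open Literature.MathematicalPhysics.QuantumFieldTheory.Balaban1983to89.B9SectBCodedCarrier (CCfg Coding pullS)
open Literature.MathematicalPhysics.QuantumFieldTheory.Balaban1983to89.B9Eq360DeltaPrimeAY (AfldY)
open Literature.MathematicalPhysics.QuantumFieldTheory.Balaban1983to89.B9PinMembersKLevelV1 (MemberY geo9Y bg9Y)
open Literature.MathematicalPhysics.QuantumFieldTheory.Balaban1983to89.B9SectBGpLettersY (GVal decY)
open Literature.MathematicalPhysics.QuantumFieldTheory.Balaban1983to89.B9SectBGpFrameCodedYR (codingYx)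
open Literature.MathematicalPhysics.QuantumFieldTheory.Balaban1983to89.B9SectBGpReadingsY (baseY)
open Literature.MathematicalPhysics.QuantumFieldTheory.Balaban1983to89.B9SectBCodedReadingsUR (KSCU KACU)
open Literature.MathematicalPhysics.QuantumFieldTheory.Balaban1983to89.B9SectBGReadYR (KACU_e_prod_eq)
open Literature.MathematicalPhysics.QuantumFieldTheory.Balaban1983to89.B9SectBGStepCodedFR (Step385F stepEPos_KACU_of_385)
open Literature.MathematicalPhysics.QuantumFieldTheory.Balaban1983to89.B9Ineq347BondReadingY (globBlock_kernelFamilyB_of_eBlock)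
open Literature.MathematicalPhysics.QuantumFieldTheory.Balaban1983to89.B9SectBStepPosFamilyTransfer (stepPos_blk_of_family_pos)
open Literature.MathematicalPhysics.QuantumFieldTheory.Balaban1983to89.B9SectBStepWhole (StepPos StepEPos StepGlobPos)
open Literature.MathematicalPhysics.QuantumFieldTheory.Balaban1983to89.B9GeoNormsKLevelV1 (geo9K_wNorm_nonneg)
open Literature.MathematicalPhysics.QuantumFieldTheory.Balaban1983to89.Node00 (SiteY BlkY FBondY IBondY CfgY SiteParY BondParY SiteOpY BondOpY deltaAY GAY
  kernelFamilyB)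

variable {d ℓ : ℕ} {hd : 1 ≤ d + 1} {hL : Odd (ℓ + 1) ∧ 1 < ℓ + 1} {b₀ b₁ : ℝ} {Mstar : ℕ}
variable {𝔸 : Type} [NormedRing 𝔸] (P : RegExtraY d ℓ hd hL b₀ b₁ Mstar 𝔸) [NormedAlgebra ℂ 𝔸] [CompleteSpace 𝔸] [FiniteDimensional ℝ 𝔸]
variable {ι : Type} [Fintype ι]

/-! ## §1 The (3.47) members of `KACU` at a coded product and the (3.47) block from the (3.42) block there -/

section Member

variable (G : Subgroup 𝔸ˣ) (x : MemberY d ℓ hd hL b₀ b₁ Mstar) (OA : BondOpY 𝔸 x.toKIdx) (parB : BondParY 𝔸 x.toKIdx)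
  (C37 C38 : ℝ → CfgY 𝔸 x.toKIdx → AfldY 𝔸 x.toKIdx → Prop)

omit [FiniteDimensional ℝ 𝔸] in
/-- at a coded product the (3.47) members of `KACU` (U-letters: differences at the base `U`, operator at the decoded product `W`) ARE those of NODE 00's
one-configuration bond reading of the CONSTANT letter `OA(W)` over the coded carrier read through `baseY` (`rfl`; the (3.42) twin is `B9SectBGReadY.KACU_e_prod_eq`).
[cite: Balaban1985BackgroundPropagators, Thm 3.4 p.400, (3.47) p.398, bookkeeping] -/
theorem KACU_glob_prod_eq (n : Fin 4) (U : CfgY 𝔸 x.toKIdx) (a : AfldY 𝔸 x.toKIdx) (lam : (geo9Y x).Loc) (γ : ℝ) :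
    (KACU P G x OA parB C37 C38).glob n (.prod U a) lam γ =
      (kernelFamilyB x.toKIdx (codingYx P G x C37 C38).bg (baseY x.toKIdx) (fun _ => OA (decY x.toKIdx (.prod U a))) parB).glob n (.prod U a) lam γ := rfl

omit [FiniteDimensional ℝ 𝔸] in
/-- the (3.47) block is monotone in its constant (the weighted norms are nonnegative). [cite: Balaban1985BackgroundPropagators, (3.47) p.398, bookkeeping] -/
theorem globBlock_mono_const {B₀ B₀' : ℝ} {c : (codingYx P G x C37 C38).bg.Cfg} (h : GlobBlock (KACU P G x OA parB C37 C38) B₀ c) (hle : B₀ ≤ B₀') :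
    GlobBlock (KACU P G x OA parB C37 C38) B₀' c :=
  fun n lam γ h1 h2 => (h n lam γ h1 h2).trans (mul_le_mul_of_nonneg_right hle (geo9K_wNorm_nonneg x.toKIdx γ lam))

/-- ★ **THE (3.47) BLOCK OF `KACU` AT A CODED PRODUCT FROM ITS (3.42) BLOCK THERE**, one threshold per rate: for every `δ > 0` there are `Mg`, `Cg ≥ 0` such
that at every member with a section of `β` above `Mg`, every `(U, a)`, every `B ≥ 0`: `EBlock KACU B δ (prod U a) → GlobBlock KACU (B·Cg) (prod U a)`
(`B9Ineq347BondReadingY.globBlock_kernelFamilyB_of_eBlock` at the frozen letter `OA(W)`). [cite: Balaban1985BackgroundPropagators, (3.47) p.398 («consequences of the local ones (3.42) and Lemma 2.1»), Thm 3.4 p.400; Balaban1984PropagatorsII, Lemma 2.1 p.234] -/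
theorem globBlock_KACU_prod_of_eBlock [∀ x : MemberY d ℓ hd hL b₀ b₁ Mstar, Fintype (geo9Y x).Site] {δ : ℝ} (hδ : 0 < δ) :
    ∃ Mg Cg : ℝ, 0 ≤ Cg ∧
      ∀ (x : MemberY d ℓ hd hL b₀ b₁ Mstar) (ιB : BlkY x.toKIdx → IBondY x.toKIdx),
        (∀ s : BlkY x.toKIdx, β x.toKIdx.hN x.toKIdx.D x.toKIdx.hk (ιB s) = s) → Mg ≤ (geo9Y x).M →
        ∀ (OA : BondOpY 𝔸 x.toKIdx) (parB : BondParY 𝔸 x.toKIdx) (C37 C38 : ℝ → CfgY 𝔸 x.toKIdx → AfldY 𝔸 x.toKIdx → Prop)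
          (U : CfgY 𝔸 x.toKIdx) (a : AfldY 𝔸 x.toKIdx) (B : ℝ), 0 ≤ B →
          EBlock (KACU P G x OA parB C37 C38) B δ (.prod U a) → GlobBlock (KACU P G x OA parB C37 C38) (B * Cg) (.prod U a) := by
  obtain ⟨Mg, Cg, hCg, H⟩ := globBlock_kernelFamilyB_of_eBlock (𝔸 := 𝔸) (d := d) (ℓ := ℓ) (hd := hd) (hL := hL) (b₀ := b₀) (b₁ := b₁) (Mstar := Mstar) hδ
  refine ⟨Mg, Cg, hCg, fun x ιB hι hM OA parB C37 C38 U a B hB hE => ?_⟩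
  -- the (3.42) block of the frozen one-configuration reading at the coded product
  have hE' : EBlock (kernelFamilyB x.toKIdx (codingYx P G x C37 C38).bg (baseY x.toKIdx) (fun _ => OA (decY x.toKIdx (.prod U a))) parB) B δ (.prod U a) := by
    intro n lam y y' hs
    rw [← KACU_e_prod_eq P]
    exact hE n lam y y' hs
  have hG := H x ιB hι hM (codingYx P G x C37 C38).bg (baseY x.toKIdx) (fun _ => OA (decY x.toKIdx (.prod U a))) parB (.prod U a) B hB hE'
  intro n lam γ h1 h2
  rw [KACU_glob_prod_eq]
  exact hG n lam γ h1 h2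

end Member

/-! ## §2 ★★ The positive-input (3.47)-step for `KACU` over the coded carrier, from the displayed (3.85) -/

section Step

variable {J : Type} (f : J → MemberY d ℓ hd hL b₀ b₁ Mstar) [∀ x : MemberY d ℓ hd hL b₀ b₁ Mstar, Fintype (geo9Y x).Site]
  (dB : ℕ) (c35 : ℝ) (G : Subgroup 𝔸ˣ) (b : Module.Basis ι ℝ 𝔸)
  (par parS : ∀ j : J, SiteParY 𝔸 (f j).toKIdx) (parB : ∀ j : J, BondParY 𝔸 (f j).toKIdx) (GpS : ∀ j : J, SiteOpY 𝔸 (f j).toKIdx)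
  (ιB : ∀ j : J, BlkY (f j).toKIdx → IBondY (f j).toKIdx)
  (C37 C38 : ∀ j : J, ℝ → CfgY 𝔸 (f j).toKIdx → AfldY 𝔸 (f j).toKIdx → Prop)
  (Cinv : ∀ j : J, B9.SiteKernel (geo9Y (f j)) (bg9YC 𝔸 G P (f j)))

/-- ★★ **THE POSITIVE-INPUT (3.47)-STEP `StepGlobPos` FOR THE BOND-SECTOR FAMILY `KACU` OF THE SECT.-B STEP OF RECORD, FROM THE DISPLAYED (3.85)** — the
`hGa` slot of `B9SectBStepWhole.sectBStepPrinted_of_posBlockSteps` for `SectBStepU`: the (3.42)-step of `B9SectBGStepCodedF.stepEPos_KACU_of_385` followed, at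
the coded product, by «(3.47) from (3.42) and Lemma 2.1» for the frozen bond letter (`globBlock_KACU_prod_of_eBlock`); thresholds merged by the generic transfer
`stepPos_blk_of_family_pos` (input families unchanged). Same structural and displayed binders as the (3.42)-step.
[cite: Balaban1985BackgroundPropagators, Thm 3.4 p.400 + (3.47) p.398 + (3.85)–(3.86) p.407; Balaban1984PropagatorsII, Lemma 2.1 p.234] -/
theorem stepGlobPos_KACU_of_385 [DecidableEq ι]
    (hι : ∀ (j : J) (s : BlkY (f j).toKIdx), β (f j).toKIdx.hN (f j).toKIdx.D (f j).toKIdx.hk (ιB j s) = s)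
    {M₂ : ℝ} (hM₂ : 0 ≤ M₂) (hrepr : ∀ (v : 𝔸) (j : ι), |b.repr v j| ≤ M₂ * ‖v‖) (hcR : 0 < M₂ * ∑ j, ‖b j‖)
    (hunitA : ∀ j (α₀ : ℝ) (U : CfgY 𝔸 (f j).toKIdx), (bg9YC 𝔸 G P (f j)).Reg335 c35 α₀ U → IsUnit (deltaAY (f j).toKIdx (parS j) (parB j) (GpS j) U))
    (h385 : Step385F P f dB c35 G b par parS parB GpS ιB C37 C38 Cinv) :
    StepGlobPos dB c35 (fun j => geo9Y (f j)) (fun j => (codingYx P G (f j) (C37 j) (C38 j)).bg)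
      (fun j => KSCU P G (f j) (par j) (C37 j) (C38 j))
      (fun j => KACU P G (f j) (GAY (f j).toKIdx (parS j) (parB j) (GpS j)) (parB j) (C37 j) (C38 j))
      (fun j => pullS (codingYx P G (f j) (C37 j) (C38 j)) (Cinv j))
      (fun j => KACU P G (f j) (GAY (f j).toKIdx (parS j) (parB j) (GpS j)) (parB j) (C37 j) (C38 j)) := by
  refine stepPos_blk_of_family_pos dB c35 (fun j => geo9Y (f j)) (fun j => (codingYx P G (f j) (C37 j) (C38 j)).bg)
    (fun j => KSCU P G (f j) (par j) (C37 j) (C38 j)) (fun j => KSCU P G (f j) (par j) (C37 j) (C38 j))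
    (fun j => KACU P G (f j) (GAY (f j).toKIdx (parS j) (parB j) (GpS j)) (parB j) (C37 j) (C38 j))
    (fun j => KACU P G (f j) (GAY (f j).toKIdx (parS j) (parB j) (GpS j)) (parB j) (C37 j) (C38 j))
    (fun j => pullS (codingYx P G (f j) (C37 j) (C38 j)) (Cinv j))
    (C₁ := ℝ × ℝ) (C₂ := ℝ) (pos₁ := fun c => 0 < c.1 ∧ 0 < c.2) (pos₂ := fun c => 0 < c)
    (Blk₁ := fun c j W => EBlock (KACU P G (f j) (GAY (f j).toKIdx (parS j) (parB j) (GpS j)) (parB j) (C37 j) (C38 j)) c.1 c.2 W)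
    (Blk₂ := fun c j W => GlobBlock (KACU P G (f j) (GAY (f j).toKIdx (parS j) (parB j) (GpS j)) (parB j) (C37 j) (C38 j)) c W)
    (fun B₀ δ₀ Bβ Bε Bεβ B₁ δ₁ hB₀ hδ₀ hB₁ hδ₁ =>
      ⟨0, 1, B₀, δ₀, Bβ, Bε, Bεβ, B₁, δ₁, one_pos, hB₀, hδ₀, hB₁, hδ₁, fun _ _ _ _ _ _ _ hT => hT⟩)
    (fun c hc a ha => ?_)
    (stepEPos_KACU_of_385 P f dB c35 G b par parS parB GpS ιB C37 C38 Cinv hι hM₂ hrepr hcR hunitA h385)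
  -- the output transfer at the coded product: (3.42) block ⟹ (3.47) block, constant `B·(Cg+1)`, above `Mg(δ)`
  obtain ⟨Mg, Cg, hCg, H⟩ := globBlock_KACU_prod_of_eBlock P (𝔸 := 𝔸) (d := d) (ℓ := ℓ) (hd := hd) (hL := hL) (b₀ := b₀) (b₁ := b₁) (Mstar := Mstar) G hc.2
  refine ⟨Mg, 1, a, c.1 * (Cg + 1), one_pos, ha, le_rfl, mul_pos hc.1 (by linarith), ?_⟩
  intro j hM α₀ hα₀ _ W hreg α₁ _ _ W' h37 hE
  obtain ⟨U, rfl, -⟩ := (codingYx P G (f j) (C37 j) (C38 j)).exists_of_bg_Reg335 hreg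
  obtain ⟨U', a', hcU, rfl, -⟩ := (codingYx P G (f j) (C37 j) (C38 j)).exists_of_bg_Cplx337 h37
  cases hcU
  have hG := H (f j) (ιB j) (hι j) hM (GAY (f j).toKIdx (parS j) (parB j) (GpS j)) (parB j) (C37 j) (C38 j) U a' c.1 hc.1.le hE
  exact globBlock_mono_const P G (f j) _ (parB j) (C37 j) (C38 j) hG (mul_le_mul_of_nonneg_left (by linarith) hc.1.le)

end Step

end Literature.MathematicalPhysics.QuantumFieldTheory.Balaban1983to89.B9SectBGStepCodedFGlobR

end

/-!
# `Balaban1983to89.B9SectBH2FrameCodedYR` — THE CLASS-PARAMETRIC TWIN of `B9SectBH2FrameCodedY` (CASCADE-R, director-ym №279 GO-R; №277 (3) `hunitA` cure; dag-n06-d SOCKET-(α) class question)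

statement-level skeleton of published theorems with citation tags; proofs where landed; nothing here is a claim about the
Yang–Mills mass gap

WHAT THIS FILE IS.  The original module `B9SectBH2FrameCodedY` types its objects over MODULE 3's member carrier `bg9Y 𝔸 G x` (MODULE 2's small-cube class (3.35)).  This file RE-DECLARES, with UNCHANGED NAMES inside the namespace `…B9SectBH2FrameCodedYR`, exactly its 17 class-dependent declarations over the CLASS-PARAMETRIC carrier `B9SectBCodedClassR.bg9YC 𝔸 G P x` (`P : RegExtraY …` = the two cube conditions of (3.35)∕(3.36) as a parameter; `bg9Y 𝔸 G x = bg9YC 𝔸 G (extraY 𝔸 G) x` by `rfl`, so every declaration here specialises definitionally to its original; at the record's reading of PRINT's class, `P := extraYPb 𝔸 G`, the displayed laws `hreg335P` ((3.35) on plaquettes) and the class-keyed `hunitA` become theorems).  The text is the original's VERBATIM under the token surgery `bg9Y 𝔸 G ↦ bg9YC 𝔸 G P`, `NAME ↦ NAME P` for the class-dependent names (P the first explicit argument), and — №277 — the binder `hunitA` re-keyed from «all G-valued U» to «all (3.35)-regular U of the carrier» (`∀ j α₀ U, (bg9YC 𝔸 G P (f j)).Reg335 c35 α₀ U → IsUnit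 (deltaAY …)`) — a clause IDLE in this twin (no `hunitA` here; v1.1).  Class-free declarations of the original are NOT copied: they are imported and used BY NAME (`open … hiding` the re-declared ones).  Generated by dag-n06-c g16's `gen.py` (HOME `pub-ymgap-dag-n06-c/lean/g16/`); the ORIGINAL MODULE DOCUMENTATION FOLLOWS VERBATIM and describes the mathematics.

HONEST SCOPE.  Re-typing bookkeeping; nothing of [B9] asserted beyond the original; COUNT-NEUTRAL; N06 NOT discharged; nothing continuum ∕ OS ∕ mass gap ∕ Clay.  Cell `pub-ymgap` (D-0062), Track A node N06 [B9], seat `pub-ymgap-dag-n06-c` g16, 2026-08-29.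
-/

/-! Module documentation: that of the original `Balaban1983to89.B9SectBH2FrameCodedY` applies verbatim to this twin (not repeated here). -/

noncomputable section

namespace Literature.MathematicalPhysics.QuantumFieldTheory.Balaban1983to89.B9SectBH2FrameCodedYR

open Literature.MathematicalPhysics.QuantumFieldTheory.Balaban1983to89.B9SectBCodedClassR (RegExtraY bg9YC)
open Literature.MathematicalPhysics.QuantumFieldTheory.Balaban1983to89.B9SectBH2FrameCodedY hiding KSC₇ KSC₇_members KSC₇_h2_inl KSC₇_h2_off eBlock_KSC₇_iff h1Block_KSC₇_iff e4Block_KSC₇_iff h2Block_KSC₇_iff KSC₇_members_base read342Y_KSC₇ write342Y_KSC₇ h2_read h2_transfer_KSC₇ h2Frame₃CodedOn stepH2Pos_KSC₇_on hin_KSC₇_on_pos stepH2Pos_KSCU_on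

open B6RandomWalk (HasMajorant hasMajorant_mono BlockSupp)
open B6KLevelCensusIndexV1 (KIdx kGeo)
open B6Ineq2142KLevelV1 (β)
open B6Prop22KLevelTorusCensusEta (nKT nKT_pos hqTP hqTP_nonneg)
open B9Thm34Ext (toB6)
open B9FromB6 (EBlock H1Block E4Block H2Block)
open B9Eq352DivFormLetters (conj coordEquiv gradLetterF gradLetterB gradLetterF_apply)
open B9Eq352GradLetters (diffLetter diffLetter_inl diffLetter_inr)
open B9Thm34SectBUniformR1 (thm34_Gp_uniform)
open B9Thm34HolderGpUniformR1 (thm34_Gp_holderInput_uniform)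
open B9SectBGpStepAtLettersV2 (GpFrame₂)
open B9SectBStepWhole (StepPos StepH2Pos)
open B9SectBCodedCarrier (CCfg Coding pullK pullS)
open B9Eq360DeltaPrimeAY (AfldY blkY)
open B9PinMembersKLevelV1 (MemberY geo9Y bg9Y)
open B9SectBGpLettersY (GVal decY coordC blkC GopC letters_base_of_gVal norm_le_one_and_inv_of_mem stencilB_blkC)
open B9SectBGpFrameCodedYR (codingYx Read342Y Write342Y)
open B9SectBGpFrameCodedY (CplxLettersY)
open B9SectBGpReadingsYR (KSC read342Y_KSC write342Y_KSC)
open B9SectBGpReadingsY (baseY etaS_eq_eta)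
open B9SectBCodedReadingsUR (KSCU KACU)
open B9SectBStepsKSCUR (KACU_members_base ineq342_346_347_congr thms_KSCU_base_iff hin_KSCU_on_pos)
open B9SectBGpTransferInYR (ineq343_345_congr)
open B9SectBCodedChainOnSubfamilyR (gpFrame₂CodedOn)
open B9SectBStepPosFamilyTransfer (stepH2Pos_of_family_pos)
open B9GeoLemma21KLevelV1 (geo9Y_dist_triangle geo9Y_len_pos geo9Y_dist_comm)
open B9RWSums347DefiniteFacesWindow (geo9Y_dist_nonneg)
open B9GeoNormsKLevelModelSignsV1 (modelSignsOn_geo9K)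
open Node00 (SiteY BlkY IBondY CfgY BallY SiteParY BondParY BondOpY liftY deltaPrimeAY kernelFamilyS GpY UboxY shiftY etaS cdS cdsS cdS_smul hqS
  supBlkS' toKT)
open Node00.OpsYHolderFar (denS denS_nonneg pair_le_hqS hqS_le_of_forall hqS_nonneg)
open Node00.OpsYRead342 (geo9K_len_congr geo9K_dist_congr)
open Node00.OpsYRead342Cross (norm_cdsS_le_norm_cdS_symm_shift)
open B9Ineq349SiteComposite (cdSL cdsSL cdSL_apply cdsSL_apply etaS_pos)
open B9Ineq344LocalPairHolds (hqTP_mono_add)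
open B9SectBH1ReadWriteY (wordS quotS h1ReadT quotS_nonneg quotS_liftY_le)
open B9SectBH1ProbesY (probeH probeH_apply norm_probeH quotS_wordS_eq Gsc symm_conj_apply symm_gradF_G symm_G_negGradB cutH_inl_nonneg
  quotL_blockSupp_le norm_coordEquiv_symm_apply_le blockSupp_coordEquiv_liftY)
open B9SectBH1FrameCodedYR (KSC₅ KSC₅_h1_inl)
open B9SectBH1FrameCodedY (len_blkC_eq pow_level_mul_etaS_le_one)
open B9SectBE4FrameCodedYR (KSC₆ e4_read)
open B9SectBE4FrameCodedY (abs_apply_le_norm_symm norm_symm_gradF_G_negGradB norm_symm_negGradB_G_negGradB)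

/-! ## §1 The (3.45) frame: the (vi′)-half of `E4H2Frame₂` -/

section Frame

universe u

variable {I : Type} (d : ℕ) (c35 : ℝ) (geo : I → B9.Geometry) (bg : I → B9.Backgrounds)
  (Gp : ∀ i, B9.KernelFamily (geo i) (bg i))
  {𝔸 : Type u} [NormedRing 𝔸] [NormedAlgebra ℂ 𝔸] [CompleteSpace 𝔸] {ι : Type} [Fintype ι] [DecidableEq ι]
  (b : Module.Basis ι ℝ 𝔸) (κ : Type) [Fintype κ]
  (S : I → Type) [∀ i, Fintype (S i)] [∀ i, DecidableEq (S i)]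
  [∀ i, Fintype (geo i).Site] [∀ i, DecidableEq (geo i).Site] [∀ i, Nonempty (geo i).Site]

variable {d c35 geo bg Gp b κ S}

end Frame

/-! ## §2 The family `KSC₇` (augmented (3.42) reading, ALL Hölder∕input members in U-letters) and its dictionaries -/

variable {d ℓ : ℕ} {hd : 1 ≤ d + 1} {hL : Odd (ℓ + 1) ∧ 1 < ℓ + 1} {b₀ b₁ : ℝ} {Mstar : ℕ}
variable {𝔸 : Type} [NormedRing 𝔸] (P : RegExtraY d ℓ hd hL b₀ b₁ Mstar 𝔸) [NormedAlgebra ℂ 𝔸] [CompleteSpace 𝔸] [FiniteDimensional ℝ 𝔸]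

section Family

variable (G : Subgroup 𝔸ˣ) (x : MemberY d ℓ hd hL b₀ b₁ Mstar) (par : SiteParY 𝔸 x.toKIdx) {ι : Type} [Fintype ι] (b : Module.Basis ι ℝ 𝔸)
  (ιB : BlkY x.toKIdx → IBondY x.toKIdx) (C37 C38 : ℝ → CfgY 𝔸 x.toKIdx → AfldY 𝔸 x.toKIdx → Prop)

/-- ★ **`KSC₇`** — g7's augmented coded reading `KSC` with the (3.43), (3.44), (3.45) members REPLACED by the U-letter ones of `KSCU`.
[cite: Balaban1985BackgroundPropagators, (3.42)–(3.45) pp.397–398, Thm 3.4 p.400, p.403 l.2–7] -/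
def KSC₇ : B9.KernelFamily (geo9Y x) (codingYx P G x C37 C38).bg :=
  { KSC P G x par C37 C38 with h1 := (KSCU P G x par C37 C38).h1, e4 := (KSCU P G x par C37 C38).e4, h2 := (KSCU P G x par C37 C38).h2 }

omit [FiniteDimensional ℝ 𝔸] in
/-- the members of `KSC₇` (`rfl` ×4). [cite: Balaban1985BackgroundPropagators, (3.42)–(3.45) pp.397–398, bookkeeping] -/
theorem KSC₇_members :
    (KSC₇ P G x par C37 C38).e = (KSC P G x par C37 C38).e ∧ (KSC₇ P G x par C37 C38).h1 = (KSCU P G x par C37 C38).h1 ∧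
      (KSC₇ P G x par C37 C38).e4 = (KSCU P G x par C37 C38).e4 ∧ (KSC₇ P G x par C37 C38).h2 = (KSCU P G x par C37 C38).h2 :=
  ⟨rfl, rfl, rfl, rfl⟩

omit [FiniteDimensional ℝ 𝔸] in
/-- the (3.45) member of `KSC₇` on (site argument, site cut-off): `sup_E sup_{μ,ν} hqS (par U) α (ζ·∇_{U,μ}G′(dec c)∇*_{U,ν}(f ⊗ E))`, `U = base c` (`rfl`).
[cite: Balaban1985BackgroundPropagators, (3.45) p.398, (3.40) p.397, p.403 l.2–7, bookkeeping] -/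
theorem KSC₇_h2_inl (c : (codingYx P G x C37 C38).bg.Cfg) (f : SiteY x.toKIdx → ℝ) (α : ℝ) (z : SiteY x.toKIdx → ℝ) :
    (KSC₇ P G x par C37 C38).h2 c (.inl f) α (.inl z) =
      ⨆ E : BallY 𝔸, ⨆ μ : Fin (d + 1), ⨆ ν : Fin (d + 1), hqS x.toKIdx (par (baseY x.toKIdx c)) α
        (fun w => ((z w : ℝ) : ℂ) • cdS x.toKIdx (baseY x.toKIdx c) μ
          (GpY x.toKIdx par (decY x.toKIdx c) (cdsS x.toKIdx (baseY x.toKIdx c) ν (liftY f (E : 𝔸)))) w) := rfl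

omit [FiniteDimensional ℝ 𝔸] in
/-- the (3.45) member of `KSC₇` vanishes off the (site argument, site cut-off) sector. [cite: Balaban1985BackgroundPropagators, (3.45) p.398, bookkeeping] -/
theorem KSC₇_h2_off (c : (codingYx P G x C37 C38).bg.Cfg) (α : ℝ) :
    (∀ (f : SiteY x.toKIdx → ℝ) (zb : Node00.FBondY x.toKIdx → ℝ), (KSC₇ P G x par C37 C38).h2 c (.inl f) α (.inr zb) = 0) ∧
    (∀ (J : Node00.FBondY x.toKIdx → ℝ) (ζ : (geo9Y x).Cut), (KSC₇ P G x par C37 C38).h2 c (.inr J) α ζ = 0) := by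
  refine ⟨fun f zb => rfl, fun J ζ => ?_⟩
  rcases ζ with z | z <;> rfl

omit [FiniteDimensional ℝ 𝔸] in
/-- the (3.42) block of `KSC₇` IS that of `KSC`. [cite: Balaban1985BackgroundPropagators, (3.42) p.397, bookkeeping] -/
theorem eBlock_KSC₇_iff {B₀ δ : ℝ} (c : (codingYx P G x C37 C38).bg.Cfg) :
    EBlock (KSC₇ P G x par C37 C38) B₀ δ c ↔ EBlock (KSC P G x par C37 C38) B₀ δ c := by
  rw [EBlock, EBlock, (KSC₇_members P G x par C37 C38).1]

omit [FiniteDimensional ℝ 𝔸] in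
/-- the (3.43) block of `KSC₇` IS that of `KSC₅` (both = `KSCU`'s). [cite: Balaban1985BackgroundPropagators, (3.43) p.398, bookkeeping] -/
theorem h1Block_KSC₇_iff {Bβ : ℝ → ℝ} {δ : ℝ} (c : (codingYx P G x C37 C38).bg.Cfg) :
    H1Block (KSC₇ P G x par C37 C38) Bβ δ c ↔ H1Block (KSC₅ P G x par C37 C38) Bβ δ c := by
  rw [H1Block, H1Block, (KSC₇_members P G x par C37 C38).2.1, B9SectBH1FrameCodedYR.KSC₅_h1 P]

omit [FiniteDimensional ℝ 𝔸] in
/-- the (3.44) block of `KSC₇` IS that of `KSCU`. [cite: Balaban1985BackgroundPropagators, (3.44) p.398, bookkeeping] -/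
theorem e4Block_KSC₇_iff {Bε : ℝ → ℝ} {δ : ℝ} (c : (codingYx P G x C37 C38).bg.Cfg) :
    E4Block (KSC₇ P G x par C37 C38) Bε δ c ↔ E4Block (KSCU P G x par C37 C38) Bε δ c := by
  rw [E4Block, E4Block, (KSC₇_members P G x par C37 C38).2.2.1]

omit [FiniteDimensional ℝ 𝔸] in
/-- the (3.45) block of `KSC₇` IS that of `KSCU`. [cite: Balaban1985BackgroundPropagators, (3.45) p.398, bookkeeping] -/
theorem h2Block_KSC₇_iff {Bεβ : ℝ → ℝ → ℝ} {δ : ℝ} (c : (codingYx P G x C37 C38).bg.Cfg) :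
    H2Block (KSC₇ P G x par C37 C38) Bεβ δ c ↔ H2Block (KSCU P G x par C37 C38) Bεβ δ c := by
  rw [H2Block, H2Block, (KSC₇_members P G x par C37 C38).2.2.2]

omit [FiniteDimensional ℝ 𝔸] in
/-- at a BASE configuration every member of `KSC₇` is `KSC`'s. [cite: Balaban1985BackgroundPropagators, (3.42)–(3.47) pp.397–398, bookkeeping] -/
theorem KSC₇_members_base (U : CfgY 𝔸 x.toKIdx) :
    (∀ n, (KSC₇ P G x par C37 C38).e n (.base U) = (KSC P G x par C37 C38).e n (.base U)) ∧
    (KSC₇ P G x par C37 C38).h1 (.base U) = (KSC P G x par C37 C38).h1 (.base U) ∧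
    (KSC₇ P G x par C37 C38).e4 (.base U) = (KSC P G x par C37 C38).e4 (.base U) ∧
    (KSC₇ P G x par C37 C38).h2 (.base U) = (KSC P G x par C37 C38).h2 (.base U) ∧
    (∀ n, (KSC₇ P G x par C37 C38).l2 n (.base U) = (KSC P G x par C37 C38).l2 n (.base U)) ∧
    (∀ n, (KSC₇ P G x par C37 C38).glob n (.base U) = (KSC P G x par C37 C38).glob n (.base U)) := by
  refine ⟨fun _ => rfl, ?_, ?_, ?_, fun _ => rfl, fun _ => rfl⟩
  · funext lam α ζ
    rcases lam with f | J <;> rcases ζ with z | z <;> rfl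
  · funext lam bb
    rcases lam with f | J <;> rfl
  · funext lam α ζ
    rcases lam with f | J <;> rcases ζ with z | z <;> rfl

variable [Fintype (geo9Y x).Site]

/-- the (3.42) reading dictionary of `KSC₇` is `KSC`'s. [cite: Balaban1985BackgroundPropagators, (3.42) p.397; Balaban1984PropagatorsII, (2.51) p.232] -/
theorem read342Y_KSC₇ (hι : ∀ s : BlkY x.toKIdx, β x.toKIdx.hN x.toKIdx.D x.toKIdx.hk (ιB s) = s)
    (M₂ : ℝ) (hM₂ : 0 ≤ M₂) (hrepr : ∀ (v : 𝔸) (j : ι), |b.repr v j| ≤ M₂ * ‖v‖) (c35 MInv aInv : ℝ) :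
    Read342Y P G x par b ιB C37 C38 (KSC₇ P G x par C37 C38) c35 (M₂ * ∑ j, ‖b j‖) MInv aInv 0 True :=
  fun α₀ U B₀ δ hM hα₀ hMa hreg hB₀ hδ hE =>
    read342Y_KSC P G x par b ιB C37 C38 hι M₂ hM₂ hrepr c35 MInv aInv α₀ U B₀ δ hM hα₀ hMa hreg hB₀ hδ ((eBlock_KSC₇_iff P G x par C37 C38 _).1 hE)

omit [FiniteDimensional ℝ 𝔸] in
/-- the (3.42) writing dictionary of `KSC₇` is `KSC`'s. [cite: Balaban1985BackgroundPropagators, (3.42) p.397, p.403; Balaban1984PropagatorsII, (2.51) p.232] -/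
theorem write342Y_KSC₇ (hι : ∀ s : BlkY x.toKIdx, β x.toKIdx.hN x.toKIdx.D x.toKIdx.hk (ιB s) = s)
    (M₂ : ℝ) (hM₂ : 0 ≤ M₂) (hrepr : ∀ (v : 𝔸) (j : ι), |b.repr v j| ≤ M₂ * ‖v‖) (aW : ℝ) (hC37 : ∀ β' U a, C37 β' U a → GVal G x.toKIdx U) :
    Write342Y P G x par b ιB C37 C38 (KSC₇ P G x par C37 C38) (fun B _ => (M₂ * ∑ j, ‖b j‖) * B + 1) (fun δ => δ) aW 0 True :=
  fun U a α₁ B δ hα₁ hα₁W h37 hB hδ hG hDG hGD hLG =>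
    (eBlock_KSC₇_iff P G x par C37 C38 _).2 (write342Y_KSC P G x par b ιB C37 C38 hι M₂ hM₂ hrepr aW hC37 U a α₁ B δ hα₁ hα₁W h37 hB hδ hG hDG hGD hLG)

end Family

/-! ## §3 Tools: the (3.45) word as a `wordS`, the value identity of the triple letter product, the (3.45) block READ -/

section Tools

variable [NormOneClass 𝔸] (c35 : ℝ) (G : Subgroup 𝔸ˣ) (x : MemberY d ℓ hd hL b₀ b₁ Mstar) (par : SiteParY 𝔸 x.toKIdx) {ι : Type} [Fintype ι]
  (b : Module.Basis ι ℝ 𝔸) (ιB : BlkY x.toKIdx → IBondY x.toKIdx) [Fintype (geo9Y x).Site]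
  (C37 C38 : ℝ → CfgY 𝔸 x.toKIdx → AfldY 𝔸 x.toKIdx → Prop)

omit [FiniteDimensional ℝ 𝔸] [NormOneClass 𝔸] [Fintype (geo9Y x).Site] in
/-- ★ **THE (3.45) BLOCK OF `KSCU` AT A BASE, READ AT A PAIR**: `quot_{z,z′}(ζ·∇_{U,μ}G′(U)∇*_{U,ν}(f ⊗ E)) ≦ B′₀(ε,β)·ℓ(y)^{−β}·(‖ζ‖_β + |ζ|)·e^{−δd(y,y′)}·
(‖f‖_{β+ε} + |f|)` for `supp ζ ⊂ Δ(βy)`, `supp f ⊂ Δ(βy′)`, `‖E‖ ≦ 1`, `z ≠ z′` (the pair is below `hqS`, which is below its `⨆` — bounded over the ball by the basis).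
[cite: Balaban1985BackgroundPropagators, (3.45) p.398, (3.40) p.397] -/
theorem h2_read {M₂ : ℝ} (hM₂ : 0 ≤ M₂) (hrepr : ∀ (v : 𝔸) (j : ι), |b.repr v j| ≤ M₂ * ‖v‖)
    {Bεβ : ℝ → ℝ → ℝ} {δ : ℝ} {U : CfgY 𝔸 x.toKIdx} (hH2 : H2Block (KSCU P G x par C37 C38) Bεβ δ (.base U))
    {ε β' : ℝ} (hε0 : 0 < ε) (hε1 : ε ≤ 1) (hβ0 : 0 ≤ β') (hβ1 : β' < 1) (f : SiteY x.toKIdx → ℝ) (ζ : SiteY x.toKIdx → ℝ) (y y' : IBondY x.toKIdx)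
    (hζ : (geo9Y x).cutInT (Sum.inl ζ) y) (hs : (geo9Y x).suppIn (Sum.inl f) y') (E : BallY 𝔸) (μ ν : Fin (d + 1)) {z z' : SiteY x.toKIdx} (hne : z ≠ z') :
    quotS x.toKIdx (par U) β' (fun w => ((ζ w : ℝ) : ℂ) • cdS x.toKIdx U μ (GpY x.toKIdx par U (cdsS x.toKIdx U ν (liftY f (E : 𝔸)))) w) z z' ≤
      Bεβ ε β' * (geo9Y x).len y ^ (-β') * (geo9Y x).cutH β' (Sum.inl ζ) * Real.exp (-(δ * (geo9Y x).dist y y')) *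
        ((geo9Y x).holder (β' + ε) (Sum.inl f) + (geo9Y x).supNorm (Sum.inl f)) := by
  have h := hH2 ε β' (Sum.inl f) (Sum.inl ζ) y y' hε0 hε1 hβ0 hβ1 hζ hs
  have hK : (KSCU P G x par C37 C38).h2 (.base U) (.inl f) β' (.inl ζ) =
      ⨆ E' : BallY 𝔸, ⨆ μ' : Fin (d + 1), ⨆ ν' : Fin (d + 1), hqS x.toKIdx (par U) β'
        (fun w => ((ζ w : ℝ) : ℂ) • cdS x.toKIdx U μ' (GpY x.toKIdx par U (cdsS x.toKIdx U ν' (liftY f (E' : 𝔸)))) w) := rfl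
  rw [hK] at h
  refine le_trans ?_ h
  set T : (SiteY x.toKIdx → 𝔸) →ₗ[ℂ] (SiteY x.toKIdx → 𝔸) := GpY x.toKIdx par U with hT
  -- every integrand is the `wordS` of `W2`; bounded over the unit ball
  have hw : ∀ (E' : 𝔸) (μ' ν' : Fin (d + 1)), (fun w => ((ζ w : ℝ) : ℂ) • cdS x.toKIdx U μ' (T (cdsS x.toKIdx U ν' (liftY f E'))) w) =
      wordS x.toKIdx ζ (W2 x T U μ' ν') (liftY f E') := fun E' μ' ν' => h2word_eq x T U μ' ν' ζ _
  have hbdd : BddAbove (Set.range fun E' : BallY 𝔸 => ⨆ μ' : Fin (d + 1), ⨆ ν' : Fin (d + 1), hqS x.toKIdx (par U) β'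
      (fun w => ((ζ w : ℝ) : ℂ) • cdS x.toKIdx U μ' (T (cdsS x.toKIdx U ν' (liftY f (E' : 𝔸)))) w)) := by
    refine ⟨∑ μ', ∑ ν', M₂ * ∑ j, hqS x.toKIdx (par U) β' (wordS x.toKIdx ζ (W2 x T U μ' ν') (liftY f (b j))), ?_⟩
    rintro _ ⟨E', rfl⟩
    have hnn : ∀ μ' ν', 0 ≤ M₂ * ∑ j, hqS x.toKIdx (par U) β' (wordS x.toKIdx ζ (W2 x T U μ' ν') (liftY f (b j))) := fun μ' ν' =>
      mul_nonneg hM₂ (Finset.sum_nonneg fun j _ => hqS_nonneg x.toKIdx _ β' _)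
    have hS : 0 ≤ ∑ μ', ∑ ν', M₂ * ∑ j, hqS x.toKIdx (par U) β' (wordS x.toKIdx ζ (W2 x T U μ' ν') (liftY f (b j))) :=
      Finset.sum_nonneg fun μ' _ => Finset.sum_nonneg fun ν' _ => hnn μ' ν'
    refine Real.iSup_le (fun μ' => Real.iSup_le (fun ν' => ?_) hS) hS
    rw [hw]
    refine (hqS_wordS_liftY_le x b (W2 x T U μ' ν') (par U) β' ζ hM₂ hrepr f (mem_closedBall_zero_iff.1 E'.2)).trans ?_
    refine le_trans ?_ (Finset.single_le_sum (f := fun μ'' => ∑ ν', M₂ * ∑ j, hqS x.toKIdx (par U) β' (wordS x.toKIdx ζ (W2 x T U μ'' ν') (liftY f (b j))))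
      (fun μ'' _ => Finset.sum_nonneg fun ν' _ => hnn μ'' ν') (Finset.mem_univ μ'))
    exact Finset.single_le_sum (f := fun ν'' => M₂ * ∑ j, hqS x.toKIdx (par U) β' (wordS x.toKIdx ζ (W2 x T U μ' ν'') (liftY f (b j))))
      (fun ν'' _ => hnn μ' ν'') (Finset.mem_univ ν')
  refine le_trans ?_ (le_ciSup hbdd E)
  refine le_trans ?_ (le_ciSup (f := fun μ' : Fin (d + 1) => ⨆ ν' : Fin (d + 1), hqS x.toKIdx (par U) β'
    (fun w => ((ζ w : ℝ) : ℂ) • cdS x.toKIdx U μ' (T (cdsS x.toKIdx U ν' (liftY f (E : 𝔸)))) w)) (Finite.bddAbove_range _) μ)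
  refine le_trans ?_ (le_ciSup (f := fun ν' : Fin (d + 1) => hqS x.toKIdx (par U) β'
    (fun w => ((ζ w : ℝ) : ℂ) • cdS x.toKIdx U μ (T (cdsS x.toKIdx U ν' (liftY f (E : 𝔸)))) w)) (Finite.bddAbove_range _) ν)
  exact pair_le_hqS x.toKIdx (par U) β' (fun w => ((ζ w : ℝ) : ℂ) • cdS x.toKIdx U μ (T (cdsS x.toKIdx U ν (liftY f (E : 𝔸)))) w) hne

end Tools

/-! ## §4 ★★ The transfer field PROVED for `KSC₇` -/

section Transfer

variable [NormOneClass 𝔸] (c35 : ℝ) (G : Subgroup 𝔸ˣ) (x : MemberY d ℓ hd hL b₀ b₁ Mstar) (par : SiteParY 𝔸 x.toKIdx) {ι : Type} [Fintype ι]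
  (b : Module.Basis ι ℝ 𝔸) (ιB : BlkY x.toKIdx → IBondY x.toKIdx) [Fintype (geo9Y x).Site]
  (C37 C38 : ℝ → CfgY 𝔸 x.toKIdx → AfldY 𝔸 x.toKIdx → Prop)

set_option maxHeartbeats 1600000 in
/-- ★★ **THE TRANSFER FIELD OF THE (3.45) FRAME, PROVED FOR `KSC₇` AT def-Y's LETTERS** (see the module header): from r06's per-probe transfer (vi′) for the letters of
the member (hypothesis `HVI`, the shape of `H2Frame₃.h2_transfer`), the (3.42) majorants at the base (`hread`), the Hölder block (3.43)–(3.45) of `KSC₇` at the base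
and unit norms of the bond variables and transporters (`G`-valued base): the (3.45) block of `KSC₇` at the coded product with `(wH2₇ … B δc Bβ Bε Bεβ, 4δc∕5)`.  For the
output word `ζ·∇_{U,μ}G′(U′U)∇*_{U,ν}(f ⊗ E)` and a pair `(z, z′)`: `Φ := probeH (par U) β ζ z z′`, `D_l := conj b(η⁻¹∇_μ)`, `D_s := conj b(−η⁻¹∇*_ν)`, anchor = the
labelled block of a point of `supp ζ`; the LEFT premise from the (3.43) block, `N` from the (3.44) block, `N₂` from the (3.45) block at the base.
[cite: Balaban1985BackgroundPropagators, Thm 3.4 p.400, (3.43)–(3.45) p.398, (3.40) p.397, p.403 l.2–7, (3.3) p.390, (3.8) p.392; Balaban1984PropagatorsII, (2.51)–(2.52) p.232, (2.54) p.233] -/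
theorem h2_transfer_KSC₇ (hι : ∀ s : BlkY x.toKIdx, β x.toKIdx.hN x.toKIdx.D x.toKIdx.hk (ιB s) = s)
    (hG1 : ∀ u : 𝔸ˣ, u ∈ G → ‖(u : 𝔸)‖ ≤ 1)
    {M₂ : ℝ} (hM₂ : 0 ≤ M₂) (hrepr : ∀ (v : 𝔸) (j : ι), |b.repr v j| ≤ M₂ * ‖v‖)
    {MInv cR aInv aW : ℝ} (hcR : 0 < cR) (hread : Read342Y P G x par b ιB C37 C38 (KSC₇ P G x par C37 C38) c35 cR MInv aInv 0 True)
    (α₀ : ℝ) (c c' : (codingYx P G x C37 C38).bg.Cfg) (α₁ B₀ B δ δc : ℝ) (Bβ Bε : ℝ → ℝ) (Bεβ : ℝ → ℝ → ℝ)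
    (hM : MInv ≤ (geo9Y x).M) (hα₀ : 0 < α₀) (hMa : (geo9Y x).M * α₀ ≤ aInv) (hreg : (codingYx P G x C37 C38).bg.Reg335 c35 α₀ c)
    (_hα₁ : 0 < α₁) (_haW : α₁ ≤ aW) (h37 : (codingYx P G x C37 C38).bg.Cplx337 α₁ c c') (hB₀ : 0 < B₀) (hB : 0 ≤ B)
    (hδ : 0 < δ) (hδc : 0 < δc) (hδcδ : δc ≤ δ)
    (hE : EBlock (KSC₇ P G x par C37 C38) B₀ δ c) (hHol : B9.Ineq343_345 (KSC₇ P G x par C37 C38) Bβ Bε Bεβ δ c)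
    (HVI : ∀ (Dl Ds : Module.End ℝ (SiteY x.toKIdx × ι → ℝ)),
      HasMajorant (g := toB6 (geo9Y x) (0 : ℝ) True) (fun p : SiteY x.toKIdx × ι => blkC x.toKIdx ιB p.1) (Dl * GopC x.toKIdx par b c)
        (fun a a' => cR * B₀ * (geo9Y x).len a * Real.exp (-(δc * (geo9Y x).dist a a'))) →
      HasMajorant (g := toB6 (geo9Y x) (0 : ℝ) True) (fun p : SiteY x.toKIdx × ι => blkC x.toKIdx ιB p.1) (GopC x.toKIdx par b c * Ds)
        (fun a a' => cR * B₀ * (geo9Y x).len a * Real.exp (-(δc * (geo9Y x).dist a a'))) →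
      ∀ (Φ : (SiteY x.toKIdx → 𝔸) →ₗ[ℝ] 𝔸) (y : IBondY x.toKIdx) (p₀ : SiteY x.toKIdx × ι), blkC x.toKIdx ιB p₀.1 = y →
      ∀ (γ Bh cζ : ℝ), 0 ≤ Bh → 0 ≤ cζ →
        (∀ (y'' : IBondY x.toKIdx) (ν : SiteY x.toKIdx × ι → ℝ) (C : ℝ),
          BlockSupp (g := toB6 (geo9Y x) (0 : ℝ) True) (fun p : SiteY x.toKIdx × ι => blkC x.toKIdx ιB p.1) ν y'' C →
          ‖Φ ((coordEquiv b).symm (Dl (GopC x.toKIdx par b c ν)))‖ ≤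
            Bh * (geo9Y x).len y ^ (1 - γ) * cζ * Real.exp (-(δc * (geo9Y x).dist y y'')) * C) →
      ∀ (y' : IBondY x.toKIdx) (μ : SiteY x.toKIdx × ι → ℝ) (M : ℝ),
        BlockSupp (g := toB6 (geo9Y x) (0 : ℝ) True) (fun p : SiteY x.toKIdx × ι => blkC x.toKIdx ιB p.1) μ y' M →
      ∀ (N : ℝ), 0 ≤ N →
        (∀ (k : Fin (d + 1) ⊕ Fin (d + 1)) (z : SiteY x.toKIdx × ι),
          |(((conj b (diffLetter (shiftY x.toKIdx) (coordC G x.toKIdx c) ((((geo9Y x).eta : ℂ))⁻¹) k)) * GopC x.toKIdx par b c * Ds) μ) z| ≤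
            N * Real.exp (-(δc * (geo9Y x).dist (blkC x.toKIdx ιB z.1) y'))) →
      ∀ (N₂ : ℝ), 0 ≤ N₂ →
        ‖Φ ((coordEquiv b).symm ((Dl * GopC x.toKIdx par b c * Ds) μ))‖ ≤ N₂ * Real.exp (-(δc * (geo9Y x).dist y y')) →
        ‖Φ ((coordEquiv b).symm ((Dl * GopC x.toKIdx par b ((codingYx P G x C37 C38).bg.mul c' c) * Ds) μ))‖ ≤
          B * (N₂ + Bh * (geo9Y x).len y ^ (1 - γ) * cζ * ((geo9Y x).len y)⁻¹ * (N + M)) *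
            Real.exp (-(4 / 5 * δc * (geo9Y x).dist y y'))) :
    H2Block (KSC₇ P G x par C37 C38) (wH2₇ (2 * ((d : ℝ) + 1)) (∑ j, ‖b j‖) M₂ B δc Bβ Bε Bεβ) (4 / 5 * δc)
      ((codingYx P G x C37 C38).bg.mul c' c) := by
  classical
  letI : Fintype (B9GeoNormsKLevelV1.geo9K x.toKIdx).Site := ‹Fintype (geo9Y x).Site›
  obtain ⟨U, a, rfl, rfl, hCa⟩ := (codingYx P G x C37 C38).exists_of_bg_Cplx337 h37
  have hU335 : (bg9YC 𝔸 G P x).Reg335 c35 α₀ U := by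
    obtain ⟨U', h1, h2⟩ := (codingYx P G x C37 C38).exists_of_bg_Reg335 hreg
    cases h1
    exact h2
  have hU : GVal G x.toKIdx U := hU335.1.1
  set Sb : ℝ := ∑ j, ‖b j‖ with hSb
  have hSb0 : 0 ≤ Sb := Finset.sum_nonneg fun j _ => norm_nonneg _
  set TU : (SiteY x.toKIdx → 𝔸) →ₗ[ℂ] (SiteY x.toKIdx → 𝔸) := GpY x.toKIdx par U with hTU
  set TW : (SiteY x.toKIdx → 𝔸) →ₗ[ℂ] (SiteY x.toKIdx → 𝔸) := GpY x.toKIdx par (decY x.toKIdx (.prod U a)) with hTW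
  have hη : 0 < etaS x.toKIdx := etaS_pos x.toKIdx
  have hco : coordC G x.toKIdx (.base U) = UboxY x.toKIdx U := (letters_base_of_gVal G x.toKIdx par hU).1
  have hGopU : GopC x.toKIdx par b (.base U) = conj b (Gsc x.toKIdx TU) := by
    show conj b (((kGeo x.toKIdx).eta ^ 2) • (GpY x.toKIdx par U).restrictScalars ℝ) = conj b ((etaS x.toKIdx ^ 2) • TU.restrictScalars ℝ)
    rw [etaS_eq_eta]
  have hGopW : GopC x.toKIdx par b ((codingYx P G x C37 C38).bg.mul (.mult a) (.base U)) = conj b (Gsc x.toKIdx TW) := by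
    show conj b (((kGeo x.toKIdx).eta ^ 2) • (GpY x.toKIdx par (decY x.toKIdx (.prod U a))).restrictScalars ℝ) =
      conj b ((etaS x.toKIdx ^ 2) • TW.restrictScalars ℝ)
    rw [etaS_eq_eta]
  have hDk : ∀ k : Fin (d + 1) ⊕ Fin (d + 1),
      diffLetter (shiftY x.toKIdx) (coordC G x.toKIdx (.base U)) ((((geo9Y x).eta : ℂ))⁻¹) k =
        diffLetter (shiftY x.toKIdx) (UboxY x.toKIdx U) ((((etaS x.toKIdx : ℝ) : ℂ))⁻¹) k := by
    intro k
    show diffLetter (shiftY x.toKIdx) (coordC G x.toKIdx (.base U)) ((((kGeo x.toKIdx).eta : ℝ) : ℂ))⁻¹ k = _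
    rw [hco, etaS_eq_eta]
  have hUu : ∀ (μ : Fin (d + 1)) (w : SiteY x.toKIdx), ‖((UboxY x.toKIdx U μ w : 𝔸ˣ) : 𝔸)‖ ≤ 1 ∧ ‖(((UboxY x.toKIdx U μ w)⁻¹ : 𝔸ˣ) : 𝔸)‖ ≤ 1 :=
    fun μ w => norm_le_one_and_inv_of_mem G hG1 (hU μ _)
  have hdd : 0 ≤ 2 * ((d : ℝ) + 1) := by positivity
  -- the (3.42) majorants of the letters at the base
  obtain ⟨-, hm1, hm2, -⟩ := hread α₀ U B₀ δ hM hα₀ hMa hU335 hB₀ hδ hE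
  have hlow : ∀ a a' : IBondY x.toKIdx, cR * B₀ * (geo9Y x).len a * Real.exp (-(δ * (geo9Y x).dist a a')) ≤
      cR * B₀ * (geo9Y x).len a * Real.exp (-(δc * (geo9Y x).dist a a')) := fun a a' =>
    mul_le_mul_of_nonneg_left (Real.exp_le_exp.2 (by nlinarith [geo9Y_dist_nonneg x a a'])) (mul_nonneg (mul_pos hcR hB₀).le (geo9Y_len_pos x a).le)
  -- the three Hölder∕input blocks at the base, in U-letters
  obtain ⟨hH1, hE4, hH2⟩ := hHol
  have hH1' : H1Block (KSC₅ P G x par C37 C38) Bβ δ (.base U) := (h1Block_KSC₇_iff P G x par C37 C38 _).1 hH1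
  have hE4' : E4Block (KSCU P G x par C37 C38) Bε δ (.base U) := (e4Block_KSC₇_iff P G x par C37 C38 _).1 hE4
  have hH2' : H2Block (KSCU P G x par C37 C38) Bεβ δ (.base U) := (h2Block_KSC₇_iff P G x par C37 C38 _).1 hH2
  -- the output block
  intro ε β' lam ζ y y' hε0 hε1 hβ0 hβ1 hζ hlam
  have hW : 0 ≤ wH2₇ (2 * ((d : ℝ) + 1)) Sb M₂ B δc Bβ Bε Bεβ ε β' := wH2₇_nonneg Bβ Bε Bεβ hSb0 hB hM₂ ε β'
  have hleny : 0 < (geo9Y x).len y := geo9Y_len_pos x y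
  have hcutH : 0 ≤ (geo9Y x).cutH β' ζ := (modelSignsOn_geo9K x.toKIdx).cutH_nonneg β' ζ
  have hHS : 0 ≤ (geo9Y x).holder (β' + ε) lam + (geo9Y x).supNorm lam :=
    add_nonneg ((modelSignsOn_geo9K x.toKIdx).holder_nonneg _ lam) ((modelSignsOn_geo9K x.toKIdx).supNorm_nonneg lam)
  have hRHS : 0 ≤ wH2₇ (2 * ((d : ℝ) + 1)) Sb M₂ B δc Bβ Bε Bεβ ε β' * (geo9Y x).len y ^ (-β') * (geo9Y x).cutH β' ζ *
      Real.exp (-(4 / 5 * δc * (geo9Y x).dist y y')) * ((geo9Y x).holder (β' + ε) lam + (geo9Y x).supNorm lam) :=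
    mul_nonneg (mul_nonneg (mul_nonneg (mul_nonneg hW (Real.rpow_nonneg hleny.le _)) hcutH) (Real.exp_pos _).le) hHS
  rcases lam with f | J
  swap
  · rw [(KSC₇_h2_off P G x par C37 C38 _ β').2 J ζ]; exact hRHS
  rcases ζ with ζ₀ | zb
  swap
  · rw [(KSC₇_h2_off P G x par C37 C38 _ β').1 f zb]; exact hRHS
  have hlam' : (geo9Y x).suppIn (Sum.inl f) y' := hlam
  have hζ' : ∀ w, ζ₀ w ≠ 0 → blkY x.toKIdx w = β x.toKIdx.hN x.toKIdx.D x.toKIdx.hk y := hζ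
  have hsupN : 0 ≤ (geo9Y x).supNorm (Sum.inl f) := (modelSignsOn_geo9K x.toKIdx).supNorm_nonneg _
  have hholε : 0 ≤ (geo9Y x).holder ε (Sum.inl f) := (modelSignsOn_geo9K x.toKIdx).holder_nonneg ε _
  have hhol : 0 ≤ (geo9Y x).holder (β' + ε) (Sum.inl f) := (modelSignsOn_geo9K x.toKIdx).holder_nonneg _ _
  -- `‖f‖_ε ≦ ‖f‖_{β+ε} + 2|f|`
  have hholmono : (geo9Y x).holder ε (Sum.inl f) ≤ (geo9Y x).holder (β' + ε) (Sum.inl f) + 2 * (geo9Y x).supNorm (Sum.inl f) := by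
    show hqTP (toKT x.toKIdx) ε f ≤ hqTP (toKT x.toKIdx) (β' + ε) f + 2 * (toKT x.toKIdx).supF f
    exact hqTP_mono_add x.toKIdx hε0 (by linarith) f
  -- the (3.45) member of the reading at the product: a ⨆ of `hqS`
  rw [KSC₇_h2_inl]
  show (⨆ E : BallY 𝔸, ⨆ μ : Fin (d + 1), ⨆ ν : Fin (d + 1), hqS x.toKIdx (par U) β'
    (fun w => ((ζ₀ w : ℝ) : ℂ) • cdS x.toKIdx U μ (TW (cdsS x.toKIdx U ν (liftY f (E : 𝔸)))) w)) ≤ _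
  refine Real.iSup_le (fun E => Real.iSup_le (fun μ => Real.iSup_le (fun ν => hqS_le_of_forall x.toKIdx (par U) β' _ hRHS
    fun z z' hne => ?_) hRHS) hRHS) hRHS
  have hE1 : ‖(E : 𝔸)‖ ≤ 1 := mem_closedBall_zero_iff.1 E.2
  set X : SiteY x.toKIdx → 𝔸 := cdS x.toKIdx U μ (TW (cdsS x.toKIdx U ν (liftY f (E : 𝔸)))) with hX
  -- the pair quotient is the norm of the probe
  have hquot : ‖B9Eq39Adjoint.R (par U z z') ((((ζ₀ z' : ℝ) : ℂ)) • X z') - (((ζ₀ z : ℝ) : ℂ)) • X z‖ / denS x.toKIdx β' z z' =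
      ‖probeH x.toKIdx (par U) β' ζ₀ z z' X‖ := by rw [norm_probeH]; rfl
  rw [hquot]
  -- trivial cut-off
  by_cases hζ0 : ∀ w, ζ₀ w = 0
  · rw [probeH_apply]
    simp only [hζ0, Complex.ofReal_zero, zero_smul, B9Eq39Adjoint.R_zero, sub_zero, smul_zero, norm_zero]
    exact hRHS
  push Not at hζ0
  obtain ⟨w₀, hw₀⟩ := hζ0
  -- the anchor
  set y₁ : IBondY x.toKIdx := blkC x.toKIdx ιB w₀ with hy₁
  have hy₁β : β x.toKIdx.hN x.toKIdx.D x.toKIdx.hk y₁ = β x.toKIdx.hN x.toKIdx.D x.toKIdx.hk y := by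
    show β x.toKIdx.hN x.toKIdx.D x.toKIdx.hk (ιB (blkY x.toKIdx w₀)) = _; rw [hι, hζ' w₀ hw₀]
  have hlen : (geo9Y x).len y₁ = (geo9Y x).len y := geo9K_len_congr x.toKIdx hy₁β
  have hdist : ∀ t : IBondY x.toKIdx, (geo9Y x).dist y₁ t = (geo9Y x).dist y t := fun t => geo9K_dist_congr x.toKIdx hy₁β rfl
  set yL : IBondY x.toKIdx := ιB (β x.toKIdx.hN x.toKIdx.D x.toKIdx.hk y') with hyL
  have hyLβ : β x.toKIdx.hN x.toKIdx.D x.toKIdx.hk yL = β x.toKIdx.hN x.toKIdx.D x.toKIdx.hk y' := hι _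
  have hdistL : (geo9Y x).dist y₁ yL = (geo9Y x).dist y y' := geo9K_dist_congr x.toKIdx hy₁β (hι _)
  have hlamL : (geo9Y x).suppIn (Sum.inl f) yL := by
    intro w hw; show B6Geom246MultiLevelBox.blkOf x.toKIdx.D.toDomains w = β x.toKIdx.hN x.toKIdx.D x.toKIdx.hk yL
    rw [hyLβ]; exact hlam' w hw
  have hleny₁ : 0 < (geo9Y x).len y₁ := geo9Y_len_pos x y₁
  haveI : Nontrivial 𝔸 := NormOneClass.nontrivial
  obtain ⟨j₀⟩ := b.index_nonempty
  have hp₀ : blkC x.toKIdx ιB ((w₀, j₀) : SiteY x.toKIdx × ι).1 = y₁ := rfl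
  set cζ : ℝ := (geo9Y x).cutH β' (Sum.inl ζ₀) with hcζ
  have hcζ0 : 0 ≤ cζ := hcutH
  set Bp : ℝ := max (Bβ β') 0 with hBp
  have hBp0 : 0 ≤ Bp := le_max_right _ _
  set Bpe : ℝ := max (Bε ε) 0 with hBpe
  have hBpe0 : 0 ≤ Bpe := le_max_right _ _
  set Bp2 : ℝ := max (Bεβ ε β') 0 with hBp2
  have hBp20 : 0 ≤ Bp2 := le_max_right _ _
  set BhL : ℝ := Sb * Bp with hBhL
  have hBhL0 : 0 ≤ BhL := mul_nonneg hSb0 hBp0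
  -- the letters of the output word, the probe, the input
  set Dl : Module.End ℝ (SiteY x.toKIdx × ι → ℝ) := conj b (gradLetterF (shiftY x.toKIdx) (UboxY x.toKIdx U) ((((etaS x.toKIdx : ℝ) : ℂ))⁻¹) μ) with hDl
  set Ds : Module.End ℝ (SiteY x.toKIdx × ι → ℝ) :=
    conj b (diffLetter (shiftY x.toKIdx) (coordC G x.toKIdx (.base U)) ((((geo9Y x).eta : ℂ))⁻¹) (Sum.inr ν)) with hDs
  have hDsU : Ds = conj b (-gradLetterB (shiftY x.toKIdx) (UboxY x.toKIdx U) ((((etaS x.toKIdx : ℝ) : ℂ))⁻¹) ν) := by rw [hDs, hDk, diffLetter_inr]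
  have hDlU : Dl = conj b (diffLetter (shiftY x.toKIdx) (coordC G x.toKIdx (.base U)) ((((geo9Y x).eta : ℂ))⁻¹) (Sum.inl μ)) := by
    rw [hDl, hDk, diffLetter_inl]
  set Φ : (SiteY x.toKIdx → 𝔸) →ₗ[ℝ] 𝔸 := probeH x.toKIdx (par U) β' ζ₀ z z' with hΦ
  have hmajL : HasMajorant (g := toB6 (geo9Y x) (0 : ℝ) True) (fun p : SiteY x.toKIdx × ι => blkC x.toKIdx ιB p.1) (Dl * GopC x.toKIdx par b (.base U))
      (fun a a' => cR * B₀ * (geo9Y x).len a * Real.exp (-(δc * (geo9Y x).dist a a'))) := by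
    rw [hDlU]; exact hasMajorant_mono _ (hm1 (Sum.inl μ)) hlow
  have hmajR : HasMajorant (g := toB6 (geo9Y x) (0 : ℝ) True) (fun p : SiteY x.toKIdx × ι => blkC x.toKIdx ιB p.1) (GopC x.toKIdx par b (.base U) * Ds)
      (fun a a' => cR * B₀ * (geo9Y x).len a * Real.exp (-(δc * (geo9Y x).dist a a'))) :=
    hasMajorant_mono _ (hm2 (Sum.inr ν)) hlow
  have hBS : BlockSupp (g := toB6 (geo9Y x) (0 : ℝ) True) (fun p : SiteY x.toKIdx × ι => blkC x.toKIdx ιB p.1)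
      (coordEquiv b (liftY f (E : 𝔸))) yL (M₂ * (geo9Y x).supNorm (Sum.inl f)) :=
    blockSupp_coordEquiv_liftY x.toKIdx b ιB hM₂ hrepr f y' hlam' hE1
  have hliftE : (coordEquiv b).symm (coordEquiv b (liftY f (E : 𝔸))) = liftY f (E : 𝔸) := LinearEquiv.symm_apply_apply _ _
  -- (A) the LEFT Hölder probes of `D_l·G′(U)` at block-supported inputs, from the (3.43) block at the base
  set Wf : IBondY x.toKIdx → ℝ := fun a' => Bp * (geo9Y x).len y₁ ^ (1 - β') * cζ * Real.exp (-(δc * (geo9Y x).dist y₁ a')) with hWf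
  have hWf0 : ∀ a', 0 ≤ Wf a' := fun a' =>
    mul_nonneg (mul_nonneg (mul_nonneg hBp0 (Real.rpow_nonneg hleny₁.le _)) hcζ0) (Real.exp_pos _).le
  have hreadU : ∀ (g : SiteY x.toKIdx → ℝ) (a' : IBondY x.toKIdx), (geo9Y x).suppIn (Sum.inl g) a' →
      h1ReadT x.toKIdx TU (par U) U g β' ζ₀ ≤ Wf a' * (geo9Y x).supNorm (Sum.inl g) := by
    intro g a' hg
    have h := hH1' β' (Sum.inl g) (Sum.inl ζ₀) y a' hβ0 hβ1 hζ hg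
    rw [KSC₅_h1_inl] at h
    have hN : 0 ≤ (geo9Y x).supNorm (Sum.inl g) := (modelSignsOn_geo9K x.toKIdx).supNorm_nonneg _
    refine (show h1ReadT x.toKIdx TU (par U) U g β' ζ₀ ≤ _ from h).trans ?_
    rw [← hlen, ← hdist]
    have hP : 0 ≤ (geo9Y x).len y₁ ^ (1 - β') * cζ := mul_nonneg (Real.rpow_nonneg hleny₁.le _) hcζ0
    have hexp : Real.exp (-(δ * (geo9Y x).dist y₁ a')) ≤ Real.exp (-(δc * (geo9Y x).dist y₁ a')) :=
      Real.exp_le_exp.2 (by nlinarith [geo9Y_dist_nonneg x y₁ a'])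
    calc Bβ β' * (geo9Y x).len y₁ ^ (1 - β') * (geo9Y x).cutH β' (Sum.inl ζ₀) * Real.exp (-(δ * (geo9Y x).dist y₁ a')) *
          (geo9Y x).supNorm (Sum.inl g)
        = Bβ β' * (((geo9Y x).len y₁ ^ (1 - β') * cζ) * Real.exp (-(δ * (geo9Y x).dist y₁ a')) * (geo9Y x).supNorm (Sum.inl g)) := by
          rw [hcζ]; ring
      _ ≤ Bp * (((geo9Y x).len y₁ ^ (1 - β') * cζ) * Real.exp (-(δc * (geo9Y x).dist y₁ a')) * (geo9Y x).supNorm (Sum.inl g)) := by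
          refine mul_le_mul (le_max_left _ _) ?_ (mul_nonneg (mul_nonneg hP (Real.exp_pos _).le) hN) hBp0
          exact mul_le_mul_of_nonneg_right (mul_le_mul_of_nonneg_left hexp hP) hN
      _ = Wf a' * (geo9Y x).supNorm (Sum.inl g) := by rw [hWf]; ring
  have premA : ∀ (y'' : IBondY x.toKIdx) (νv : SiteY x.toKIdx × ι → ℝ) (C : ℝ),
      BlockSupp (g := toB6 (geo9Y x) (0 : ℝ) True) (fun p : SiteY x.toKIdx × ι => blkC x.toKIdx ιB p.1) νv y'' C →
      ‖Φ ((coordEquiv b).symm (Dl (GopC x.toKIdx par b (.base U) νv)))‖ ≤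
        BhL * (geo9Y x).len y₁ ^ (1 - β') * cζ * Real.exp (-(δc * (geo9Y x).dist y₁ y'')) * C := by
    intro y'' νv C hν
    calc ‖Φ ((coordEquiv b).symm (Dl (GopC x.toKIdx par b (.base U) νv)))‖
        = quotS x.toKIdx (par U) β' (wordS x.toKIdx ζ₀ (cdSL x.toKIdx U μ ∘ₗ TU) ((coordEquiv b).symm νv)) z z' := by
          rw [quotS_wordS_eq, hGopU, ← Module.End.mul_apply, hDl, symm_gradF_G]; rfl
      _ ≤ Sb * (Wf y'' * C) := quotL_blockSupp_le x.toKIdx b ιB TU (par U) U hι hM₂ hrepr β' ζ₀ hWf0 hreadU hν μ hne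
      _ = BhL * (geo9Y x).len y₁ ^ (1 - β') * cζ * Real.exp (-(δc * (geo9Y x).dist y₁ y'')) * C := by rw [hWf, hBhL]; ring
  -- (N) the sup data of `∇♯_k·G′(U)·D_s` at the input, from the (3.44) block at the base
  have he4U : ∀ (μ' ν' : Fin (d + 1)) (w : SiteY x.toKIdx),
      ‖cdS x.toKIdx U μ' (TU (cdsS x.toKIdx U ν' (liftY f (E : 𝔸)))) w‖ ≤
        Bpe * Real.exp (-(δc * (geo9Y x).dist (blkC x.toKIdx ιB w) yL)) * ((geo9Y x).holder ε (Sum.inl f) + (geo9Y x).supNorm (Sum.inl f)) := by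
    intro μ' ν' w
    have hwb : blkY x.toKIdx w = β x.toKIdx.hN x.toKIdx.D x.toKIdx.hk (blkC x.toKIdx ιB w) := (hι _).symm
    refine (e4_read P G x par C37 C38 hE4' hε0 hε1 f (blkC x.toKIdx ιB w) yL hlamL E μ' ν' hwb).trans ?_
    have hHS' : 0 ≤ (geo9Y x).holder ε (Sum.inl f) + (geo9Y x).supNorm (Sum.inl f) := add_nonneg hholε hsupN
    refine mul_le_mul_of_nonneg_right ?_ hHS'
    have hexp : Real.exp (-(δ * (geo9Y x).dist (blkC x.toKIdx ιB w) yL)) ≤ Real.exp (-(δc * (geo9Y x).dist (blkC x.toKIdx ιB w) yL)) :=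
      Real.exp_le_exp.2 (by nlinarith [geo9Y_dist_nonneg x (blkC x.toKIdx ιB w) yL])
    calc Bε ε * Real.exp (-(δ * (geo9Y x).dist (blkC x.toKIdx ιB w) yL))
        ≤ Bpe * Real.exp (-(δ * (geo9Y x).dist (blkC x.toKIdx ιB w) yL)) := mul_le_mul_of_nonneg_right (le_max_left _ _) (Real.exp_pos _).le
      _ ≤ Bpe * Real.exp (-(δc * (geo9Y x).dist (blkC x.toKIdx ιB w) yL)) := mul_le_mul_of_nonneg_left hexp hBpe0
  have he4U' : ∀ (μ' ν' : Fin (d + 1)) (w : SiteY x.toKIdx),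
      ‖cdsS x.toKIdx U μ' (TU (cdsS x.toKIdx U ν' (liftY f (E : 𝔸)))) w‖ ≤
        Bpe * Real.exp (δc * (2 * ((d : ℝ) + 1))) * Real.exp (-(δc * (geo9Y x).dist (blkC x.toKIdx ιB w) yL)) *
          ((geo9Y x).holder ε (Sum.inl f) + (geo9Y x).supNorm (Sum.inl f)) := by
    intro μ' ν' w
    refine (norm_cdsS_le_norm_cdS_symm_shift x.toKIdx U hUu μ' _ w).trans ((he4U μ' ν' _).trans ?_)
    have hHS' : 0 ≤ (geo9Y x).holder ε (Sum.inl f) + (geo9Y x).supNorm (Sum.inl f) := add_nonneg hholε hsupN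
    refine mul_le_mul_of_nonneg_right ?_ hHS'
    rw [mul_assoc]
    refine mul_le_mul_of_nonneg_left ?_ hBpe0
    rw [← Real.exp_add]
    refine Real.exp_le_exp.2 ?_
    have hst := stencilB_blkC x.toKIdx ιB hι μ' w
    have htri := geo9Y_dist_triangle x (blkC x.toKIdx ιB w) (blkC x.toKIdx ιB ((shiftY x.toKIdx μ').symm w)) yL
    have h3 : (geo9Y x).dist (blkC x.toKIdx ιB w) yL ≤ 2 * ((d : ℝ) + 1) + (geo9Y x).dist (blkC x.toKIdx ιB ((shiftY x.toKIdx μ').symm w)) yL := by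
      have hst' : (geo9Y x).dist (blkC x.toKIdx ιB w) (blkC x.toKIdx ιB ((shiftY x.toKIdx μ').symm w)) ≤ 2 * ((d : ℝ) + 1) := hst
      linarith
    have h4 := mul_le_mul_of_nonneg_left h3 hδc.le
    rw [mul_add] at h4
    linarith
  set N : ℝ := M₂ * (Bpe * Real.exp (δc * (2 * ((d : ℝ) + 1))) * ((geo9Y x).holder ε (Sum.inl f) + (geo9Y x).supNorm (Sum.inl f))) with hN
  have hN0 : 0 ≤ N := by positivity
  have hN1 : ∀ (k : Fin (d + 1) ⊕ Fin (d + 1)) (zz : SiteY x.toKIdx × ι),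
      |(((conj b (diffLetter (shiftY x.toKIdx) (coordC G x.toKIdx (.base U)) ((((geo9Y x).eta : ℂ))⁻¹) k)) * GopC x.toKIdx par b (.base U) * Ds)
        (coordEquiv b (liftY f (E : 𝔸)))) zz| ≤ N * Real.exp (-(δc * (geo9Y x).dist (blkC x.toKIdx ιB zz.1) yL)) := by
    intro k zz
    refine (abs_apply_le_norm_symm x b hrepr _ zz).trans ?_
    rw [hDk, hGopU, hDsU]
    rcases k with μ' | μ'
    · rw [diffLetter_inl, norm_symm_gradF_G_negGradB x b TU U μ' ν _ zz.1, hliftE]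
      refine (mul_le_mul_of_nonneg_left (he4U μ' ν zz.1) hM₂).trans ?_
      rw [hN]
      have hone : (1 : ℝ) ≤ Real.exp (δc * (2 * ((d : ℝ) + 1))) := Real.one_le_exp (by positivity)
      have hHS' : 0 ≤ (geo9Y x).holder ε (Sum.inl f) + (geo9Y x).supNorm (Sum.inl f) := add_nonneg hholε hsupN
      have he0 : 0 ≤ Real.exp (-(δc * (geo9Y x).dist (blkC x.toKIdx ιB zz.1) yL)) := (Real.exp_pos _).le
      calc M₂ * (Bpe * Real.exp (-(δc * (geo9Y x).dist (blkC x.toKIdx ιB zz.1) yL)) * ((geo9Y x).holder ε (Sum.inl f) + (geo9Y x).supNorm (Sum.inl f)))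
          = (M₂ * (Bpe * 1 * ((geo9Y x).holder ε (Sum.inl f) + (geo9Y x).supNorm (Sum.inl f)))) *
              Real.exp (-(δc * (geo9Y x).dist (blkC x.toKIdx ιB zz.1) yL)) := by ring
        _ ≤ (M₂ * (Bpe * Real.exp (δc * (2 * ((d : ℝ) + 1))) * ((geo9Y x).holder ε (Sum.inl f) + (geo9Y x).supNorm (Sum.inl f)))) *
              Real.exp (-(δc * (geo9Y x).dist (blkC x.toKIdx ιB zz.1) yL)) := by
            refine mul_le_mul_of_nonneg_right (mul_le_mul_of_nonneg_left ?_ hM₂) he0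
            exact mul_le_mul_of_nonneg_right (mul_le_mul_of_nonneg_left hone hBpe0) hHS'
    · rw [diffLetter_inr, norm_symm_negGradB_G_negGradB x b TU U μ' ν _ zz.1, hliftE]
      refine (mul_le_mul_of_nonneg_left (he4U' μ' ν zz.1) hM₂).trans (le_of_eq ?_)
      rw [hN]; ring
  -- (N₂) the probe of the unperturbed word, from the (3.45) block at the base
  set N₂ : ℝ := Bp2 * (geo9Y x).len y₁ ^ (-β') * cζ * ((geo9Y x).holder (β' + ε) (Sum.inl f) + (geo9Y x).supNorm (Sum.inl f)) with hN₂
  have hN₂0 : 0 ≤ N₂ := mul_nonneg (mul_nonneg (mul_nonneg hBp20 (Real.rpow_nonneg hleny₁.le _)) hcζ0) (add_nonneg hhol hsupN)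
  have hN2 : ‖Φ ((coordEquiv b).symm ((Dl * GopC x.toKIdx par b (.base U) * Ds) (coordEquiv b (liftY f (E : 𝔸)))))‖ ≤
      N₂ * Real.exp (-(δc * (geo9Y x).dist y₁ yL)) := by
    rw [hGopU, hDsU, hDl, symm_gradF_G_negGradB_eq x b TU U μ ν, hliftE, map_neg, norm_neg, norm_probeH]
    refine (h2_read P G x par b C37 C38 hM₂ hrepr hH2' hε0 hε1 hβ0 hβ1 f ζ₀ y y' hζ hlam' E μ ν hne).trans ?_
    rw [← hlen, ← hdistL, hN₂]
    have hexp : Real.exp (-(δ * (geo9Y x).dist y₁ yL)) ≤ Real.exp (-(δc * (geo9Y x).dist y₁ yL)) :=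
      Real.exp_le_exp.2 (by nlinarith [geo9Y_dist_nonneg x y₁ yL])
    have hP : 0 ≤ (geo9Y x).len y₁ ^ (-β') * cζ * ((geo9Y x).holder (β' + ε) (Sum.inl f) + (geo9Y x).supNorm (Sum.inl f)) :=
      mul_nonneg (mul_nonneg (Real.rpow_nonneg hleny₁.le _) hcζ0) (add_nonneg hhol hsupN)
    calc Bεβ ε β' * (geo9Y x).len y₁ ^ (-β') * (geo9Y x).cutH β' (Sum.inl ζ₀) * Real.exp (-(δ * (geo9Y x).dist y₁ yL)) *
          ((geo9Y x).holder (β' + ε) (Sum.inl f) + (geo9Y x).supNorm (Sum.inl f))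
        = Bεβ ε β' * (((geo9Y x).len y₁ ^ (-β') * cζ * ((geo9Y x).holder (β' + ε) (Sum.inl f) + (geo9Y x).supNorm (Sum.inl f))) *
            Real.exp (-(δ * (geo9Y x).dist y₁ yL))) := by rw [hcζ]; ring
      _ ≤ Bp2 * (((geo9Y x).len y₁ ^ (-β') * cζ * ((geo9Y x).holder (β' + ε) (Sum.inl f) + (geo9Y x).supNorm (Sum.inl f))) *
            Real.exp (-(δc * (geo9Y x).dist y₁ yL))) :=
          mul_le_mul (le_max_left _ _) (mul_le_mul_of_nonneg_left hexp hP) (mul_nonneg hP (Real.exp_pos _).le) hBp20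
      _ = _ := by ring
  -- the transfer
  have hout := HVI Dl Ds hmajL hmajR Φ y₁ (w₀, j₀) hp₀ β' BhL cζ hBhL0 hcζ0 premA yL (coordEquiv b (liftY f (E : 𝔸))) _ hBS N hN0 hN1 N₂ hN₂0 hN2
  have hval : ‖Φ X‖ = ‖Φ ((coordEquiv b).symm ((Dl * GopC x.toKIdx par b ((codingYx P G x C37 C38).bg.mul (.mult a) (.base U)) * Ds)
      (coordEquiv b (liftY f (E : 𝔸)))))‖ := by
    rw [hGopW, hDsU, hDl, symm_gradF_G_negGradB_eq x b TW U μ ν, hliftE, map_neg, norm_neg]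
  rw [hval]
  refine hout.trans ?_
  rw [hlen, hdistL]
  -- arithmetic
  set L : ℝ := (geo9Y x).len y with hLdef
  set ee : ℝ := Real.exp (-(4 / 5 * δc * (geo9Y x).dist y y')) with hee
  have hee0 : 0 ≤ ee := (Real.exp_pos _).le
  set HS : ℝ := (geo9Y x).holder (β' + ε) (Sum.inl f) + (geo9Y x).supNorm (Sum.inl f) with hHSdef
  have hHS0 : 0 ≤ HS := add_nonneg hhol hsupN
  have hLm : L ^ (1 - β') * L⁻¹ = L ^ (-β') := by
    rw [← Real.rpow_neg_one, ← Real.rpow_add hleny]; ring_nf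
  have hNM : N + M₂ * (geo9Y x).supNorm (Sum.inl f) ≤ 3 * M₂ * (Bpe * Real.exp (δc * (2 * ((d : ℝ) + 1))) + 1) * HS := by
    rw [hN, hHSdef]
    have hc0 : 0 ≤ M₂ * (Bpe * Real.exp (δc * (2 * ((d : ℝ) + 1))) + 1) := by positivity
    have h1 : (geo9Y x).holder ε (Sum.inl f) + (geo9Y x).supNorm (Sum.inl f) ≤
        3 * ((geo9Y x).holder (β' + ε) (Sum.inl f) + (geo9Y x).supNorm (Sum.inl f)) := by nlinarith
    have h2 : (geo9Y x).supNorm (Sum.inl f) ≤ 3 * ((geo9Y x).holder (β' + ε) (Sum.inl f) + (geo9Y x).supNorm (Sum.inl f)) := by nlinarith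
    have hA : 0 ≤ M₂ * (Bpe * Real.exp (δc * (2 * ((d : ℝ) + 1)))) := by positivity
    calc M₂ * (Bpe * Real.exp (δc * (2 * ((d : ℝ) + 1))) * ((geo9Y x).holder ε (Sum.inl f) + (geo9Y x).supNorm (Sum.inl f))) +
          M₂ * (geo9Y x).supNorm (Sum.inl f)
        = (M₂ * (Bpe * Real.exp (δc * (2 * ((d : ℝ) + 1))))) * ((geo9Y x).holder ε (Sum.inl f) + (geo9Y x).supNorm (Sum.inl f)) +
            M₂ * (geo9Y x).supNorm (Sum.inl f) := by ring
      _ ≤ (M₂ * (Bpe * Real.exp (δc * (2 * ((d : ℝ) + 1))))) * (3 * ((geo9Y x).holder (β' + ε) (Sum.inl f) + (geo9Y x).supNorm (Sum.inl f))) +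
            M₂ * (3 * ((geo9Y x).holder (β' + ε) (Sum.inl f) + (geo9Y x).supNorm (Sum.inl f))) :=
          add_le_add (mul_le_mul_of_nonneg_left h1 hA) (mul_le_mul_of_nonneg_left h2 hM₂)
      _ = 3 * M₂ * (Bpe * Real.exp (δc * (2 * ((d : ℝ) + 1))) + 1) * ((geo9Y x).holder (β' + ε) (Sum.inl f) + (geo9Y x).supNorm (Sum.inl f)) := by
          ring
  have hNMnn : 0 ≤ N + M₂ * (geo9Y x).supNorm (Sum.inl f) := add_nonneg hN0 (mul_nonneg hM₂ hsupN)
  have hterm2 : BhL * L ^ (1 - β') * cζ * L⁻¹ * (N + M₂ * (geo9Y x).supNorm (Sum.inl f)) ≤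
      BhL * cζ * L ^ (-β') * (3 * M₂ * (Bpe * Real.exp (δc * (2 * ((d : ℝ) + 1))) + 1) * HS) := by
    calc BhL * L ^ (1 - β') * cζ * L⁻¹ * (N + M₂ * (geo9Y x).supNorm (Sum.inl f))
        = BhL * cζ * (L ^ (1 - β') * L⁻¹) * (N + M₂ * (geo9Y x).supNorm (Sum.inl f)) := by ring
      _ = BhL * cζ * L ^ (-β') * (N + M₂ * (geo9Y x).supNorm (Sum.inl f)) := by rw [hLm]
      _ ≤ BhL * cζ * L ^ (-β') * (3 * M₂ * (Bpe * Real.exp (δc * (2 * ((d : ℝ) + 1))) + 1) * HS) :=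
          mul_le_mul_of_nonneg_left hNM (mul_nonneg (mul_nonneg hBhL0 hcζ0) (Real.rpow_nonneg hleny.le _))
  have hterm1 : N₂ = Bp2 * L ^ (-β') * cζ * HS := by rw [hN₂, hlen]
  calc B * (N₂ + BhL * L ^ (1 - β') * cζ * L⁻¹ * (N + M₂ * (geo9Y x).supNorm (Sum.inl f))) * ee
      ≤ B * (Bp2 * L ^ (-β') * cζ * HS + BhL * cζ * L ^ (-β') * (3 * M₂ * (Bpe * Real.exp (δc * (2 * ((d : ℝ) + 1))) + 1) * HS)) * ee := by
        refine mul_le_mul_of_nonneg_right (mul_le_mul_of_nonneg_left ?_ hB) hee0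
        rw [hterm1]
        exact add_le_add le_rfl hterm2
    _ = wH2₇ (2 * ((d : ℝ) + 1)) Sb M₂ B δc Bβ Bε Bεβ ε β' * L ^ (-β') * cζ * ee * HS := by
        rw [wH2₇, ← hBp, ← hBpe, ← hBp2, hBhL]; ring

end Transfer

/-! ## §5 ★★ The frame instance over the coded carriers of a subfamily and the (3.45) block-steps -/

section Steps

variable [NormOneClass 𝔸] {J : Type} (f : J → MemberY d ℓ hd hL b₀ b₁ Mstar) [∀ x : MemberY d ℓ hd hL b₀ b₁ Mstar, Fintype (geo9Y x).Site]
  [instDS : ∀ x : MemberY d ℓ hd hL b₀ b₁ Mstar, DecidableEq (geo9Y x).Site] [instNE : ∀ x : MemberY d ℓ hd hL b₀ b₁ Mstar, Nonempty (geo9Y x).Site]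
  (c35 : ℝ) (G : Subgroup 𝔸ˣ) (par : ∀ j : J, SiteParY 𝔸 (f j).toKIdx) (OA : ∀ j : J, BondOpY 𝔸 (f j).toKIdx)
  (parB : ∀ j : J, BondParY 𝔸 (f j).toKIdx) {ι : Type} [Fintype ι] [DecidableEq ι] (b : Module.Basis ι ℝ 𝔸)
  (ιB : ∀ j : J, BlkY (f j).toKIdx → IBondY (f j).toKIdx)
  (C37 C38 : ∀ j : J, ℝ → CfgY 𝔸 (f j).toKIdx → AfldY 𝔸 (f j).toKIdx → Prop)
  (Cinv : ∀ j : J, B9.SiteKernel (geo9Y (f j)) (bg9YC 𝔸 G P (f j)))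

/-- ★★ **THE (3.45) FRAME OVER THE CODED CARRIERS OF A SUBFAMILY, INHABITED FOR `KSC₇`** (root frame `gpFrame₂CodedOn` with `KSC₇`'s dictionaries, writing function
`wH2₇`, rate `4δc∕5`, transfer field `h2_transfer_KSC₇`); no hypothesis beyond the root frame's.
[cite: Balaban1985BackgroundPropagators, Thm 3.4 p.400, (3.45) p.398, p.403 l.2–5, (3.60)–(3.65) pp.402–403; Balaban1984PropagatorsII, Lemma 2.1 p.234, (2.51)–(2.52) p.232] -/
noncomputable def h2Frame₃CodedOn (hι : ∀ (j : J) (s : BlkY (f j).toKIdx), β (f j).toKIdx.hN (f j).toKIdx.D (f j).toKIdx.hk (ιB j s) = s)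
    (hG1 : ∀ u : 𝔸ˣ, u ∈ G → ‖(u : 𝔸)‖ ≤ 1) (hpar : ∀ j (U : CfgY 𝔸 (f j).toKIdx), GVal G (f j).toKIdx U → ∀ z w, par j U z w ∈ G)
    (hunit : ∀ j (U : CfgY 𝔸 (f j).toKIdx), GVal G (f j).toKIdx U → IsUnit (deltaPrimeAY (f j).toKIdx (par j) U))
    (dB : ℕ) (M₂ : ℝ) (hM₂ : 0 ≤ M₂) (hrepr : ∀ (v : 𝔸) (j : ι), |b.repr v j| ≤ M₂ * ‖v‖) (hcR : 0 < M₂ * ∑ j, ‖b j‖)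
    (Cq : ℝ) (hCq : 0 ≤ Cq) (hC37 : ∀ j β' U a, C37 j β' U a → GVal G (f j).toKIdx U ∧ CplxLettersY G (f j) (par j) (ιB j) Cq β' U a)
    (MInv aInv aW : ℝ) (hMInv : 0 < MInv) (haInv : 0 < aInv) (haW : 0 < aW) :
    H2Frame₃ c35 (fun j => geo9Y (f j)) (fun j => (codingYx P G (f j) (C37 j) (C38 j)).bg) (fun j => KSC₇ P G (f j) (par j) (C37 j) (C38 j)) b
      (Fin (d + 1)) (fun j => SiteY (f j).toKIdx) :=
  { gpFrame₂CodedOn P f c35 G b C37 C38 par ιB (fun j => KSC₇ P G (f j) (par j) (C37 j) (C38 j)) hι hG1 hpar hunit dB M₂ hM₂ hrepr Cq hCq hC37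
      (M₂ * ∑ j, ‖b j‖) hcR (fun B _ => (M₂ * ∑ j, ‖b j‖) * B + 1) (fun B _ hB _ => by positivity) (fun δ => δ) (fun δ hδ => hδ)
      MInv aInv aW hMInv haInv haW (fun j => read342Y_KSC₇ P G (f j) (par j) b (ιB j) (C37 j) (C38 j) (hι j) M₂ hM₂ hrepr c35 MInv aInv)
      (fun j => write342Y_KSC₇ P G (f j) (par j) b (ιB j) (C37 j) (C38 j) (hι j) M₂ hM₂ hrepr aW fun β' U a h => (hC37 j β' U a h).1) with
    wH2 := fun B δc Bβ Bε Bεβ => wH2₇ (2 * ((d : ℝ) + 1)) (∑ j, ‖b j‖) M₂ B δc Bβ Bε Bεβ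
    wH2δ := fun δc => 4 / 5 * δc
    wH2δ_pos := fun δc hδc => by positivity
    h2_transfer := fun j α₀ c c' α₁ B₀ B δ δc Bβ Bε Bεβ hM hα₀ hMa hreg hα₁ haW' h37 hB₀ hB hδ hδc hδcδ hE hHol HVI =>
      h2_transfer_KSC₇ P c35 G (f j) (par j) b (ιB j) (C37 j) (C38 j) (hι j) hG1 hM₂ hrepr hcR
        (read342Y_KSC₇ P G (f j) (par j) b (ιB j) (C37 j) (C38 j) (hι j) M₂ hM₂ hrepr c35 MInv aInv)
        α₀ c c' α₁ B₀ B δ δc Bβ Bε Bεβ hM hα₀ hMa hreg hα₁ haW' h37 hB₀ hB hδ hδc hδcδ hE hHol HVI }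

/-- ★★ **`StepH2Pos` OF `KSC₇` OVER THE CODED CARRIERS** (any shared `GA`, `Cinv`). [cite: Balaban1985BackgroundPropagators, Thm 3.4 p.400, (3.45) p.398, p.403 l.2–5; Balaban1984PropagatorsII, Lemma 2.1 p.234] -/
theorem stepH2Pos_KSC₇_on (hι : ∀ (j : J) (s : BlkY (f j).toKIdx), β (f j).toKIdx.hN (f j).toKIdx.D (f j).toKIdx.hk (ιB j s) = s)
    (hG1 : ∀ u : 𝔸ˣ, u ∈ G → ‖(u : 𝔸)‖ ≤ 1) (hpar : ∀ j (U : CfgY 𝔸 (f j).toKIdx), GVal G (f j).toKIdx U → ∀ z w, par j U z w ∈ G)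
    (hunit : ∀ j (U : CfgY 𝔸 (f j).toKIdx), GVal G (f j).toKIdx U → IsUnit (deltaPrimeAY (f j).toKIdx (par j) U))
    (dB : ℕ) (M₂ : ℝ) (hM₂ : 0 ≤ M₂) (hrepr : ∀ (v : 𝔸) (j : ι), |b.repr v j| ≤ M₂ * ‖v‖) (hcR : 0 < M₂ * ∑ j, ‖b j‖)
    (Cq : ℝ) (hCq : 0 ≤ Cq) (hC37 : ∀ j β' U a, C37 j β' U a → GVal G (f j).toKIdx U ∧ CplxLettersY G (f j) (par j) (ιB j) Cq β' U a)
    (MInv aInv aW : ℝ) (hMInv : 0 < MInv) (haInv : 0 < aInv) (haW : 0 < aW)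
    (GA : ∀ j : J, B9.KernelFamily (geo9Y (f j)) (codingYx P G (f j) (C37 j) (C38 j)).bg)
    (CinvC : ∀ j : J, B9.SiteKernel (geo9Y (f j)) (codingYx P G (f j) (C37 j) (C38 j)).bg) :
    StepH2Pos dB c35 (fun j => geo9Y (f j)) (fun j => (codingYx P G (f j) (C37 j) (C38 j)).bg) (fun j => KSC₇ P G (f j) (par j) (C37 j) (C38 j)) GA CinvC
      (fun j => KSC₇ P G (f j) (par j) (C37 j) (C38 j)) :=
  stepH2Pos_of_h2Frame₃ (d := dB)
    (h2Frame₃CodedOn P f c35 G par b ιB C37 C38 hι hG1 hpar hunit dB M₂ hM₂ hrepr hcR Cq hCq hC37 MInv aInv aW hMInv haInv haW) GA CinvC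

omit [NormOneClass 𝔸] [FiniteDimensional ℝ 𝔸] [DecidableEq ι] instDS instNE in
/-- ★ **`hin` FOR `KSC₇` WITH POSITIVE OUTPUT CONSTANTS** (input families `(KSCU, KACU, pullS Cinv)`): g11's `hin_KSCU_on_pos` (output `KSC`) followed by the base
congruence `KSC ↦ KSC₇`. [cite: Balaban1985BackgroundPropagators, Thms 3.1–3.3 (3.42)–(3.48) pp.397–399, (3.35) p.396; Balaban1984PropagatorsII, (2.51) p.232] -/
theorem hin_KSC₇_on_pos (hι : ∀ (j : J) (s : BlkY (f j).toKIdx), β (f j).toKIdx.hN (f j).toKIdx.D (f j).toKIdx.hk (ιB j s) = s)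
    (hG1 : ∀ u : 𝔸ˣ, u ∈ G → ‖(u : 𝔸)‖ ≤ 1) {M₂ : ℝ} (hM₂ : 0 ≤ M₂) (hrepr : ∀ (v : 𝔸) (j : ι), |b.repr v j| ≤ M₂ * ‖v‖) (dC : ℕ) :
    ∀ (B₀ δ₀ : ℝ) (Bβ Bε : ℝ → ℝ) (Bεβ : ℝ → ℝ → ℝ) (B₁ δ₁ : ℝ), 0 < B₀ → 0 < δ₀ → 0 < B₁ → 0 < δ₁ →
      ∃ (Mi ai B₀' δ₀' : ℝ) (Bβ' Bε' : ℝ → ℝ) (Bεβ' : ℝ → ℝ → ℝ) (B₁' δ₁' : ℝ), 0 < ai ∧ 0 < B₀' ∧ 0 < δ₀' ∧ 0 < B₁' ∧ 0 < δ₁' ∧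
        ∀ j : J, Mi ≤ (geo9Y (f j)).M → ∀ α₀ : ℝ, 0 < α₀ → (geo9Y (f j)).M * α₀ ≤ ai →
          ∀ c : (codingYx P G (f j) (C37 j) (C38 j)).bg.Cfg, (codingYx P G (f j) (C37 j) (C38 j)).bg.Reg335 c35 α₀ c →
          B9.Thms31to33IneqAt dC (KSCU P G (f j) (par j) (C37 j) (C38 j)) (KACU P G (f j) (OA j) (parB j) (C37 j) (C38 j))
              (pullS (codingYx P G (f j) (C37 j) (C38 j)) (Cinv j)) B₀ δ₀ Bβ Bε Bεβ B₁ δ₁ c →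
          B9.Thms31to33IneqAt dC (KSC₇ P G (f j) (par j) (C37 j) (C38 j)) (KACU P G (f j) (OA j) (parB j) (C37 j) (C38 j))
              (pullS (codingYx P G (f j) (C37 j) (C38 j)) (Cinv j)) B₀' δ₀' Bβ' Bε' Bεβ' B₁' δ₁' c := by
  intro B₀ δ₀ Bβ Bε Bεβ B₁ δ₁ hB₀ hδ₀ hB₁ hδ₁
  obtain ⟨Mi, ai, B₀', δ₀', Bβ', Bε', Bεβ', B₁', δ₁', hai, hB₀', hδ₀', hB₁', hδ₁', H⟩ :=
    hin_KSCU_on_pos P f c35 G par OA parB b ιB C37 C38 Cinv hι hG1 hM₂ hrepr dC B₀ δ₀ Bβ Bε Bεβ B₁ δ₁ hB₀ hδ₀ hB₁ hδ₁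
  refine ⟨Mi, ai, B₀', δ₀', Bβ', Bε', Bεβ', B₁', δ₁', hai, hB₀', hδ₀', hB₁', hδ₁', fun j hM α₀ hα₀ hMa c hreg hT => ?_⟩
  obtain ⟨U, rfl, -⟩ := (codingYx P G (f j) (C37 j) (C38 j)).exists_of_bg_Reg335 hreg
  obtain ⟨⟨h42, h43⟩, hC, hG⟩ := H j hM α₀ hα₀ hMa _ hreg hT
  obtain ⟨se, sh1, se4, sh2, sl2, sg⟩ := KSC₇_members_base P G (f j) (par j) (C37 j) (C38 j) U
  exact ⟨⟨ineq342_346_347_congr P G (f j) (C37 j) (C38 j) _ _ (fun n => (se n).symm) (fun n => (sl2 n).symm) (fun n => (sg n).symm) _ _ h42,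
    ineq343_345_congr P G (f j) (C37 j) (C38 j) _ _ sh1.symm se4.symm sh2.symm _ _ _ _ h43⟩, hC, hG⟩

/-- ★★ **`StepH2Pos` OF `KSCU` OVER THE CODED CARRIER — THE (3.45) MEMBER OF THE SECT.-B STEP OF RECORD IN PRINT's READING (R13-U1), G′ SIDE** (input
families `(KSCU, KACU, pullS Cinv)`, output `KSCU`'s (3.45) block at the product): `stepH2Pos_KSC₇_on` (with `GA := KACU`, `Cinv := pullS Cinv`) transported
by `stepH2Pos_of_family_pos` — `hin_KSC₇_on_pos`, identity output (`KSC₇.h2 = KSCU.h2`).  Binders = those of `B9SectBStepsKSCUBlocks.stepEPos_KSCU_on`.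
[cite: Balaban1985BackgroundPropagators, Thm 3.4 p.400, (3.45) p.398, p.403 l.2–5, (3.60)–(3.65) pp.402–403, (3.35)–(3.37) p.396; Balaban1984PropagatorsII, Lemma 2.1 p.234, (2.51)–(2.52) p.232] -/
theorem stepH2Pos_KSCU_on (hι : ∀ (j : J) (s : BlkY (f j).toKIdx), β (f j).toKIdx.hN (f j).toKIdx.D (f j).toKIdx.hk (ιB j s) = s)
    (hG1 : ∀ u : 𝔸ˣ, u ∈ G → ‖(u : 𝔸)‖ ≤ 1) (hpar : ∀ j (U : CfgY 𝔸 (f j).toKIdx), GVal G (f j).toKIdx U → ∀ z w, par j U z w ∈ G)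
    (hunit : ∀ j (U : CfgY 𝔸 (f j).toKIdx), GVal G (f j).toKIdx U → IsUnit (deltaPrimeAY (f j).toKIdx (par j) U))
    (dB : ℕ) (M₂ : ℝ) (hM₂ : 0 ≤ M₂) (hrepr : ∀ (v : 𝔸) (j : ι), |b.repr v j| ≤ M₂ * ‖v‖) (hcR : 0 < M₂ * ∑ j, ‖b j‖)
    (Cq : ℝ) (hCq : 0 ≤ Cq) (hC37 : ∀ j β' U a, C37 j β' U a → GVal G (f j).toKIdx U ∧ CplxLettersY G (f j) (par j) (ιB j) Cq β' U a)
    (MInv aInv aW : ℝ) (hMInv : 0 < MInv) (haInv : 0 < aInv) (haW : 0 < aW) :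
    StepH2Pos dB c35 (fun j => geo9Y (f j)) (fun j => (codingYx P G (f j) (C37 j) (C38 j)).bg)
      (fun j => KSCU P G (f j) (par j) (C37 j) (C38 j)) (fun j => KACU P G (f j) (OA j) (parB j) (C37 j) (C38 j))
      (fun j => pullS (codingYx P G (f j) (C37 j) (C38 j)) (Cinv j)) (fun j => KSCU P G (f j) (par j) (C37 j) (C38 j)) :=
  stepH2Pos_of_family_pos dB c35 (fun j => geo9Y (f j)) (fun j => (codingYx P G (f j) (C37 j) (C38 j)).bg)
    (fun j => KSC₇ P G (f j) (par j) (C37 j) (C38 j)) (fun j => KSCU P G (f j) (par j) (C37 j) (C38 j))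
    (fun j => KACU P G (f j) (OA j) (parB j) (C37 j) (C38 j)) (fun j => KACU P G (f j) (OA j) (parB j) (C37 j) (C38 j))
    (fun j => pullS (codingYx P G (f j) (C37 j) (C38 j)) (Cinv j))
    (fun j => KSC₇ P G (f j) (par j) (C37 j) (C38 j)) (fun j => KSCU P G (f j) (par j) (C37 j) (C38 j))
    (hin_KSC₇_on_pos P f c35 G par OA parB b ιB C37 C38 Cinv hι hG1 hM₂ hrepr dB)
    (fun Bεβ δ a hδ ha => ⟨0, 1, a, Bεβ, δ, one_pos, ha, le_rfl, hδ, fun j _ _ _ _ _ _ _ _ _ _ _ h => (h2Block_KSC₇_iff P G (f j) (par j) (C37 j) (C38 j) _).1 h⟩)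
    (stepH2Pos_KSC₇_on P f c35 G par b ιB C37 C38 hι hG1 hpar hunit dB M₂ hM₂ hrepr hcR Cq hCq hC37 MInv aInv aW hMInv haInv haW _ _)

end Steps

end Literature.MathematicalPhysics.QuantumFieldTheory.Balaban1983to89.B9SectBH2FrameCodedYR

end

/-!
# `Balaban1983to89.B9SectBKerStepParSymYR` — THE CLASS-PARAMETRIC TWIN of `B9SectBKerStepParSymY` (CASCADE-R, director-ym №279 GO-R; №277 (3) `hunitA` cure; dag-n06-d SOCKET-(α) class question)

statement-level skeleton of published theorems with citation tags; proofs where landed; nothing here is a claim about the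
Yang–Mills mass gap

WHAT THIS FILE IS.  The original module `B9SectBKerStepParSymY` types its objects over MODULE 3's member carrier `bg9Y 𝔸 G x` (MODULE 2's small-cube class (3.35)).  This file RE-DECLARES, with UNCHANGED NAMES inside the namespace `…B9SectBKerStepParSymYR`, exactly its 2 class-dependent declarations over the CLASS-PARAMETRIC carrier `B9SectBCodedClassR.bg9YC 𝔸 G P x` (`P : RegExtraY …` = the two cube conditions of (3.35)∕(3.36) as a parameter; `bg9Y 𝔸 G x = bg9YC 𝔸 G (extraY 𝔸 G) x` by `rfl`, so every declaration here specialises definitionally to its original; at the record's reading of PRINT's class, `P := extraYPb 𝔸 G`, the displayed laws `hreg335P` ((3.35) on plaquettes) and the class-keyed `hunitA` become theorems).  The text is the original's VERBATIM under the token surgery `bg9Y 𝔸 G ↦ bg9YC 𝔸 G P`, `NAME ↦ NAME P` for the class-dependent names (P the first explicit argument), and — №277 — the binder `hunitA` re-keyed from «all G-valued U» to «all (3.35)-regular U of the carrier» (`∀ j α₀ U, (bg9YC 𝔸 G P (f j)).Reg335 c35 α₀ U → IsUnit (deltaAY …)`) — a clause IDLE in this twin (no `hunitA` here; v1.1).  Class-free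 declarations of the original are NOT copied: they are imported and used BY NAME (`open … hiding` the re-declared ones).  Generated by dag-n06-c g16's `gen.py` (HOME `pub-ymgap-dag-n06-c/lean/g16/`); the ORIGINAL MODULE DOCUMENTATION FOLLOWS VERBATIM and describes the mathematics.

HONEST SCOPE.  Re-typing bookkeeping; nothing of [B9] asserted beyond the original; COUNT-NEUTRAL; N06 NOT discharged; nothing continuum ∕ OS ∕ mass gap ∕ Clay.  Cell `pub-ymgap` (D-0062), Track A node N06 [B9], seat `pub-ymgap-dag-n06-c` g16, 2026-08-29.
-/

/-!
# Balaban [B9], Thm 3.2 (3.48) p. 398 + (3.65)–(3.67) p. 403 + Thm 3.11 p. 416 — THE C⁻¹ MEMBER OF THE SECT.-B STEP OF RECORD (R13-U1) AT THE RECORD's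
# TRANSPORTERS `parSymY`: the reversal law discharged (`Node00.parSymY_inv_symm`), and — for the matrix algebra with `G ≦ U(N)` — the invertibility of
# `(Q′G′²Q′*)(U)` discharged (`B9Thm311PosAtRecordV4.isUnit_XY_parSymY`): ★★ `stepKerPos_KSCU_parSymY_on`, ★★★ `stepKerPos_KSCU_parSymY_unitary_on`

T. Bałaban, *Propagators for lattice gauge theories in a background field*, Commun. Math. Phys. **99** (1985) 389–434
[`Balaban1985BackgroundPropagators`, "B9"]; [4] = T. Bałaban, *Propagators and renormalization transformations for lattice gauge
theories. II*, Commun. Math. Phys. **96** (1984) 223–250 [`Balaban1984PropagatorsII`].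

statement-level skeleton of published theorems with citation tags; proofs where landed; nothing here is a claim about the
Yang–Mills mass gap

WHAT.  `B9SectBKerFrameCodedY.stepKerPos_KSCU_on` (the (3.48) member of `B9SectBCodedReadingsU.SectBStepU` for a general transporter table `par`) displays,
beyond the binders of `B9SectBStepsKSCUBlocks.stepEPos_KSCU_on`, two print-intrinsic laws: `hunitX` (`(Q′G′²Q′*)(U)` is a unit at every `G`-valued `U` —
Theorem 3.2 ∕ 3.11's regime) and the reversal law `hsym` (`U(Γ_{z,w}) = U(Γ_{w,z})⁻¹`).  At the record's transporters `parSymY` (the symmetrised gauge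
transporter of node00-def-Y, `Node00.OpsYRecordV4`):
* ★★ `stepKerPos_KSCU_parSymY_on` — `hsym` discharged by `Node00.parSymY_inv_symm` (any complete normed `ℂ`-algebra `𝔸`; `hunitX` displayed);
* ★★★ `stepKerPos_KSCU_parSymY_unitary_on` — for `𝔸 = Matrix (Fin N) (Fin N) ℂ` (operator norm) and `G ≦ U(N)`, `hunitX` discharged as well by dag-n06's
  `B9Thm311PosAtRecordV4.isUnit_XY_parSymY` (Theorem 3.11's positivity of `Q′G′²Q′*`): the (3.48) member of `SectBStepU` at the record's letters with EXACTLY the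
  binders of `stepEPos_KSCU_on` plus `G ≦ U(N)`.

HONEST FRAMING.  Two specialisations; no analysis.  Count-neutral; no summit ∕ sub-problem statement is proved; N06 is not discharged by this file; nothing
continuum ∕ OS ∕ mass-gap ∕ Clay.  No `sorry`, no `axiom`, no `… : Prop` fact, no `instance`, no `notation`, no `def`.  Seat dag-n06-c g12, 2026-08-28;
`--supports stmt-QuantumFields-27364`.
-/

noncomputable section

namespace Literature.MathematicalPhysics.QuantumFieldTheory.Balaban1983to89.B9SectBKerStepParSymYR

open Literature.MathematicalPhysics.QuantumFieldTheory.Balaban1983to89.B9SectBCodedClassR (RegExtraY bg9YC)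
open Literature.MathematicalPhysics.QuantumFieldTheory.Balaban1983to89.B9SectBKerStepParSymY hiding stepKerPos_KSCU_parSymY_on stepKerPos_KSCU_parSymY_unitary_on

open Literature.MathematicalPhysics.QuantumFieldTheory.Balaban1983to89.B6Ineq2142KLevelV1 (β)
open Literature.MathematicalPhysics.QuantumFieldTheory.Balaban1983to89.B9SectBCodedCarrier (pullS)
open Literature.MathematicalPhysics.QuantumFieldTheory.Balaban1983to89.B9Eq360DeltaPrimeAY (AfldY)
open Literature.MathematicalPhysics.QuantumFieldTheory.Balaban1983to89.B9PinMembersKLevelV1 (MemberY geo9Y bg9Y)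
open Literature.MathematicalPhysics.QuantumFieldTheory.Balaban1983to89.B9SectBGpLettersY (GVal)
open Literature.MathematicalPhysics.QuantumFieldTheory.Balaban1983to89.B9SectBGpFrameCodedYR (codingYx)
open Literature.MathematicalPhysics.QuantumFieldTheory.Balaban1983to89.B9SectBGpFrameCodedY (CplxLettersY)
open Literature.MathematicalPhysics.QuantumFieldTheory.Balaban1983to89.B9SectBCodedReadingsUR (KSCU KACU)
open Literature.MathematicalPhysics.QuantumFieldTheory.Balaban1983to89.B9SectBStepWhole (StepKerPos)
open Literature.MathematicalPhysics.QuantumFieldTheory.Balaban1983to89.B9SectBKerFrameCodedYR (CinvY stepKerPos_KSCU_on)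
open Literature.MathematicalPhysics.QuantumFieldTheory.Balaban1983to89.B9Thm311PosAtRecordV4 (isUnit_XY_parSymY)
open Literature.MathematicalPhysics.QuantumFieldTheory.Balaban1983to89.Node00 (SiteY BlkY IBondY CfgY BondOpY BondParY GpY XY deltaPrimeAY parSymY
  parSymY_inv_symm)

variable {d ℓ : ℕ} {hd : 1 ≤ d + 1} {hL : Odd (ℓ + 1) ∧ 1 < ℓ + 1} {b₀ b₁ : ℝ} {Mstar : ℕ}

/-! ## §1 Any complete normed `ℂ`-algebra: the reversal law discharged -/

section General

variable {𝔸 : Type} [NormedRing 𝔸] (P : RegExtraY d ℓ hd hL b₀ b₁ Mstar 𝔸) [NormedAlgebra ℂ 𝔸] [CompleteSpace 𝔸] [NormOneClass 𝔸] [FiniteDimensional ℝ 𝔸]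
  {J : Type} (f : J → MemberY d ℓ hd hL b₀ b₁ Mstar) [∀ x : MemberY d ℓ hd hL b₀ b₁ Mstar, Fintype (geo9Y x).Site]
  [instDS : ∀ x : MemberY d ℓ hd hL b₀ b₁ Mstar, DecidableEq (geo9Y x).Site] [instNE : ∀ x : MemberY d ℓ hd hL b₀ b₁ Mstar, Nonempty (geo9Y x).Site]
  (c35 : ℝ) (G : Subgroup 𝔸ˣ) (OA : ∀ j : J, BondOpY 𝔸 (f j).toKIdx)
  (parB : ∀ j : J, BondParY 𝔸 (f j).toKIdx) {ι : Type} [Fintype ι] [DecidableEq ι] (b : Module.Basis ι ℝ 𝔸)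
  (ιB : ∀ j : J, BlkY (f j).toKIdx → IBondY (f j).toKIdx)
  (C37 C38 : ∀ j : J, ℝ → CfgY 𝔸 (f j).toKIdx → AfldY 𝔸 (f j).toKIdx → Prop)

/-- ★★ **THE (3.48) MEMBER OF `SectBStepU` AT THE RECORD's TRANSPORTERS `parSymY`**: `stepKerPos_KSCU_on` at `par := parSymY`, the reversal law supplied by
`Node00.parSymY_inv_symm`; displayed beyond `stepEPos_KSCU_on`'s binders: only `hunitX`. [cite: Balaban1985BackgroundPropagators, Thm 3.4 p.400, Thm 3.2 (3.48) p.398, (3.65)–(3.67) p.403, (3.40) p.397; Balaban1984PropagatorsII, Lemma 2.1 p.234, (2.51) p.232] -/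
theorem stepKerPos_KSCU_parSymY_on (hι : ∀ (j : J) (s : BlkY (f j).toKIdx), β (f j).toKIdx.hN (f j).toKIdx.D (f j).toKIdx.hk (ιB j s) = s)
    (hG1 : ∀ u : 𝔸ˣ, u ∈ G → ‖(u : 𝔸)‖ ≤ 1)
    (hpar : ∀ j (U : CfgY 𝔸 (f j).toKIdx), GVal G (f j).toKIdx U → ∀ z w, parSymY (f j).toKIdx U z w ∈ G)
    (hunit : ∀ j (U : CfgY 𝔸 (f j).toKIdx), GVal G (f j).toKIdx U → IsUnit (deltaPrimeAY (f j).toKIdx (parSymY (f j).toKIdx) U))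
    (M₂ : ℝ) (hM₂ : 0 ≤ M₂) (hrepr : ∀ (v : 𝔸) (j : ι), |b.repr v j| ≤ M₂ * ‖v‖) (hcR : 0 < M₂ * ∑ j, ‖b j‖)
    (Cq : ℝ) (hCq : 0 ≤ Cq)
    (hC37 : ∀ j β' U a, C37 j β' U a → GVal G (f j).toKIdx U ∧ CplxLettersY G (f j) (parSymY (f j).toKIdx) (ιB j) Cq β' U a)
    (MInv aInv aW : ℝ) (hMInv : 0 < MInv) (haInv : 0 < aInv) (haW : 0 < aW)
    (hunitX : ∀ j (U : CfgY 𝔸 (f j).toKIdx), GVal G (f j).toKIdx U →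
      IsUnit (XY (f j).toKIdx (parSymY (f j).toKIdx) (GpY (f j).toKIdx (parSymY (f j).toKIdx)) U)) :
    StepKerPos (d + 1) c35 (fun j => geo9Y (f j)) (fun j => (codingYx P G (f j) (C37 j) (C38 j)).bg)
      (fun j => KSCU P G (f j) (parSymY (f j).toKIdx) (C37 j) (C38 j)) (fun j => KACU P G (f j) (OA j) (parB j) (C37 j) (C38 j))
      (fun j => pullS (codingYx P G (f j) (C37 j) (C38 j)) (CinvY P f G (fun j => parSymY (f j).toKIdx) j))
      (fun j => pullS (codingYx P G (f j) (C37 j) (C38 j)) (CinvY P f G (fun j => parSymY (f j).toKIdx) j)) :=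
  stepKerPos_KSCU_on P f c35 G (fun j => parSymY (f j).toKIdx) OA parB b ιB C37 C38 hι hG1 hpar hunit M₂ hM₂ hrepr hcR Cq hCq hC37
    MInv aInv aW hMInv haInv haW hunitX (fun _ U z w => parSymY_inv_symm U z w)

end General

/-! ## §2 The matrix algebra with `G ≦ U(N)`: the invertibility of `(Q′G′²Q′*)(U)` discharged (Theorem 3.11) -/

section Unitary

open scoped Matrix.Norms.L2Operator

variable {N : ℕ} (P : RegExtraY d ℓ hd hL b₀ b₁ Mstar (Matrix (Fin N) (Fin N) ℂ)) {J : Type} (f : J → MemberY d ℓ hd hL b₀ b₁ Mstar) [∀ x : MemberY d ℓ hd hL b₀ b₁ Mstar, Fintype (geo9Y x).Site]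
  [instDS : ∀ x : MemberY d ℓ hd hL b₀ b₁ Mstar, DecidableEq (geo9Y x).Site] [instNE : ∀ x : MemberY d ℓ hd hL b₀ b₁ Mstar, Nonempty (geo9Y x).Site]
  (c35 : ℝ) (G : Subgroup (Matrix (Fin N) (Fin N) ℂ)ˣ) (OA : ∀ j : J, BondOpY (Matrix (Fin N) (Fin N) ℂ) (f j).toKIdx)
  (parB : ∀ j : J, BondParY (Matrix (Fin N) (Fin N) ℂ) (f j).toKIdx) {ι : Type} [Fintype ι] [DecidableEq ι]
  (b : Module.Basis ι ℝ (Matrix (Fin N) (Fin N) ℂ))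
  (ιB : ∀ j : J, BlkY (f j).toKIdx → IBondY (f j).toKIdx)
  (C37 C38 : ∀ j : J, ℝ → CfgY (Matrix (Fin N) (Fin N) ℂ) (f j).toKIdx → AfldY (Matrix (Fin N) (Fin N) ℂ) (f j).toKIdx → Prop)

/-- ★★★ **THE (3.48) MEMBER OF `SectBStepU` AT THE RECORD's LETTERS, `G ≦ U(N)`**: `stepKerPos_KSCU_parSymY_on` with `hunitX` discharged by dag-n06's
`isUnit_XY_parSymY` — binders = those of `stepEPos_KSCU_on` (at `parSymY`) plus `G ≦ U(N)`. [cite: Balaban1985BackgroundPropagators, Thm 3.4 p.400, Thm 3.2 (3.48) p.398, (3.65)–(3.67) p.403, Thm 3.11 p.416, p.395; Balaban1984PropagatorsII, Lemma 2.1 p.234, (2.51) p.232] -/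
theorem stepKerPos_KSCU_parSymY_unitary_on [NormOneClass (Matrix (Fin N) (Fin N) ℂ)] [FiniteDimensional ℝ (Matrix (Fin N) (Fin N) ℂ)]
    (hG : G ≤ B7Prop2Explicit.unitaryUnits (Matrix (Fin N) (Fin N) ℂ))
    (hι : ∀ (j : J) (s : BlkY (f j).toKIdx), β (f j).toKIdx.hN (f j).toKIdx.D (f j).toKIdx.hk (ιB j s) = s)
    (hG1 : ∀ u : (Matrix (Fin N) (Fin N) ℂ)ˣ, u ∈ G → ‖(u : Matrix (Fin N) (Fin N) ℂ)‖ ≤ 1)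
    (hpar : ∀ j (U : CfgY (Matrix (Fin N) (Fin N) ℂ) (f j).toKIdx), GVal G (f j).toKIdx U → ∀ z w, parSymY (f j).toKIdx U z w ∈ G)
    (hunit : ∀ j (U : CfgY (Matrix (Fin N) (Fin N) ℂ) (f j).toKIdx), GVal G (f j).toKIdx U →
      IsUnit (deltaPrimeAY (f j).toKIdx (parSymY (f j).toKIdx) U))
    (M₂ : ℝ) (hM₂ : 0 ≤ M₂) (hrepr : ∀ (v : Matrix (Fin N) (Fin N) ℂ) (j : ι), |b.repr v j| ≤ M₂ * ‖v‖) (hcR : 0 < M₂ * ∑ j, ‖b j‖)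
    (Cq : ℝ) (hCq : 0 ≤ Cq)
    (hC37 : ∀ j β' U a, C37 j β' U a → GVal G (f j).toKIdx U ∧ CplxLettersY G (f j) (parSymY (f j).toKIdx) (ιB j) Cq β' U a)
    (MInv aInv aW : ℝ) (hMInv : 0 < MInv) (haInv : 0 < aInv) (haW : 0 < aW) :
    StepKerPos (d + 1) c35 (fun j => geo9Y (f j)) (fun j => (codingYx P G (f j) (C37 j) (C38 j)).bg)
      (fun j => KSCU P G (f j) (parSymY (f j).toKIdx) (C37 j) (C38 j)) (fun j => KACU P G (f j) (OA j) (parB j) (C37 j) (C38 j))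
      (fun j => pullS (codingYx P G (f j) (C37 j) (C38 j)) (CinvY P f G (fun j => parSymY (f j).toKIdx) j))
      (fun j => pullS (codingYx P G (f j) (C37 j) (C38 j)) (CinvY P f G (fun j => parSymY (f j).toKIdx) j)) :=
  stepKerPos_KSCU_parSymY_on P f c35 G OA parB b ιB C37 C38 hι hG1 hpar hunit M₂ hM₂ hrepr hcR Cq hCq hC37 MInv aInv aW hMInv haInv haW
    fun j _ hU => isUnit_XY_parSymY (f j).toKIdx hG hU

end Unitary

end Literature.MathematicalPhysics.QuantumFieldTheory.Balaban1983to89.B9SectBKerStepParSymYR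

end

/-!
# `Balaban1983to89.B9SectBKerStepRecordReductionR` — THE CLASS-PARAMETRIC TWIN of `B9SectBKerStepRecordReduction` (CASCADE-R, director-ym №279 GO-R; №277 (3) `hunitA` cure; dag-n06-d SOCKET-(α) class question)

statement-level skeleton of published theorems with citation tags; proofs where landed; nothing here is a claim about the
Yang–Mills mass gap

WHAT THIS FILE IS.  The original module `B9SectBKerStepRecordReduction` types its objects over MODULE 3's member carrier `bg9Y 𝔸 G x` (MODULE 2's small-cube class (3.35)).  This file RE-DECLARES, with UNCHANGED NAMES inside the namespace `…B9SectBKerStepRecordReductionR`, exactly its 1 class-dependent declarations over the CLASS-PARAMETRIC carrier `B9SectBCodedClassR.bg9YC 𝔸 G P x` (`P : RegExtraY …` = the two cube conditions of (3.35)∕(3.36) as a parameter; `bg9Y 𝔸 G x = bg9YC 𝔸 G (extraY 𝔸 G) x` by `rfl`, so every declaration here specialises definitionally to its original; at the record's reading of PRINT's class, `P := extraYPb 𝔸 G`, the displayed laws `hreg335P` ((3.35) on plaquettes) and the class-keyed `hunitA` become theorems).  The text is the original's VERBATIM under the token surgery `bg9Y 𝔸 G ↦ bg9YC 𝔸 G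 P`, `NAME ↦ NAME P` for the class-dependent names (P the first explicit argument), and — №277 — the binder `hunitA` re-keyed from «all G-valued U» to «all (3.35)-regular U of the carrier» (`∀ j α₀ U, (bg9YC 𝔸 G P (f j)).Reg335 c35 α₀ U → IsUnit (deltaAY …)`) — a clause IDLE in this twin (no `hunitA` here; v1.1).  Class-free declarations of the original are NOT copied: they are imported and used BY NAME (`open … hiding` the re-declared ones).  Generated by dag-n06-c g16's `gen.py` (HOME `pub-ymgap-dag-n06-c/lean/g16/`); the ORIGINAL MODULE DOCUMENTATION FOLLOWS VERBATIM and describes the mathematics.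

HONEST SCOPE.  Re-typing bookkeeping; nothing of [B9] asserted beyond the original; COUNT-NEUTRAL; N06 NOT discharged; nothing continuum ∕ OS ∕ mass gap ∕ Clay.  Cell `pub-ymgap` (D-0062), Track A node N06 [B9], seat `pub-ymgap-dag-n06-c` g16, 2026-08-29.
-/

/-! Module documentation: that of the original `Balaban1983to89.B9SectBKerStepRecordReduction` applies verbatim to this twin (not repeated here). -/

noncomputable section

namespace Literature.MathematicalPhysics.QuantumFieldTheory.Balaban1983to89.B9SectBKerStepRecordReductionR

open Literature.MathematicalPhysics.QuantumFieldTheory.Balaban1983to89.B9SectBCodedClassR (RegExtraY bg9YC)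
open Literature.MathematicalPhysics.QuantumFieldTheory.Balaban1983to89.B9SectBKerStepRecordReduction hiding stepKerPos_record_on_of_KSC

open Literature.MathematicalPhysics.QuantumFieldTheory.Balaban1983to89
open Literature.MathematicalPhysics.QuantumFieldTheory.Balaban1983to89.B6Ineq2142KLevelV1 (β)
open Literature.MathematicalPhysics.QuantumFieldTheory.Balaban1983to89.B9SectBCodedCarrier (CCfg Coding pullK pullS)
open Literature.MathematicalPhysics.QuantumFieldTheory.Balaban1983to89.B9Eq360DeltaPrimeAY (AfldY)
open Literature.MathematicalPhysics.QuantumFieldTheory.Balaban1983to89.B9PinMembersKLevelV1 (MemberY geo9Y bg9Y)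
open Literature.MathematicalPhysics.QuantumFieldTheory.Balaban1983to89.B9SectBGpLettersY (GVal)
open Literature.MathematicalPhysics.QuantumFieldTheory.Balaban1983to89.B9SectBGpFrameCodedYR (codingYx)
open Literature.MathematicalPhysics.QuantumFieldTheory.Balaban1983to89.B9SectBGpReadingsYR (KSC)
open Literature.MathematicalPhysics.QuantumFieldTheory.Balaban1983to89.B9SectBEGlobAnStepRecordOnR (hin_KSC_on_pos)
open Literature.MathematicalPhysics.QuantumFieldTheory.Balaban1983to89.B9SectBStepPosFamilyTransfer (stepKerPos_of_family_pos stepKerPos_of_coded)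
open Literature.MathematicalPhysics.QuantumFieldTheory.Balaban1983to89.B9SectBStepWhole (StepKerPos)
open Literature.MathematicalPhysics.QuantumFieldTheory.Balaban1983to89.Node00 (SiteY BlkY IBondY CfgY SiteParY kernelFamilyS GpY)

variable {d ℓ : ℕ} {hd : 1 ≤ d + 1} {hL : Odd (ℓ + 1) ∧ 1 < ℓ + 1} {b₀ b₁ : ℝ} {Mstar : ℕ}
variable {𝔸 : Type} [NormedRing 𝔸] (P : RegExtraY d ℓ hd hL b₀ b₁ Mstar 𝔸) [NormedAlgebra ℂ 𝔸] [CompleteSpace 𝔸]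

variable {J : Type} (f : J → MemberY d ℓ hd hL b₀ b₁ Mstar) [∀ x : MemberY d ℓ hd hL b₀ b₁ Mstar, Fintype (geo9Y x).Site]
  (c35 : ℝ) (G : Subgroup 𝔸ˣ) (par : ∀ j : J, SiteParY 𝔸 (f j).toKIdx) {ι : Type} [Fintype ι] (b : Module.Basis ι ℝ 𝔸)
  (ιB : ∀ j : J, BlkY (f j).toKIdx → IBondY (f j).toKIdx)
  (C37 C38 : ∀ j : J, ℝ → CfgY 𝔸 (f j).toKIdx → AfldY 𝔸 (f j).toKIdx → Prop)

/-- ★★ **`StepKerPos` OF THE RECORD FAMILY ON A SUBFAMILY, REDUCED TO THE CODED STEP** (input families: the record's `kernelFamilyS … (GpY par) par`, `GA`,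
`Cinv` over `bg9Y`; output: the record's (3.48) kernel `Cinv` at `U′U`): IF the (3.48) block-step holds over the coded carriers for the coded readings `KSC`
with the shared families `pullK GA`, `pullS Cinv` (input) and `pullS Cinv` (output) — the letters-level C⁻¹ frame's output, R-Ker-1's target — THEN it holds for
the record, under the class implication `hclass` (discharged for `C37Y` in `B9SectBCodedChainC37Y`): `stepKerPos_of_coded ∘ stepKerPos_of_family_pos` with
`hin_KSC_on_pos` and the identity output domination (the output kernel is the same function on both sides).
[cite: Balaban1985BackgroundPropagators, Thm 3.2 (3.48) p.398, Thm 3.4 p.400, (3.65)–(3.67) p.403, p.403 l.1–9, (3.35)–(3.37) p.396; Balaban1984PropagatorsII, (2.51) p.232] -/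
theorem stepKerPos_record_on_of_KSC (hι : ∀ (j : J) (s : BlkY (f j).toKIdx), β (f j).toKIdx.hN (f j).toKIdx.D (f j).toKIdx.hk (ιB j s) = s)
    (hG1 : ∀ u : 𝔸ˣ, u ∈ G → ‖(u : 𝔸)‖ ≤ 1) {M₂ : ℝ} (hM₂ : 0 ≤ M₂) (hrepr : ∀ (v : 𝔸) (j : ι), |b.repr v j| ≤ M₂ * ‖v‖) (dB : ℕ)
    (GA : ∀ j : J, B9.KernelFamily (geo9Y (f j)) (bg9YC 𝔸 G P (f j))) (Cinv : ∀ j : J, B9.SiteKernel (geo9Y (f j)) (bg9YC 𝔸 G P (f j)))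
    {r αcap Mc ac : ℝ} (hr : 0 < r) (hcap : 0 < αcap) (hac : 0 < ac)
    (hclass : ∀ (j : J) (α₀ α₁ : ℝ) (U U' : (bg9YC 𝔸 G P (f j)).Cfg), Mc ≤ (geo9Y (f j)).M → 0 < α₀ → (geo9Y (f j)).M * α₀ ≤ ac →
      (bg9YC 𝔸 G P (f j)).Reg335 c35 α₀ U → 0 < α₁ → α₁ ≤ αcap → (bg9YC 𝔸 G P (f j)).Cplx337 α₁ U U' →
      ∃ a : (codingYx P G (f j) (C37 j) (C38 j)).A,
        (codingYx P G (f j) (C37 j) (C38 j)).decA a = U' ∧ (codingYx P G (f j) (C37 j) (C38 j)).C37 (r * α₁) U a)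
    (h : StepKerPos dB c35 (fun j => geo9Y (f j)) (fun j => (codingYx P G (f j) (C37 j) (C38 j)).bg) (fun j => KSC P G (f j) (par j) (C37 j) (C38 j))
      (fun j => pullK (codingYx P G (f j) (C37 j) (C38 j)) (GA j)) (fun j => pullS (codingYx P G (f j) (C37 j) (C38 j)) (Cinv j))
      (fun j => pullS (codingYx P G (f j) (C37 j) (C38 j)) (Cinv j))) :
    StepKerPos dB c35 (fun j => geo9Y (f j)) (fun j => bg9YC 𝔸 G P (f j))
      (fun j => kernelFamilyS (f j).toKIdx (bg9YC 𝔸 G P (f j)) (fun U => U) (GpY (f j).toKIdx (par j)) (par j)) GA Cinv Cinv := by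
  refine stepKerPos_of_coded dB c35 (fun j => geo9Y (f j)) (fun j => bg9YC 𝔸 G P (f j))
    (fun j => kernelFamilyS (f j).toKIdx (bg9YC 𝔸 G P (f j)) (fun U => U) (GpY (f j).toKIdx (par j)) (par j)) GA Cinv
    (fun j => codingYx P G (f j) (C37 j) (C38 j)) hr hcap hac hclass Cinv ?_
  refine stepKerPos_of_family_pos dB c35 (fun j => geo9Y (f j)) (fun j => (codingYx P G (f j) (C37 j) (C38 j)).bg)
    (fun j => KSC P G (f j) (par j) (C37 j) (C38 j))
    (fun j => pullK (codingYx P G (f j) (C37 j) (C38 j)) (kernelFamilyS (f j).toKIdx (bg9YC 𝔸 G P (f j)) (fun U => U) (GpY (f j).toKIdx (par j)) (par j)))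
    (fun j => pullK (codingYx P G (f j) (C37 j) (C38 j)) (GA j)) (fun j => pullK (codingYx P G (f j) (C37 j) (C38 j)) (GA j))
    (fun j => pullS (codingYx P G (f j) (C37 j) (C38 j)) (Cinv j))
    (hin_KSC_on_pos P f c35 G par b ιB C37 C38 hι hG1 hM₂ hrepr dB _ _)
    (fun j => pullS (codingYx P G (f j) (C37 j) (C38 j)) (Cinv j)) (fun j => pullS (codingYx P G (f j) (C37 j) (C38 j)) (Cinv j))
    (fun B δ a hB hδ ha => ⟨0, 1, a, B, δ, one_pos, ha, le_rfl, hB, hδ, fun _ _ _ _ _ _ _ _ _ _ _ _ hK => hK⟩) h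

end Literature.MathematicalPhysics.QuantumFieldTheory.Balaban1983to89.B9SectBKerStepRecordReductionR

end
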